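import Literature.Computability.Complexity.CookLevinTableau
import Literature.Computability.Complexity.Nondeterministic
import Literature.Computability.ImplicitComplexity.SoftTypeAssignmentPass
import Literature.Computability.ImplicitComplexity.SoftTypeAssignmentTypingKit
import Mathlib.Algebra.Polynomial.Degree.Defs
import Mathlib.Algebra.Polynomial.Eval.Defs
import HarnessLib

/-!
# NP-completeness of `STA₊` (GMR08 Thm. 5.14): every language of NP is soft-sum-representable

One module for the whole completeness half of `STAPlusCapturesNP` (GMR08 = Gaboardi–Marion–Ronchi
Della Rocca 2008, *Soft Linear Logic and Polynomial Complexity Classes*, **Thm. 5.14**: "a decision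
problem decidable by a nondeterministic Turing machine in polynomial time is definable by a term of
`STA₊`", the transition RELATION being programmed as the SUM of deterministic transition terms),
above `SoftTypeAssignmentPass.lean` (one transducer pass over a Church list) and
`SoftTypeAssignmentTypingKit.lean` (admissible typing rules, data types). For the tree's verifier
class `NP = polyExists P` over `FinTM2` deciders, the program of `L` (verifier `M` for `L'`,
certificate bound `p`) is `M_L = λs. OUT (T̲(s) CASTEP (P̲(s) (W_□ + W₀ + W₁) (ROW0 PAD̲(s) s)))`:
build the start row of `⟨x, ·⟩`, let `p(|x|)` nondeterministic passes write a certificate `u`,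
run `T(|x|)` steps of the tree's Cook–Levin tableau of `M` (`Complexity/TableauStep`,
`Complexity/CookLevinTableau`), read the answer. The parts, in dependency order, each with its own
section docstring below:

* Part `TypedCombinators` — `STA₊` typings of the pass combinators (GMR08 Table 2, §3.2);
* Part `Trees` — transition trees of finite functions as terms (`treeOf`, `mealyPass`, `outProg`);
* Part `Numerals` — Church numerals, `NumLike` semantics, indexed typings of `len/add/mult`
  (GMR08 §3.2);
* Part `TableauCA` — one `FinTM2` tableau step as a one-pass transducer on stored rows (`castep`);
* Part `TableauIO` — start rows, certificate-writing passes, the acceptance fold (GMR08 Thm. 3.9,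
  Thm. 5.14);
* Part `Horner` — GMR08 Lemma 3.6: polynomials of the input length as typed numerals;
* Part `Row0` — the start-row program `ROW0` (GMR08 Thm. 3.9 `Init`) and `merge_slots`;
* Part `NPProgram` — the assembly: `prog`, `decides_prog`, `typing_prog` and
  `exists_softSum_of_mem_NP : L ∈ NP → ∃ t, SoftSumRepresentsAtLevel t L`, **GMR08 Thm. 5.14 on the
  tree's classes**.

## References

* [GaboardiMarionRonchidellarocca2008] GMR08, §3.2, Lemma 3.6, Thm. 3.9, Table 2, Thm. 5.14, Def. 5.13.
* [AroraBarak2009] Def. 2.1 (NP by polynomial-time verifiers).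
-/

-- ============================== Part: TypedCombinators ==============================

/-!
## Part `TypedCombinators`: `STA₊` typings of the combinators of a pass

Typing derivations (GMR08 = Gaboardi–Marion–Ronchi Della Rocca 2008, Table 2 + Table 5), in the
tree's de Bruijn system `STA.Typing`, of the programs of `SoftTypeAssignmentPass.lean`:
selectors `oneHot q i : tyE q`, decision trees `caseT1`/`caseT2`, the pair `PAIR` at
`C ⊸ A ⊸ STof C A` (GMR08 §3.2 `⟨M, N⟩`, also at an OPEN component type `A`, by `(∀I)` over the
shifted context), `1` as the second projection, leaves `LEAF`, the step `STEPc`, the pass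
combinator `passC S I F : Rty j U ⊸ Rty j U` (one fold = one transition term `Trᵢ : TM ⊸ TM` of
GMR08 Thm. 5.14, the promotion `(sp)ʲ` of the step being what the modality `!ʲ` of the row type
pays for), sums of passes, iteration by a numeral, and the acceptance program `OUTc`.

## References

* [GaboardiMarionRonchidellarocca2008] Table 2, Table 5, §3.2, Thm. 5.14.
-/

namespace Literature.Computability.ImplicitComplexity

namespace STA

open Term

/-! ### Small helpers on list contexts -/

/-- A closed typing placed in a list of empty slots. [folklore] -/
theorem TypingLe.inNones {D : ℕ} {M : Term} {σ : SoftTy} (h : TypingLe D Ctx.empty M σ) (l : List (Option SoftTy))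
    (hl : ∀ a ∈ l, a = none) : TypingLe D (Ctx.ofList l) M σ := by
  have : l = List.replicate l.length none := List.eq_replicate_iff.2 ⟨rfl, hl⟩
  rw [this]; exact h.emptyL _

/-- The trivial split keeping everything on the left. [folklore] -/
theorem splitL_left (l : List (Option SoftTy)) : SplitL l l (List.replicate l.length none) := by
  induction l with
  | nil => trivial
  | cons a l ih => exact ⟨Or.inl ⟨rfl, rfl⟩, ih⟩

/-- The trivial split keeping everything on the right. [folklore] -/
theorem splitL_right (l : List (Option SoftTy)) : SplitL l (List.replicate l.length none) l := by
  induction l with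
  | nil => trivial
  | cons a l ih => exact ⟨Or.inr ⟨rfl, rfl⟩, ih⟩

/-- Applying a term to closed arguments of the argument type of an `arr`. [cite: GaboardiMarionRonchidellarocca2008, Table 2 (⊸E)] -/
theorem typingLe_apps_closed {D : ℕ} {l : List (Option SoftTy)} {M : Term} {X R : LinTy} :
    ∀ {q : ℕ} {args : List Term}, TypingLe D (Ctx.ofList l) M ⟨0, arr q X R⟩ → args.length = q →
      (∀ a ∈ args, TypingLe D Ctx.empty a ⟨0, X⟩) → TypingLe D (Ctx.ofList l) (M.apps args) ⟨0, R⟩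
  | 0, [], h, _, _ => h
  | 0, _ :: _, _, hlen, _ => absurd hlen (by simp)
  | _ + 1, [], _, hlen, _ => absurd hlen (by simp)
  | q + 1, a :: args, h, hlen, hargs => by
    rw [arr_succ] at h
    rw [apps_cons]
    refine typingLe_apps_closed (q := q) ?_ (by simpa using hlen) fun b hb => hargs b (by simp [hb])
    exact TypingLe.appL (splitL_left l) h ((hargs a (by simp)).emptyL _)

/-- Iterated abstraction over linear binders of one type. [cite: GaboardiMarionRonchidellarocca2008, Table 2 (⊸I)] -/
theorem typingLe_lams {D : ℕ} {X R : LinTy} {B : Term} :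
    ∀ (q : ℕ) (l : List (Option SoftTy)), TypingLe D (Ctx.ofList (List.replicate q (some ⟨0, X⟩) ++ l)) B ⟨0, R⟩ →
      TypingLe D (Ctx.ofList l) (lams q B) ⟨0, arr q X R⟩
  | 0, _, h => h
  | q + 1, l, h => by
    rw [lams_succ, arr_succ]
    refine TypingLe.lamL (typingLe_lams q _ ?_)
    rwa [List.replicate_succ', List.append_assoc, List.singleton_append] at h

/-- Iterated `(sp)` on list contexts. [cite: GaboardiMarionRonchidellarocca2008, Table 2 (sp)] -/
theorem TypingLe.spNL {D : ℕ} {M : Term} {k : ℕ} {A : LinTy} :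
    ∀ (n : ℕ) {l : List (Option SoftTy)}, TypingLe D (Ctx.ofList l) M ⟨k, A⟩ →
      TypingLe (D + n) (Ctx.ofList (l.map fun a => a.map fun σ => ⟨σ.bangs + n, σ.lin⟩)) M ⟨k + n, A⟩
  | 0, l, h => by
    have : (l.map fun a => a.map fun σ : SoftTy => (⟨σ.bangs + 0, σ.lin⟩ : SoftTy)) = l := by
      refine (List.map_congr_left fun a _ => ?_).trans (List.map_id' l)
      cases a <;> rfl
    rw [this]; exact h
  | n + 1, l, h => by
    have := (TypingLe.spNL n h).spL
    rw [List.map_map] at this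
    refine (this.of_eq_ctx ?_)
    congr 1
    refine List.map_congr_left fun a _ => ?_
    cases a with
    | none => rfl
    | some σ => simp [SoftTy.bang, Nat.add_assoc]

/-! ### Selectors and decision trees -/

/-- **`⊢ oneHot q i : tyE q`** (degree `0`). [cite: GaboardiMarionRonchidellarocca2008, §3.2] -/
theorem typingLe_oneHot {q i : ℕ} (hi : i < q) : TypingLe 0 Ctx.empty (oneHot q i) ⟨0, tyE q⟩ := by
  rw [← Ctx.ofList_nil]
  refine TypingLe.allIL ?_
  rw [List.map_nil]
  refine typingLe_lams q [] ?_
  rw [List.append_nil]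
  exact typingLe_var (by rw [List.getElem?_replicate, if_pos (by omega)]) le_rfl

/-- Bits are elements of `tyE 2`. [cite: GaboardiMarionRonchidellarocca2008, §3.2] -/
theorem typingLe_encBit (b : Bool) : TypingLe 0 Ctx.empty (encBit b) ⟨0, tyE 2⟩ := by
  cases b
  · rw [show encBit false = oneHot 2 0 from rfl]; exact typingLe_oneHot (by omega)
  · rw [show encBit true = oneHot 2 1 from rfl]; exact typingLe_oneHot (by omega)

/-- **`⊢ caseT1 l⃗ : tyE |l⃗| ⊸ X`** if every branch has type `X`. [cite: GaboardiMarionRonchidellarocca2008, §3.2] -/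
theorem typingLe_caseT1 {D : ℕ} {ls : List Term} {X : LinTy} (h : ∀ l ∈ ls, TypingLe D Ctx.empty l ⟨0, X⟩) :
    TypingLe D Ctx.empty (caseT1 ls) ⟨0, .limp 0 (tyE ls.length) X⟩ := by
  rw [← Ctx.ofList_nil]
  refine TypingLe.lamL ?_
  refine typingLe_apps_closed (q := ls.length) ?_ rfl h
  rw [← inst_arr_tvar]
  exact (typingLe_var (l := [some ⟨0, tyE ls.length⟩]) (i := 0) rfl (Nat.zero_le D)).allE _

/-- **`⊢ caseT2 rows : tyE |rows| ⊸ tyE k' ⊸ X`** if every leaf has type `X` and rows have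
length `k'`. [cite: GaboardiMarionRonchidellarocca2008, §3.2] -/
theorem typingLe_caseT2 {D : ℕ} {rows : List (List Term)} {k' : ℕ} {X : LinTy} (hlen : ∀ r ∈ rows, r.length = k')
    (h : ∀ r ∈ rows, ∀ l ∈ r, TypingLe D Ctx.empty l ⟨0, X⟩) :
    TypingLe D Ctx.empty (caseT2 rows) ⟨0, .limp 0 (tyE rows.length) (.limp 0 (tyE k') X)⟩ := by
  rw [← Ctx.ofList_nil, caseT2]
  refine TypingLe.lamL (TypingLe.lamL ?_)
  rw [apps_append, apps_cons, apps_nil]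
  refine TypingLe.appL (l₁ := [none, some ⟨0, tyE rows.length⟩]) (l₂ := [some ⟨0, tyE k'⟩, none])
    (by simp [SplitL]) ?_ (typingLe_var rfl (Nat.zero_le D))
  refine typingLe_apps_closed (q := rows.length) (X := .limp 0 (tyE k') X) ?_ (by simp) ?_
  · rw [← inst_arr_tvar]
    exact (typingLe_var (l := [none, some ⟨0, tyE rows.length⟩]) (i := 1) rfl (Nat.zero_le D)).allE _
  · intro b hb
    obtain ⟨r, hr, rfl⟩ := List.mem_map.1 hb
    rw [← hlen r hr]
    exact typingLe_caseT1 (h r hr)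

/-! ### Pairs, the second projection, leaves -/

/-- **`⊢ PAIR : C ⊸ A ⊸ STof C A`** (also for an open `A`). [cite: GaboardiMarionRonchidellarocca2008, §3.2] -/
theorem typingLe_PAIR (C A : LinTy) : TypingLe 0 Ctx.empty PAIR ⟨0, .limp 0 C (.limp 0 A (STof C A))⟩ := by
  rw [← Ctx.ofList_nil, PAIR]
  refine TypingLe.lamL (TypingLe.lamL ?_)
  refine TypingLe.allIL ?_
  simp only [List.map_cons, List.map_nil, Option.map_some, SoftTy.shift]
  refine TypingLe.lamL ?_
  simp only [lams_zero, apps_cons, apps_nil]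
  set C' := C.rename Nat.succ
  set A' := A.rename Nat.succ
  refine TypingLe.appL (l₁ := [some ⟨0, .limp 0 C' (.limp 0 A' (.tvar 0))⟩, none, some ⟨0, C'⟩])
    (l₂ := [none, some ⟨0, A'⟩, none]) (by simp [SplitL]) ?_ (typingLe_var rfl le_rfl)
  exact TypingLe.appL (l₁ := [some ⟨0, .limp 0 C' (.limp 0 A' (.tvar 0))⟩, none, none])
    (l₂ := [none, none, some ⟨0, C'⟩]) (by simp [SplitL]) (typingLe_var rfl le_rfl) (typingLe_var rfl le_rfl)

/-- **`⊢ 1 : C ⊸ A ⊸ A`** (`1 = λxy.y`, the second projection). [cite: GaboardiMarionRonchidellarocca2008, §3.2] -/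
theorem typingLe_one (C A : LinTy) : TypingLe 0 Ctx.empty one ⟨0, .limp 0 C (.limp 0 A A)⟩ := by
  rw [← Ctx.ofList_nil, one]
  exact TypingLe.lamL (TypingLe.lamL (typingLe_var (l := [some ⟨0, A⟩, some ⟨0, C⟩]) (i := 0) rfl le_rfl))

/-- **`⊢ 0 : C ⊸ A ⊸ C`** (`0 = λxy.x`, the first projection). [cite: GaboardiMarionRonchidellarocca2008, §3.2] -/
theorem typingLe_zero' (C A : LinTy) : TypingLe 0 Ctx.empty zero ⟨0, .limp 0 C (.limp 0 A C)⟩ := by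
  rw [← Ctx.ofList_nil, zero]
  exact TypingLe.lamL (TypingLe.lamL (typingLe_var (l := [some ⟨0, A⟩, some ⟨0, C⟩]) (i := 1) rfl le_rfl))

/-- The state type of a pass with control type `C`: `STof C α`. [folklore] -/
abbrev STc (C : LinTy) : LinTy := STof C (.tvar 0)

/-- **`⊢ LEAF q' e : (U ⊸ α ⊸ α) ⊸ α ⊸ STc C`**. [cite: GaboardiMarionRonchidellarocca2008, Thm. 5.14 (proof)] -/
theorem typingLe_LEAF {D : ℕ} {C U : LinTy} {q' e : Term} (hq : TypingLe D Ctx.empty q' ⟨0, C⟩)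
    (he : TypingLe D Ctx.empty e ⟨0, U⟩) :
    TypingLe D Ctx.empty (LEAF q' e) ⟨0, .limp 0 (Fty U) (.limp 0 (.tvar 0) (STc C))⟩ := by
  rw [← Ctx.ofList_nil, LEAF, Stq]
  refine TypingLe.lamL (TypingLe.lamL ?_)
  simp only [lams_zero, apps_cons, apps_nil]
  refine TypingLe.appL (l₁ := [none, none]) (l₂ := [some ⟨0, .tvar 0⟩, some ⟨0, Fty U⟩]) (k := 0) (B := .tvar 0)
    (by simp [SplitL]) ?_ ?_
  · refine TypingLe.appL (l₁ := [none, none]) (l₂ := [none, none]) (by simp [SplitL]) ?_ (hq.inNones _ (by simp))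
    exact ((typingLe_PAIR C (.tvar 0)).mono (Nat.zero_le D)).inNones _ (by simp)
  · refine TypingLe.appL (l₁ := [none, some ⟨0, Fty U⟩]) (l₂ := [some ⟨0, .tvar 0⟩, none]) (by simp [SplitL]) ?_
      (typingLe_var rfl (Nat.zero_le D))
    exact TypingLe.appL (l₁ := [none, some ⟨0, Fty U⟩]) (l₂ := [none, none]) (by simp [SplitL])
      (typingLe_var rfl (Nat.zero_le D)) (he.inNones _ (by simp))

/-! ### The step and the pass -/

/-- **`⊢ STEPc T : (U ⊸ α ⊸ α) ⊸ U ⊸ STc C ⊸ STc C`** for a transition tree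
`⊢ T : C ⊸ U ⊸ (U ⊸ α ⊸ α) ⊸ α ⊸ STc C`. [cite: GaboardiMarionRonchidellarocca2008, Thm. 5.14 (proof)] -/
theorem typingLe_STEPc {D : ℕ} {C U : LinTy} {T : Term}
    (hT : TypingLe D Ctx.empty T ⟨0, .limp 0 C (.limp 0 U (.limp 0 (Fty U) (.limp 0 (.tvar 0) (STc C))))⟩) :
    TypingLe D Ctx.empty (STEPc T) ⟨0, .limp 0 (Fty U) (.limp 0 U (.limp 0 (STc C) (STc C)))⟩ := by
  rw [← Ctx.ofList_nil, STEPc]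
  refine TypingLe.lamL (TypingLe.lamL (TypingLe.lamL ?_))
  simp only [lams_zero, lams_succ]
  refine TypingLe.appL (l₁ := [some ⟨0, STc C⟩, none, none]) (l₂ := [none, some ⟨0, U⟩, some ⟨0, Fty U⟩])
    (k := 0) (B := .limp 0 C (.limp 0 (.tvar 0) (STc C))) (by simp [SplitL]) ?_ ?_
  · have := (typingLe_var (l := [some ⟨0, STc C⟩, none, none]) (i := 0) rfl (Nat.zero_le D)).allE (STc C)
    rwa [inst_STof_body] at this
  · refine TypingLe.lamL (TypingLe.lamL ?_)
    simp only [apps_cons, apps_nil]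
    refine TypingLe.appL (l₁ := [none, some ⟨0, C⟩, none, some ⟨0, U⟩, some ⟨0, Fty U⟩])
      (l₂ := [some ⟨0, .tvar 0⟩, none, none, none, none]) (by simp [SplitL]) ?_ (typingLe_var rfl (Nat.zero_le D))
    refine TypingLe.appL (l₁ := [none, some ⟨0, C⟩, none, some ⟨0, U⟩, none])
      (l₂ := [none, none, none, none, some ⟨0, Fty U⟩]) (by simp [SplitL]) ?_ (typingLe_var rfl (Nat.zero_le D))
    refine TypingLe.appL (l₁ := [none, some ⟨0, C⟩, none, none, none])
      (l₂ := [none, none, none, some ⟨0, U⟩, none]) (by simp [SplitL]) ?_ (typingLe_var rfl (Nat.zero_le D))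
    exact TypingLe.appL (l₁ := [none, none, none, none, none])
      (l₂ := [none, some ⟨0, C⟩, none, none, none]) (by simp [SplitL]) (hT.inNones _ (by simp))
      (typingLe_var rfl (Nat.zero_le D))

/-- **`⊢ passC S I F : Rty j U ⊸ Rty j U`**: one fold of a row with the promoted step `!ʲ(S c)`,
from the initial state `I z`, finished by `F`. [cite: GaboardiMarionRonchidellarocca2008, Thm. 5.14 (proof), Table 2 (sp)] -/
theorem typingLe_passC {DS DI DF : ℕ} {S I F : Term} {j : ℕ} {C U : LinTy} (hU : U.ClosedT)
    (hS : TypingLe DS Ctx.empty S ⟨0, .limp 0 (Fty U) (.limp 0 U (.limp 0 (STc C) (STc C)))⟩)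
    (hI : TypingLe DI Ctx.empty I ⟨0, .limp 0 (.tvar 0) (STc C)⟩)
    (hF : TypingLe DF Ctx.empty F ⟨0, .limp 0 C (.limp 0 (.tvar 0) (.tvar 0))⟩) :
    TypingLe (max (DS + j) (max DI DF)) Ctx.empty (passC S I F) ⟨0, .limp 0 (Rty j U) (Rty j U)⟩ := by
  set DD := max (DS + j) (max DI DF) with hDD
  rw [← Ctx.ofList_nil, passC]
  refine TypingLe.lamL ?_
  refine TypingLe.allIL ?_
  rw [shiftL_closed (by simpa using closedT_Rty j hU)]
  refine TypingLe.lamL (TypingLe.lamL ?_)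
  simp only [lams_zero, apps_cons, apps_nil]
  -- ((r (S c)) (I z)) F
  refine TypingLe.appL (l₁ := [some ⟨0, .tvar 0⟩, some ⟨j, Fty U⟩, some ⟨0, Rty j U⟩]) (l₂ := [none, none, none])
    (by simp [SplitL]) ?_ ((hF.mono (by omega)).inNones _ (by simp))
  rw [← inst_STof_body C (.tvar 0) (.tvar 0)]
  refine TypingLe.allE _ ?_
  refine TypingLe.appL (l₁ := [none, some ⟨j, Fty U⟩, some ⟨0, Rty j U⟩]) (l₂ := [some ⟨0, .tvar 0⟩, none, none])
    (k := 0) (B := STc C) (by simp [SplitL]) ?_ ?_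
  · refine TypingLe.appL (l₁ := [none, none, some ⟨0, Rty j U⟩]) (l₂ := [none, some ⟨j, Fty U⟩, none])
      (k := j) (B := .limp 0 U (.limp 0 (STc C) (STc C))) (by simp [SplitL]) ?_ ?_
    · have := (typingLe_var (l := [none, none, some ⟨0, Rty j U⟩]) (i := 2) rfl (Nat.zero_le DD)).allE (STc C)
      rwa [inst_Rty_body j hU] at this
    · -- the promoted step `S c`
      have h0 : TypingLe DS (Ctx.ofList [none, some ⟨0, Fty U⟩, none]) (S.app (.var 1)) ⟨0, .limp 0 U (.limp 0 (STc C) (STc C))⟩ :=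
        TypingLe.appL (l₁ := [none, none, none]) (l₂ := [none, some ⟨0, Fty U⟩, none]) (by simp [SplitL])
          (hS.inNones _ (by simp)) (typingLe_var rfl (Nat.zero_le DS))
      have := TypingLe.spNL j h0
      simp only [List.map_cons, List.map_nil, Option.map_none, Option.map_some, Nat.zero_add] at this
      exact this.mono (by omega)
  · exact TypingLe.appL (l₁ := [none, none, none]) (l₂ := [some ⟨0, .tvar 0⟩, none, none]) (by simp [SplitL])
      ((hI.mono (by omega)).inNones _ (by simp)) (typingLe_var rfl (Nat.zero_le DD))

/-- The pass of a transition tree is typed `Rty j U ⊸ Rty j U`. [cite: GaboardiMarionRonchidellarocca2008, Thm. 5.14 (proof)] -/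
theorem typingLe_passC_ofTree {D : ℕ} {C U : LinTy} {T : Term} (hU : U.ClosedT) (hTc : T.Closed)
    (hT : TypingLe D Ctx.empty T ⟨0, .limp 0 C (.limp 0 U (.limp 0 (Fty U) (.limp 0 (.tvar 0) (STc C))))⟩)
    {nQ : ℕ} (q₀ : Fin nQ) (hCq : TypingLe D Ctx.empty (oneHot nQ q₀) ⟨0, C⟩) (j : ℕ) :
    TypingLe (D + j) Ctx.empty (PassC.ofTree T hTc q₀).term ⟨0, .limp 0 (Rty j U) (Rty j U)⟩ := by
  have h := typingLe_passC (j := j) (C := C) hU (typingLe_STEPc hT)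
    (TypingLe.app_empty ((typingLe_PAIR C (.tvar 0)).mono (Nat.zero_le D)) hCq)
    ((typingLe_one C (.tvar 0)).mono (Nat.zero_le D))
  exact h.mono (by omega)

/-- **Sums of programs of one type** (rule `(sum)`, iterated). [cite: GaboardiMarionRonchidellarocca2008, Table 5 (sum)] -/
theorem typingLe_sums {D : ℕ} {Γ : Ctx} {A : LinTy} {Cs : List Term} (hne : Cs ≠ []) (h : ∀ C ∈ Cs, TypingLe D Γ C ⟨0, A⟩) :
    TypingLe D Γ (sums Cs) ⟨0, A⟩ := by
  induction Cs with
  | nil => exact absurd rfl hne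
  | cons C Cs ih =>
    cases Cs with
    | nil => exact h C (by simp)
    | cons C' Cs => exact TypingLe.sum (h C (by simp)) (ih (by simp) fun E hE => h E (by simp [hE]))

/-- **Iteration**: `⊢ P : Nᵢ`, `⊢ F : A ⊸ A`, `⊢ X : A` give `⊢ P F X : A` with `F` promoted `i`
times. [cite: GaboardiMarionRonchidellarocca2008, §3.2 (iteration), Table 2 (sp), (∀E)] -/
theorem typingLe_iterApp {DP DF DX : ℕ} {P F X : Term} {i : ℕ} {A : LinTy} (hP : TypingLe DP Ctx.empty P ⟨0, Nty i⟩)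
    (hF : TypingLe DF Ctx.empty F ⟨0, .limp 0 A A⟩) (hX : TypingLe DX Ctx.empty X ⟨0, A⟩) :
    TypingLe (max DP (max (DF + i) DX)) Ctx.empty (P.apps [F, X]) ⟨0, A⟩ := by
  simp only [apps_cons, apps_nil]
  refine TypingLe.app_empty (TypingLe.app_empty (k := i) (B := .limp 0 A A) ?_ ?_) (hX.mono (by omega))
  · have := (hP.mono (show DP ≤ max DP (max (DF + i) DX) by omega)).allE A
    rwa [inst_Nty_body] at this
  · have := hF.spN_empty i
    rw [Nat.zero_add] at this
    exact this.mono (by omega)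

/-! ### The acceptance program -/

/-- **`⊢ soC T' : U ⊸ C ⊸ C`** for `⊢ T' : C ⊸ U ⊸ C`. [folklore] -/
theorem typingLe_soC {D : ℕ} {C U : LinTy} {T' : Term} (hT : TypingLe D Ctx.empty T' ⟨0, .limp 0 C (.limp 0 U C)⟩) :
    TypingLe D Ctx.empty (soC T') ⟨0, .limp 0 U (.limp 0 C C)⟩ := by
  rw [← Ctx.ofList_nil, soC]
  refine TypingLe.lamL (TypingLe.lamL ?_)
  simp only [lams_zero, apps_cons, apps_nil]
  refine TypingLe.appL (l₁ := [some ⟨0, C⟩, none]) (l₂ := [none, some ⟨0, U⟩]) (by simp [SplitL]) ?_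
    (typingLe_var rfl (Nat.zero_le D))
  exact TypingLe.appL (l₁ := [none, none]) (l₂ := [some ⟨0, C⟩, none]) (by simp [SplitL]) (hT.inNones _ (by simp))
    (typingLe_var rfl (Nat.zero_le D))

/-- **`⊢ OUTc so s₀ b⃗ : Rty j U ⊸ B`**: fold the row with the promoted finite-state step, start
from `s₀`, and map the final control (of type `tyE |b⃗|`) to a boolean. [cite: GaboardiMarionRonchidellarocca2008, §3.2 (Ext), Thm. 5.14] -/
theorem typingLe_OUTc {Dso Ds Db : ℕ} {so s₀ : Term} {bs : List Term} {j : ℕ} {U : LinTy} (hU : U.ClosedT)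
    (hso : TypingLe Dso Ctx.empty so ⟨0, .limp 0 U (.limp 0 (tyE bs.length) (tyE bs.length))⟩)
    (hs₀ : TypingLe Ds Ctx.empty s₀ ⟨0, tyE bs.length⟩) (hbs : ∀ b ∈ bs, TypingLe Db Ctx.empty b ⟨0, tyB⟩) :
    TypingLe (max (Dso + j) (max Ds Db)) Ctx.empty (OUTc so s₀ bs) ⟨0, .limp 0 (Rty j U) tyB⟩ := by
  set DD := max (Dso + j) (max Ds Db) with hDD
  rw [← Ctx.ofList_nil, OUTc]
  refine TypingLe.lamL ?_
  rw [apps_cons, apps_cons]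
  refine typingLe_apps_closed (q := bs.length) (X := tyB) ?_ rfl fun b hb => (hbs b hb).mono (by omega)
  rw [← inst_arr_tvar]
  refine TypingLe.allE _ ?_
  refine TypingLe.appL (l₁ := [some ⟨0, Rty j U⟩]) (l₂ := [none]) (by simp [SplitL]) ?_ ((hs₀.mono (by omega)).inNones _ (by simp))
  refine TypingLe.appL (l₁ := [some ⟨0, Rty j U⟩]) (l₂ := [none]) (k := j)
    (B := .limp 0 U (.limp 0 (tyE bs.length) (tyE bs.length))) (by simp [SplitL]) ?_ ?_
  · have := (typingLe_var (l := [some ⟨0, Rty j U⟩]) (i := 0) rfl (Nat.zero_le DD)).allE (tyE bs.length)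
    rwa [inst_Rty_body j hU] at this
  · have := hso.spN_empty j
    rw [Nat.zero_add] at this
    exact (this.mono (by omega)).inNones _ (by simp)

end STA

end Literature.Computability.ImplicitComplexity

-- ============================== Part: Trees ==============================

/-!
## Part `Trees`: Transition trees of finite functions, and the typed pass of a Mealy machine

Given a Mealy transition `δ : Fin nQ → Fin nU → Fin nQ × Fin nE` (finite control, finite
alphabets), the decision tree `treeOf δ` tabulates it as a closed `Λ`-term (GMR08 =
Gaboardi–Marion–Ronchi Della Rocca 2008, §3.2: booleans and `if-then-else`, here `q`-ary), so that
`treeOf δ (oneHot q) (oneHot u) →β* LEAF (oneHot q') (oneHot e)` (`tspec_treeOf`) and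
`⊢ treeOf δ : C ⊸ U ⊸ (E ⊸ α ⊸ α) ⊸ α ⊸ STc C` (`typingLe_treeOf`). Consequently the pass
`mealyPass δ q₀` (one transition term `Trᵢ` of GMR08 Thm. 5.14 in tableau form) is a closed
program with `RowLike`-semantics `mealy δ q₀` (`rowLike_mealyPass`) and type `Rty j U ⊸ Rty j U`
for every `j` (`typingLe_mealyPass`). Likewise `treeOf' δ'` / `outProg` for the finite-state
acceptance fold.

## References

* [GaboardiMarionRonchidellarocca2008] §3.2, Thm. 5.14 (proof).
-/

namespace Literature.Computability.ImplicitComplexity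

namespace STA

open Term

variable {nQ nU nE : ℕ}

/-! ### Mealy transition trees -/

/-- The rows of the transition table of `δ`. [folklore] -/
def tableOf (δ : Fin nQ → Fin nU → Fin nQ × Fin nE) : List (List Term) :=
  (List.finRange nQ).map fun q => (List.finRange nU).map fun u => LEAF (oneHot nQ (δ q u).1) (oneHot nE (δ q u).2)

/-- The transition tree of `δ`. [cite: GaboardiMarionRonchidellarocca2008, §3.2 (if-then-else), Thm. 5.14] -/
def treeOf (δ : Fin nQ → Fin nU → Fin nQ × Fin nE) : Term := caseT2 (tableOf δ)

/-- The table has `nQ` rows. [folklore] -/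
@[simp] theorem length_tableOf (δ : Fin nQ → Fin nU → Fin nQ × Fin nE) : (tableOf δ).length = nQ := by
  simp [tableOf]

/-- Every leaf of the table is closed. [folklore] -/
theorem tableOf_closed (δ : Fin nQ → Fin nU → Fin nQ × Fin nE) : ∀ r ∈ tableOf δ, ∀ l ∈ r, l.Closed := by
  intro r hr l hl
  obtain ⟨q, -, rfl⟩ := List.mem_map.1 hr
  obtain ⟨u, -, rfl⟩ := List.mem_map.1 hl
  exact closed_LEAF (closed_oneHot (δ q u).1.2) (closed_oneHot (δ q u).2.2)

/-- Every row of the table has length `nU`. [folklore] -/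
theorem tableOf_length (δ : Fin nQ → Fin nU → Fin nQ × Fin nE) : ∀ r ∈ tableOf δ, r.length = nU := by
  intro r hr
  obtain ⟨q, -, rfl⟩ := List.mem_map.1 hr
  simp

/-- The transition tree is closed. [folklore] -/
theorem closed_treeOf (δ : Fin nQ → Fin nU → Fin nQ × Fin nE) : (treeOf δ).Closed := closed_caseT2 (tableOf_closed δ)

/-- **The transition tree realises `δ`.** [cite: GaboardiMarionRonchidellarocca2008, §3.2, Thm. 5.14] -/
theorem tspec_treeOf (δ : Fin nQ → Fin nU → Fin nQ × Fin nE) : TSpec (treeOf δ) nQ nU nE δ := by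
  refine ⟨closed_treeOf δ, fun q u => ?_⟩
  have h := caseT2_spec (tableOf_closed δ) (tableOf_length δ) (i := q) (j := u) (by simp) u.2 []
  simp only [length_tableOf, apps_nil] at h
  have e : ((tableOf δ).getD q []).getD u (.var 0) = LEAF (oneHot nQ (δ q u).1) (oneHot nE (δ q u).2) := by
    simp [tableOf, List.getD_eq_getElem?_getD]
  rwa [e] at h

/-- **The transition tree is typed** `C ⊸ U ⊸ (E ⊸ α ⊸ α) ⊸ α ⊸ STc C`. [cite: GaboardiMarionRonchidellarocca2008, §3.2, Thm. 5.14] -/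
theorem typingLe_treeOf (δ : Fin nQ → Fin nU → Fin nQ × Fin nE) :
    TypingLe 0 Ctx.empty (treeOf δ)
      ⟨0, .limp 0 (tyE nQ) (.limp 0 (tyE nU) (.limp 0 (Fty (tyE nE)) (.limp 0 (.tvar 0) (STc (tyE nQ)))))⟩ := by
  have := typingLe_caseT2 (D := 0) (X := .limp 0 (Fty (tyE nE)) (.limp 0 (.tvar 0) (STc (tyE nQ))))
    (tableOf_length δ) fun r hr l hl => by
      obtain ⟨q, -, rfl⟩ := List.mem_map.1 hr
      obtain ⟨u, -, rfl⟩ := List.mem_map.1 hl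
      exact typingLe_LEAF (typingLe_oneHot (δ q u).1.2) (typingLe_oneHot (δ q u).2.2)
  rwa [length_tableOf] at this

/-- **The pass of a Mealy machine**: one fold computing `mealy δ q₀`. [cite: GaboardiMarionRonchidellarocca2008, Thm. 5.14 (proof: `Trᵢ`)] -/
def mealyPass (δ : Fin nQ → Fin nU → Fin nQ × Fin nE) (q₀ : Fin nQ) : PassC := PassC.ofTree (treeOf δ) (closed_treeOf δ) q₀

/-- **Semantics of the pass**: row-like in, row-like out with the transducer's output. [cite: GaboardiMarionRonchidellarocca2008, Thm. 5.14 (proof)] -/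
theorem rowLike_mealyPass (δ : Fin nQ → Fin nU → Fin nQ × Fin nE) (q₀ : Fin nQ) {R : Term} {us : List (Fin nU)}
    (hR : RowLike R (us.map fun u : Fin nU => oneHot nU u.val)) :
    RowLike ((mealyPass δ q₀).term.app R) ((mealy δ q₀ us).2.map fun e : Fin nE => oneHot nE e.val) :=
  PassC.rowLike_app (tspec_treeOf δ) q₀ hR

/-- **Typing of the pass**: `⊢ mealyPass δ q₀ : Rty j U ⊸ Rty j U` with degree `j`, for `U = tyE nU`
and output alphabet = input alphabet. [cite: GaboardiMarionRonchidellarocca2008, Thm. 5.14 (proof), Table 2] -/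
theorem typingLe_mealyPass (δ : Fin nQ → Fin nU → Fin nQ × Fin nU) (q₀ : Fin nQ) (j : ℕ) :
    TypingLe j Ctx.empty (mealyPass δ q₀).term ⟨0, .limp 0 (Rty j (tyE nU)) (Rty j (tyE nU))⟩ := by
  have := typingLe_passC_ofTree (closedT_tyE nU) (closed_treeOf δ) (typingLe_treeOf δ) q₀ (typingLe_oneHot q₀.2) j
  rwa [Nat.zero_add] at this

/-! ### Finite-state folds (acceptance) -/

/-- The table of a finite-state transition `δ'`. [folklore] -/
def tableOf' (δ' : Fin nQ → Fin nU → Fin nQ) : List (List Term) :=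
  (List.finRange nQ).map fun q => (List.finRange nU).map fun u => oneHot nQ (δ' q u)

/-- The tree of a finite-state transition. [cite: GaboardiMarionRonchidellarocca2008, §3.2] -/
def treeOf' (δ' : Fin nQ → Fin nU → Fin nQ) : Term := caseT2 (tableOf' δ')

/-- The finite-state tree realises `δ'`. [cite: GaboardiMarionRonchidellarocca2008, §3.2] -/
theorem tspec'_treeOf' (δ' : Fin nQ → Fin nU → Fin nQ) : TSpec' (treeOf' δ') nQ nU δ' := by
  have hcl : ∀ r ∈ tableOf' δ', ∀ l ∈ r, l.Closed := by
    intro r hr l hl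
    obtain ⟨q, -, rfl⟩ := List.mem_map.1 hr
    obtain ⟨u, -, rfl⟩ := List.mem_map.1 hl
    exact closed_oneHot (δ' q u).2
  have hlen : ∀ r ∈ tableOf' δ', r.length = nU := by
    intro r hr; obtain ⟨q, -, rfl⟩ := List.mem_map.1 hr; simp
  refine ⟨closed_caseT2 hcl, fun q u => ?_⟩
  have h := caseT2_spec hcl hlen (i := q) (j := u) (by simp [tableOf']) u.2 []
  simp only [apps_nil] at h
  have e1 : (tableOf' δ').length = nQ := by simp [tableOf']
  rw [e1] at h
  have e : ((tableOf' δ').getD q []).getD u (.var 0) = oneHot nQ (δ' q u) := by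
    simp [tableOf', List.getD_eq_getElem?_getD]
  rwa [e] at h

/-- The finite-state tree is typed `C ⊸ U ⊸ C`. [cite: GaboardiMarionRonchidellarocca2008, §3.2] -/
theorem typingLe_treeOf' (δ' : Fin nQ → Fin nU → Fin nQ) :
    TypingLe 0 Ctx.empty (treeOf' δ') ⟨0, .limp 0 (tyE nQ) (.limp 0 (tyE nU) (tyE nQ))⟩ := by
  have hlen : ∀ r ∈ tableOf' δ', r.length = nU := by
    intro r hr; obtain ⟨q, -, rfl⟩ := List.mem_map.1 hr; simp
  have := typingLe_caseT2 (D := 0) (X := tyE nQ) hlen fun r hr l hl => by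
    obtain ⟨q, -, rfl⟩ := List.mem_map.1 hr
    obtain ⟨u, -, rfl⟩ := List.mem_map.1 hl
    exact typingLe_oneHot (δ' q u).2
  have e1 : (tableOf' δ').length = nQ := by simp [tableOf']
  rwa [e1] at this

/-- **The acceptance program** of a finite-state fold `δ'` from `q₀` with verdict table `acc`:
`OUTc (soC (treeOf' δ')) (oneHot q₀) [b_q]` where `b_q = 0` (accept) iff `acc q`. [cite: GaboardiMarionRonchidellarocca2008, §3.2 (Ext)] -/
def outProg (δ' : Fin nQ → Fin nU → Fin nQ) (q₀ : Fin nQ) (acc : Fin nQ → Bool) : Term :=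
  OUTc (soC (treeOf' δ')) (oneHot nQ q₀) ((List.finRange nQ).map fun q => encBit (!acc q))

/-- The components of the acceptance program are closed. [folklore] -/
theorem outProg_closed_parts (δ' : Fin nQ → Fin nU → Fin nQ) (q₀ : Fin nQ) (acc : Fin nQ → Bool) :
    (soC (treeOf' δ')).Closed ∧ (oneHot nQ (q₀ : ℕ)).Closed ∧
      ∀ b ∈ (List.finRange nQ).map (fun q => encBit (!acc q)), b.Closed :=
  ⟨closed_soC (tspec'_treeOf' δ').1, closed_oneHot q₀.2, fun b hb => by
    obtain ⟨q, -, rfl⟩ := List.mem_map.1 hb; exact closed_encBit _⟩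

/-- **Semantics of the acceptance program on a row-like argument**: the answer is `0` iff the final
control is accepting. [cite: GaboardiMarionRonchidellarocca2008, §3.2 (Ext), Def. 5.13] -/
theorem outProg_spec (δ' : Fin nQ → Fin nU → Fin nQ) (q₀ : Fin nQ) (acc : Fin nQ → Bool) {R : Term} {us : List (Fin nU)}
    (hR : RowLike R (us.map fun u : Fin nU => oneHot nU u.val)) :
    BetaReduces (R.apps (soC (treeOf' δ') :: oneHot nQ q₀ :: (List.finRange nQ).map fun q => encBit (!acc q)))
      (encBit (!acc (us.foldr (fun (u : Fin nU) (q : Fin nQ) => δ' q u) q₀))) := by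
  have h := outc_spec (tspec'_treeOf' δ') q₀ hR (bs := (List.finRange nQ).map fun q => encBit (!acc q))
    (outProg_closed_parts δ' q₀ acc).2.2 (by simp)
  set qf : Fin nQ := us.foldr (fun (u : Fin nU) (q : Fin nQ) => δ' q u) q₀
  have e : ((List.finRange nQ).map fun q => encBit (!acc q)).getD qf.val (.var 0) = encBit (!acc qf) := by
    simp [List.getD_eq_getElem?_getD]
  rwa [e] at h

/-- **Typing of the acceptance program**: `⊢ outProg : Rty j U ⊸ B` with degree `j`. [cite: GaboardiMarionRonchidellarocca2008, §3.2 (Ext), Thm. 5.14] -/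
theorem typingLe_outProg (δ' : Fin nQ → Fin nU → Fin nQ) (q₀ : Fin nQ) (acc : Fin nQ → Bool) (j : ℕ) :
    TypingLe j Ctx.empty (outProg δ' q₀ acc) ⟨0, .limp 0 (Rty j (tyE nU)) tyB⟩ := by
  have hlen : ((List.finRange nQ).map fun q => encBit (!acc q)).length = nQ := by simp
  have h := typingLe_OUTc (j := j) (Dso := 0) (Ds := 0) (Db := 0) (bs := (List.finRange nQ).map fun q => encBit (!acc q))
    (closedT_tyE nU) (by rw [hlen]; exact typingLe_soC (typingLe_treeOf' δ')) (by rw [hlen]; exact typingLe_oneHot q₀.2)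
    (fun b hb => by obtain ⟨q, -, rfl⟩ := List.mem_map.1 hb; rw [tyB_eq_tyE]; exact typingLe_encBit _)
  simpa [outProg] using h

end STA

end Literature.Computability.ImplicitComplexity

-- ============================== Part: Numerals ==============================

/-!
## Part `Numerals`: Church numerals in `STA`: iteration semantics and indexed typings

GMR08 (= Gaboardi–Marion–Ronchi Della Rocca 2008) §3.2: "Natural numbers are represented by Church
numerals `n̲ = λs.λz.sⁿ(z)`. Terms defining successor, addition and multiplication are typable by
indexed types `Nᵢ = ∀α.!ⁱ(α ⊸ α) ⊸ α ⊸ α`", and `len : Sᵢ ⊸ Nᵢ`. This file provides: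

* the behavioural notion `NumLike P p` ("`P` iterates `p` times": `P F X →β* F (⋯ (F X))` for
  closed `F X`), which is all the completeness proof needs of a numeral, and is stable under the
  arithmetic programs WITHOUT normalising them: `church p`, `lenC s̲` (`p = |s|`), `add P Q`,
  `mult P Q`;
* the typings `⊢ church p : Nᵢ` (`i ≥ 1`), `⊢ lenC : Sₘ ⊸ Nₘ`, `⊢ add : Nᵢ ⊸ Nᵢ ⊸ Nᵢ₊₁`,
  `⊢ mult : Nᵢ ⊸ !ⁱNⱼ ⊸ Nᵢ₊ⱼ` (GMR08 §3.2, GR07 Lemma 16), in the de Bruijn system `STA.Typing`,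
  the multiple occurrences of the iterated variable being merged by rule `(m)` from distinct slots.

## References

* [GaboardiMarionRonchidellarocca2008] §3.2 (numerals, `len`, Lemma 3.6).
* M. Gaboardi, S. Ronchi Della Rocca, *A soft type assignment system for λ-calculus*, CSL 2007,
  LNCS 4646, Lemma 16 (typings of successor, addition, multiplication).
-/

namespace Literature.Computability.ImplicitComplexity

namespace STA

open Term

/-! ### Iteration semantics -/

/-- `F (F (⋯ (F X)))`, `p` times. [folklore] -/
def iterT (F : Term) (p : ℕ) (X : Term) : Term := nestApp (List.replicate p F) X

/-- No iteration. [folklore] -/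
@[simp] theorem iterT_zero (F X : Term) : iterT F 0 X = X := rfl

/-- One more iteration. [folklore] -/
theorem iterT_succ (F : Term) (p : ℕ) (X : Term) : iterT F (p + 1) X = F.app (iterT F p X) := rfl

/-- Iterations compose. [folklore] -/
theorem iterT_add (F : Term) (p q : ℕ) (X : Term) : iterT F (p + q) X = iterT F p (iterT F q X) := by
  induction p with
  | zero => simp
  | succ p ih => rw [Nat.succ_add, iterT_succ, iterT_succ, ih]

/-- Iterations of closed terms are closed. [folklore] -/
theorem closed_iterT {F X : Term} (hF : F.Closed) (hX : X.Closed) (p : ℕ) : (iterT F p X).Closed :=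
  closed_nestApp (fun C hC => by rw [List.eq_of_mem_replicate hC]; exact hF) hX

/-- Substitution through an iteration spine. [folklore] -/
theorem iterT_substp (F X : Term) (p : ℕ) (τ : ℕ → Term) : (iterT F p X).substp τ = iterT (F.substp τ) p (X.substp τ) := by
  induction p with
  | zero => rfl
  | succ p ih => simp [iterT_succ, Term.substp, ih]

/-- Renaming through an iteration spine. [folklore] -/
theorem iterT_rename (F X : Term) (p : ℕ) (ρ : ℕ → ℕ) : (iterT F p X).rename ρ = iterT (F.rename ρ) p (X.rename ρ) := by
  induction p with
  | zero => rfl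
  | succ p ih => simp [iterT_succ, Term.rename, ih]

/-- `→β*` inside an iteration spine's base. [folklore] -/
theorem BetaReduces.iterT_base (F : Term) (p : ℕ) {X X' : Term} (h : BetaReduces X X') : BetaReduces (iterT F p X) (iterT F p X') := by
  induction p with
  | zero => exact h
  | succ p ih => rw [iterT_succ, iterT_succ]; exact BetaReduces.appR F ih

/-- `NumLike P p`: the closed term `P` iterates `p` times, `P F X →β* Fᵖ X` for closed `F`, `X`.
[cite: GaboardiMarionRonchidellarocca2008, §3.2 (iteration `P(len s) Tr (Init P s)`)] -/
def NumLike (P : Term) (p : ℕ) : Prop :=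
  P.Closed ∧ ∀ F X : Term, F.Closed → X.Closed → BetaReduces (P.apps [F, X]) (iterT F p X)

/-- A closed term `β`-reducing to a num-like term is num-like. [folklore] -/
theorem NumLike.of_betaReduces {P P' : Term} {p : ℕ} (h : NumLike P' p) (hP : P.Closed) (hred : BetaReduces P P') :
    NumLike P p :=
  ⟨hP, fun F X hF hX => (hred.apps_head [F, X]).trans' (h.2 F X hF hX)⟩

/-! ### Church numerals -/

/-- The Church numeral `church p = λf.λz. f (f (⋯ (f z)))`. [cite: GaboardiMarionRonchidellarocca2008, §3.2] -/
def church (p : ℕ) : Term := lams 2 (iterT (.var 1) p (.var 0))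

/-- Church numerals are closed. [folklore] -/
theorem closed_church (p : ℕ) : (church p).Closed := by
  simp only [church, Closed, bnd_lams, Nat.zero_add]
  induction p with
  | zero => decide
  | succ p ih => rw [iterT_succ]; simpa using ih

/-- **Church numerals iterate.** [cite: GaboardiMarionRonchidellarocca2008, §3.2] -/
theorem numLike_church (p : ℕ) : NumLike (church p) p := by
  refine ⟨closed_church p, fun F X hF hX => ?_⟩
  have h := apps_lams_betaReduces (iterT (.var 1) p (.var 0)) 2 [F, X] rfl (by simp [hF, hX])
  rwa [iterT_substp] at h

/-! ### Length of a word -/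

/-- `lenC = λs.λf.λz. s (λb. f) z` (GMR08 `len`). [cite: GaboardiMarionRonchidellarocca2008, §3.2 (`len : Sᵢ ⊸ Nᵢ`)] -/
def lenC : Term := lams 3 ((Term.var 2).apps [.lam (.var 2), .var 0])

/-- `lenC` is closed. [folklore] -/
theorem closed_lenC : lenC.Closed := by decide

/-- A chain of constant functions iterates. [folklore] -/
theorem chain_lamConst_betaReduces (F X : Term) (vs : List Term) :
    BetaReduces (chain (.lam (F.rename Nat.succ)) X vs) (iterT F vs.length X) := by
  induction vs with
  | nil => exact BetaReduces.rfl' _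
  | cons v vs ih =>
    rw [chain_cons, List.length_cons, iterT_succ]
    refine (BetaReduces.apps_args _ (List.Forall₂.cons (BetaReduces.rfl' v)
      (List.Forall₂.cons ih List.Forall₂.nil))).trans' ?_
    simp only [apps_cons, apps_nil]
    refine BetaReduces.appL (BetaReduces.single ?_) _
    have := RedB.beta (F.rename Nat.succ) v
    rwa [subst0_rename_succ] at this

/-- **`lenC s̲` iterates `|s|` times.** [cite: GaboardiMarionRonchidellarocca2008, §3.2 (`len`)] -/
theorem numLike_lenC_encWord (w : List Bool) : NumLike (lenC.app (encWord w)) w.length := by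
  refine ⟨closed_app.2 ⟨closed_lenC, closed_encWord w⟩, fun F X hF hX => ?_⟩
  have h1 := apps_lams_betaReduces ((Term.var 2).apps [.lam (.var 2), .var 0]) 3 [encWord w, F, X] rfl
    (by simp [closed_encWord w, hF, hX])
  have e1 : ((Term.var 2).apps [.lam (.var 2), .var 0]).substp (instN 3 [encWord w, F, X]) =
      (encWord w).apps [.lam (F.rename Nat.succ), X] := by
    simp [Term.substp, Term.up, instN, List.getD]
  rw [e1] at h1
  refine h1.trans' ?_
  rw [encWord_eq_encList]
  have hbits : ∀ v ∈ w.map encBit, v.Closed := fun v hv => by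
    obtain ⟨b, -, rfl⟩ := List.mem_map.1 hv; exact closed_encBit b
  have hlamF : (Term.lam (F.rename Nat.succ)).Closed := by
    rw [hF.rename_eq]; rw [closed_lam]; exact hF.bnd 1
  refine (apps_encList_betaReduces hbits hlamF hX []).trans' ?_
  simpa using chain_lamConst_betaReduces F X (w.map encBit)

/-! ### Addition and multiplication -/

/-- `add = λp q f z. p f (q f z)`. [cite: GaboardiMarionRonchidellarocca2008, §3.2] -/
def add : Term := lams 4 ((Term.var 3).apps [.var 1, (Term.var 2).apps [.var 1, .var 0]])

/-- `add` is closed. [folklore] -/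
theorem closed_add : add.Closed := by decide

/-- **`add P Q` iterates `p + q` times.** [cite: GaboardiMarionRonchidellarocca2008, §3.2] -/
theorem numLike_add {P Q : Term} {p q : ℕ} (hP : NumLike P p) (hQ : NumLike Q q) : NumLike (add.apps [P, Q]) (p + q) := by
  refine ⟨by simp [closed_add, hP.1, hQ.1], fun F X hF hX => ?_⟩
  rw [show (add.apps [P, Q]).apps [F, X] = add.apps [P, Q, F, X] from rfl]
  have h1 := apps_lams_betaReduces ((Term.var 3).apps [.var 1, (Term.var 2).apps [.var 1, .var 0]]) 4 [P, Q, F, X] rfl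
    (by simp [hP.1, hQ.1, hF, hX])
  have e1 : ((Term.var 3).apps [.var 1, (Term.var 2).apps [.var 1, .var 0]]).substp (instN 4 [P, Q, F, X]) =
      P.apps [F, Q.apps [F, X]] := by
    simp [Term.substp, instN, List.getD]
  rw [e1] at h1
  refine h1.trans' ?_
  refine (BetaReduces.apps_args P (List.Forall₂.cons (BetaReduces.rfl' F)
    (List.Forall₂.cons (hQ.2 F X hF hX) List.Forall₂.nil))).trans' ?_
  rw [iterT_add]
  exact hP.2 F _ hF (closed_iterT hF hX q)

/-- `mult = λp q f z. p (q f) z`. [cite: GaboardiMarionRonchidellarocca2008, §3.2] -/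
def mult : Term := lams 4 ((Term.var 3).apps [(Term.var 2).app (.var 1), .var 0])

/-- `mult` is closed. [folklore] -/
theorem closed_mult : mult.Closed := by decide

/-- Iterating `Q F` when `Q` iterates `q` times. [folklore] -/
theorem iterT_numLike {Q F X : Term} {q : ℕ} (hQ : NumLike Q q) (hF : F.Closed) (hX : X.Closed) (p : ℕ) :
    BetaReduces (iterT (Q.app F) p X) (iterT F (p * q) X) := by
  induction p with
  | zero => rw [Nat.zero_mul]; exact BetaReduces.rfl' _
  | succ p ih =>
    rw [iterT_succ, Nat.succ_mul, iterT_add]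
    refine (BetaReduces.appR _ ih).trans' ?_
    have := hQ.2 F (iterT F (p * q) X) hF (closed_iterT hF hX _)
    rw [← iterT_add, Nat.add_comm, iterT_add]
    exact this

/-- **`mult P Q` iterates `p · q` times.** [cite: GaboardiMarionRonchidellarocca2008, §3.2] -/
theorem numLike_mult {P Q : Term} {p q : ℕ} (hP : NumLike P p) (hQ : NumLike Q q) : NumLike (mult.apps [P, Q]) (p * q) := by
  refine ⟨by simp [closed_mult, hP.1, hQ.1], fun F X hF hX => ?_⟩
  rw [show (mult.apps [P, Q]).apps [F, X] = mult.apps [P, Q, F, X] from rfl]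
  have h1 := apps_lams_betaReduces ((Term.var 3).apps [(Term.var 2).app (.var 1), .var 0]) 4 [P, Q, F, X] rfl
    (by simp [hP.1, hQ.1, hF, hX])
  have e1 : ((Term.var 3).apps [(Term.var 2).app (.var 1), .var 0]).substp (instN 4 [P, Q, F, X]) = P.apps [Q.app F, X] := by
    simp [Term.substp, instN, List.getD]
  rw [e1] at h1
  refine h1.trans' ((hP.2 _ X (closed_app.2 ⟨hQ.1, hF⟩) hX).trans' ?_)
  exact iterT_numLike hQ hF hX p

/-! ### Typings -/

/-- The iteration spine with DISTINCT step variables `x_{b}, x_{b+1}, …` (innermost index `b`) over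
the base `z = x_0`: the subject of the premise of rule `(m)`. [folklore] -/
def iterVars (b : ℕ) : ℕ → Term
  | 0 => .var 0
  | p + 1 => (Term.var (b + p)).app (iterVars b p)

/-- Merging the step variables of `iterVars` onto slot `1` gives the body of a numeral. [folklore] -/
theorem iterVars_rename (b p : ℕ) (hb : 2 ≤ b) {S : Finset ℕ} (hS : ∀ x, x ∈ S ↔ b ≤ x ∧ x < b + p) :
    (iterVars b p).rename (mpxRen S 1) = iterT (.var 1) p (.var 0) := by
  induction p generalizing S with
  | zero =>
    have : (0 : ℕ) ∉ S := fun h => by have := (hS 0).1 h; omega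
    simp [iterVars, Term.rename, mpxRen, this]
  | succ p ih =>
    rw [iterVars, Term.rename, iterT_succ]
    have hmem : b + p ∈ S := (hS _).2 ⟨by omega, by omega⟩
    simp only [Term.rename, mpxRen, hmem, ite_true]
    congr 1
    -- the inner spine does not mention `b + p`, so the smaller set acts the same way
    have hfv : ∀ q ≤ p, ∀ x ∈ (iterVars b q).fv, x = 0 ∨ (b ≤ x ∧ x < b + q) := by
      intro q
      induction q with
      | zero => intro _ x hx; simp [iterVars] at hx; exact Or.inl hx
      | succ q ihq =>
        intro hq x hx
        simp only [iterVars, mem_fv_app, mem_fv_var] at hx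
        rcases hx with rfl | hx
        · exact Or.inr ⟨by omega, by omega⟩
        · rcases ihq (by omega) x hx with h | h
          · exact Or.inl h
          · exact Or.inr ⟨h.1, by omega⟩
    rw [← ih (S := S.erase (b + p)) fun x => by rw [Finset.mem_erase, hS]; omega]
    refine rename_congr_fv fun x hx => ?_
    rcases hfv p le_rfl x hx with rfl | hx'
    · have h0 : (0 : ℕ) ∉ S := fun h => by have := (hS 0).1 h; omega
      simp [mpxRen, h0]
    · have hne : x ≠ b + p := by omega
      simp [mpxRen, Finset.mem_erase, hne, (hS x).2 ⟨hx'.1, by omega⟩]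

/-- The context of `iterVars b p` at result type `α`: `z : α`, the step variables linear of type
`α ⊸ α`, the other slots below `b` empty. [folklore] -/
def numeralCtx (b p : ℕ) (A : LinTy) : Ctx := fun x =>
  if x = 0 then some ⟨0, A⟩ else if b ≤ x ∧ x < b + p then some ⟨0, .limp 0 A A⟩ else none

/-- Typing the spine of distinct step variables. [cite: GaboardiMarionRonchidellarocca2008, Table 2 (Ax), (⊸E)] -/
theorem typing_iterVars (b : ℕ) (hb : 2 ≤ b) (A : LinTy) : ∀ p : ℕ, TypingLe 0 (numeralCtx b p A) (iterVars b p) ⟨0, A⟩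
  | 0 => by
    have : numeralCtx b 0 A = Ctx.ofList [some ⟨0, A⟩] := by
      funext x; cases x with
      | zero => simp [numeralCtx]
      | succ x => simp [numeralCtx]
    rw [this]; exact typingLe_var rfl le_rfl
  | p + 1 => by
    rw [iterVars]
    have hsplit : (numeralCtx b (p + 1) A).Split (fun x => if x = b + p then some ⟨0, .limp 0 A A⟩ else none) (numeralCtx b p A) := by
      intro x
      by_cases hx : x = b + p
      · subst hx
        refine Or.inl ⟨?_, ?_⟩ <;> simp [numeralCtx] <;> omega
      · refine Or.inr ⟨by simp [hx], ?_⟩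
        simp only [numeralCtx]
        by_cases h0 : x = 0
        · simp [h0]
        · simp only [h0, if_false]
          by_cases h1 : b ≤ x ∧ x < b + p
          · rw [if_pos h1, if_pos ⟨h1.1, by omega⟩]
          · rw [if_neg h1, if_neg (by omega)]
    refine TypingLe.app hsplit ?_ (typing_iterVars b hb A p)
    exact ⟨0, le_rfl, typing_var_single (b + p) 0 (.limp 0 A A)⟩

/-- **`⊢ church p : Nᵢ`** for `i ≥ 1` (degree `0`). [cite: GaboardiMarionRonchidellarocca2008, §3.2] -/
theorem typingLe_church (p : ℕ) {i : ℕ} (hi : 1 ≤ i) : TypingLe 0 Ctx.empty (church p) ⟨0, Nty i⟩ := by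
  -- the spine with distinct steps, merged by (m) onto slot 1 at modality 1, raised to modality i
  set S : Finset ℕ := (Finset.range p).image (fun t => 2 + t) with hSdef
  have hS : ∀ x, x ∈ S ↔ 2 ≤ x ∧ x < 2 + p := by
    intro x
    simp only [hSdef, Finset.mem_image, Finset.mem_range]
    constructor
    · rintro ⟨t, ht, rfl⟩; omega
    · intro h; exact ⟨x - 2, by omega, by omega⟩
  have h1 := typing_iterVars 2 le_rfl (.tvar 0) p
  have h2 : TypingLe 0 (Ctx.ofList [some ⟨0, .tvar 0⟩, some ⟨1, .limp 0 (.tvar 0) (.tvar 0)⟩]) (iterT (.var 1) p (.var 0))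
      ⟨0, .tvar 0⟩ := by
    refine (h1.mpx S 1 (τ := ⟨0, .limp 0 (.tvar 0) (.tvar 0)⟩) (fun x hx => ?_) ?_ ?_ (iterVars_rename 2 p le_rfl hS).symm)
    · obtain ⟨h2x, hxp⟩ := (hS x).1 hx
      simp [numeralCtx, show x ≠ 0 by omega, h2x, hxp]
    · simp [numeralCtx]
    · funext x
      simp only [Ctx.mpx, hS, numeralCtx, Ctx.ofList_apply, SoftTy.bang]
      rcases x with _ | _ | x
      · simp
      · simp
      · by_cases hx : x < p
        · simp [show 2 ≤ x + 2 by omega, show x + 2 < 2 + p by omega]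
        · simp [show ¬ (x + 2 < 2 + p) by omega]
  -- raise slot 1 to modality i
  obtain ⟨d, hd, h2⟩ := h2
  have h3 := h2.raiseN (i := 1) (k := 1) (A := .limp 0 (.tvar 0) (.tvar 0)) rfl (J := p + 2) (by simp) ?_ (i - 1)
  · rw [Ctx.ofList_set _ (by simp), show 1 + (i - 1) = i by omega] at h3
    simp only [List.set_cons_succ, List.set_cons_zero] at h3
    have h4 : TypingLe 0 (Ctx.ofList [some ⟨0, .tvar 0⟩, some ⟨i, .limp 0 (.tvar 0) (.tvar 0)⟩]) (iterT (.var 1) p (.var 0))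
        ⟨0, .tvar 0⟩ := ⟨d, hd, h3⟩
    rw [← Ctx.ofList_nil, church]
    refine TypingLe.allIL ?_
    rw [List.map_nil]
    exact TypingLe.lamL (TypingLe.lamL h4)
  · -- `p + 2` is not free in the numeral body
    intro hmem
    have : ∀ q, ∀ x ∈ (iterT (Term.var 1) q (Term.var 0)).fv, x = 0 ∨ x = 1 := by
      intro q; induction q with
      | zero => intro x hx; simp [iterT] at hx; simp [nestApp] at hx; exact Or.inl hx
      | succ q ih => intro x hx; rw [iterT_succ] at hx; simp only [mem_fv_app, mem_fv_var] at hx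
                     rcases hx with rfl | hx; exact Or.inr rfl; exact ih x hx
    rcases this p _ hmem with h | h <;> omega

/-- `(∀E)` on `Sₘ`. [cite: GaboardiMarionRonchidellarocca2008, Table 2 (∀E)] -/
theorem inst_tyS_body (m : ℕ) (X : LinTy) :
    (LinTy.limp m (.limp 0 tyB (.limp 0 (.tvar 0) (.tvar 0))) (.limp 0 (.tvar 0) (.tvar 0))).inst X =
      .limp m (.limp 0 tyB (.limp 0 X X)) (.limp 0 X X) := by
  have h := (closedT_tyE 2).substp_eq
  rw [← tyB_eq_tyE] at h
  simp [LinTy.inst, LinTy.substp, h]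

/-- **`⊢ lenC : Sₘ ⊸ Nₘ`** (degree `m`). [cite: GaboardiMarionRonchidellarocca2008, §3.2 (`len : Sᵢ ⊸ Nᵢ`)] -/
theorem typingLe_lenC (m : ℕ) : TypingLe m Ctx.empty lenC ⟨0, .limp 0 (tyS m) (Nty m)⟩ := by
  rw [← Ctx.ofList_nil, lenC]
  refine TypingLe.lamL ?_
  refine TypingLe.allIL ?_
  rw [shiftL_closed (by simp [tyS_eq_Rty]; exact closedT_Rty m (closedT_tyE 2))]
  refine TypingLe.lamL (TypingLe.lamL ?_)
  simp only [lams_zero, apps_cons, apps_nil]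
  refine TypingLe.appL (l₁ := [none, some ⟨m, .limp 0 (.tvar 0) (.tvar 0)⟩, some ⟨0, tyS m⟩])
    (l₂ := [some ⟨0, .tvar 0⟩, none, none]) (by simp [SplitL]) ?_ (typingLe_var rfl (Nat.zero_le m))
  refine TypingLe.appL (l₁ := [none, none, some ⟨0, tyS m⟩]) (l₂ := [none, some ⟨m, .limp 0 (.tvar 0) (.tvar 0)⟩, none])
    (k := m) (B := .limp 0 tyB (.limp 0 (.tvar 0) (.tvar 0))) (by simp [SplitL]) ?_ ?_
  · have := (typingLe_var (l := [none, none, some ⟨0, tyS m⟩]) (i := 2) rfl (Nat.zero_le m)).allE (.tvar 0)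
    rwa [inst_tyS_body] at this
  · -- the box `λb. f`, promoted `m` times
    have h0 : TypingLe 0 (Ctx.ofList [none, some ⟨0, .limp 0 (.tvar 0) (.tvar 0)⟩, none]) (.lam (.var 2))
        ⟨0, .limp 0 tyB (.limp 0 (.tvar 0) (.tvar 0))⟩ :=
      TypingLe.lamL (typingLe_var (l := [some ⟨0, tyB⟩, none, some ⟨0, .limp 0 (.tvar 0) (.tvar 0)⟩, none]) (i := 2) rfl le_rfl)
    have := TypingLe.spNL m h0
    simpa using this

/-- The body of `add` with the two occurrences of `f` in the distinct slots `4`, `5`. [folklore] -/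
def addBody' : Term := (Term.var 3).apps [.var 4, (Term.var 2).apps [.var 5, .var 0]]

/-- **`⊢ add : Nᵢ ⊸ Nᵢ ⊸ Nᵢ₊₁`** (degree `i`). [cite: GaboardiMarionRonchidellarocca2008, §3.2] -/
theorem typingLe_add (i : ℕ) : TypingLe i Ctx.empty add ⟨0, .limp 0 (Nty i) (.limp 0 (Nty i) (Nty (i + 1)))⟩ := by
  -- the body with distinct copies
  have h1 : TypingLe i (Ctx.ofList [some ⟨0, .tvar 0⟩, none, some ⟨0, Nty i⟩, some ⟨0, Nty i⟩, some ⟨i, (LinTy.limp 0 (.tvar 0) (.tvar 0))⟩, some ⟨i, (LinTy.limp 0 (.tvar 0) (.tvar 0))⟩])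
      addBody' ⟨0, .tvar 0⟩ := by
    rw [addBody']
    simp only [apps_cons, apps_nil]
    refine TypingLe.appL (l₁ := [none, none, none, some ⟨0, Nty i⟩, some ⟨i, (LinTy.limp 0 (.tvar 0) (.tvar 0))⟩, none])
      (l₂ := [some ⟨0, .tvar 0⟩, none, some ⟨0, Nty i⟩, none, none, some ⟨i, (LinTy.limp 0 (.tvar 0) (.tvar 0))⟩])
      (k := 0) (B := .tvar 0) (by simp [SplitL]) ?_ ?_
    · refine TypingLe.appL (l₁ := [none, none, none, some ⟨0, Nty i⟩, none, none])
        (l₂ := [none, none, none, none, some ⟨i, (LinTy.limp 0 (.tvar 0) (.tvar 0))⟩, none]) (by simp [SplitL]) ?_ (typingLe_var rfl le_rfl)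
      have := (typingLe_var (l := [none, none, none, some ⟨0, Nty i⟩, none, none]) (i := 3) rfl (Nat.zero_le i)).allE (.tvar 0)
      rwa [inst_Nty_body] at this
    · refine TypingLe.appL (l₁ := [none, none, some ⟨0, Nty i⟩, none, none, some ⟨i, (LinTy.limp 0 (.tvar 0) (.tvar 0))⟩])
        (l₂ := [some ⟨0, .tvar 0⟩, none, none, none, none, none]) (by simp [SplitL]) ?_ (typingLe_var rfl (Nat.zero_le i))
      refine TypingLe.appL (l₁ := [none, none, some ⟨0, Nty i⟩, none, none, none])
        (l₂ := [none, none, none, none, none, some ⟨i, (LinTy.limp 0 (.tvar 0) (.tvar 0))⟩]) (by simp [SplitL]) ?_ (typingLe_var rfl le_rfl)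
      have := (typingLe_var (l := [none, none, some ⟨0, Nty i⟩, none, none, none]) (i := 2) rfl (Nat.zero_le i)).allE (.tvar 0)
      rwa [inst_Nty_body] at this
  -- merge slots 4, 5 onto slot 1
  have h2 : TypingLe i (Ctx.ofList [some ⟨0, .tvar 0⟩, some ⟨i + 1, (LinTy.limp 0 (.tvar 0) (.tvar 0))⟩, some ⟨0, Nty i⟩, some ⟨0, Nty i⟩])
      ((Term.var 3).apps [.var 1, (Term.var 2).apps [.var 1, .var 0]]) ⟨0, .tvar 0⟩ := by
    refine h1.mpx {4, 5} 1 (τ := ⟨i, (LinTy.limp 0 (.tvar 0) (.tvar 0))⟩) (fun x hx => ?_) rfl ?_ ?_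
    · simp only [Finset.mem_insert, Finset.mem_singleton] at hx
      rcases hx with rfl | rfl <;> rfl
    · funext x
      simp only [Ctx.mpx, Finset.mem_insert, Finset.mem_singleton, Ctx.ofList_apply, SoftTy.bang]
      rcases x with _ | _ | _ | _ | _ | _ | x <;> simp
    · simp [addBody', Term.rename, mpxRen]
  rw [← Ctx.ofList_nil, add]
  refine TypingLe.lamL (TypingLe.lamL ?_)
  refine TypingLe.allIL ?_
  rw [shiftL_closed (by simp [closedT_Nty i])]
  exact TypingLe.lamL (TypingLe.lamL h2)

/-- **`⊢ mult : Nᵢ ⊸ !ⁱNⱼ ⊸ Nᵢ₊ⱼ`** (degree `i + j`). [cite: GaboardiMarionRonchidellarocca2008, §3.2] -/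
theorem typingLe_mult (i j : ℕ) : TypingLe (i + j) Ctx.empty mult ⟨0, .limp 0 (Nty i) (.limp i (Nty j) (Nty (i + j)))⟩ := by
  rw [← Ctx.ofList_nil, mult]
  refine TypingLe.lamL (TypingLe.lamL ?_)
  refine TypingLe.allIL ?_
  rw [shiftL_closed (by simp [closedT_Nty i, closedT_Nty j])]
  refine TypingLe.lamL (TypingLe.lamL ?_)
  simp only [lams_zero, apps_cons, apps_nil]
  refine TypingLe.appL (l₁ := [none, some ⟨i + j, (LinTy.limp 0 (.tvar 0) (.tvar 0))⟩, some ⟨i, Nty j⟩, some ⟨0, Nty i⟩])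
    (l₂ := [some ⟨0, .tvar 0⟩, none, none, none]) (by simp [SplitL]) ?_ (typingLe_var rfl (Nat.zero_le _))
  refine TypingLe.appL (l₁ := [none, none, none, some ⟨0, Nty i⟩]) (l₂ := [none, some ⟨i + j, (LinTy.limp 0 (.tvar 0) (.tvar 0))⟩, some ⟨i, Nty j⟩, none])
    (k := i) (B := (LinTy.limp 0 (.tvar 0) (.tvar 0))) (by simp [SplitL]) ?_ ?_
  · have := (typingLe_var (l := [none, none, none, some ⟨0, Nty i⟩]) (i := 3) rfl (Nat.zero_le (i + j))).allE (.tvar 0)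
    rwa [inst_Nty_body] at this
  · -- `q f` at modality `i`: type it at degree `j`, promote `i` times
    have h0 : TypingLe j (Ctx.ofList [none, some ⟨j, (LinTy.limp 0 (.tvar 0) (.tvar 0))⟩, some ⟨0, Nty j⟩, none]) ((Term.var 2).app (.var 1)) ⟨0, (LinTy.limp 0 (.tvar 0) (.tvar 0))⟩ := by
      refine TypingLe.appL (l₁ := [none, none, some ⟨0, Nty j⟩, none]) (l₂ := [none, some ⟨j, (LinTy.limp 0 (.tvar 0) (.tvar 0))⟩, none, none])
        (by simp [SplitL]) ?_ (typingLe_var rfl le_rfl)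
      have := (typingLe_var (l := [none, none, some ⟨0, Nty j⟩, none]) (i := 2) rfl (Nat.zero_le j)).allE (.tvar 0)
      rwa [inst_Nty_body] at this
    have := TypingLe.spNL i h0
    simp only [List.map_cons, List.map_nil, Option.map_none, Option.map_some, Nat.zero_add] at this
    rw [show j + i = i + j by omega] at this
    exact this

end STA

end Literature.Computability.ImplicitComplexity

-- ============================== Part: TableauCA ==============================

/-!
## Part `TableauCA`: The tableau of a `FinTM2` decider as a one-pass transducer on rows

GMR08 (= Gaboardi–Marion–Ronchi Della Rocca 2008) Thm. 5.14 / Thm. 3.9 programs a Turing machine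
transition as a term `Tr : TM ⊸ TM` on Church-encoded configurations. For the machine model of
the tree's classes (Mathlib's `FinTM2`, through the Cook–Levin tableau of `TableauStep.lean` /
`CookLevinTableau.lean`: row `t` = the blocks `absVal (cfgAt t) 0, 1, …`, next row given by the
local rules `topF` / `intF`), one machine step becomes ONE LEFT-TO-RIGHT PASS of a transducer over
the row, block `0` first, with a delay: reading block `J + D` (`D = 3·dM`) it emits the new block
`J`, computed from the head blocks `0 … 3 dM` and the window `J - dM … J + dM` seen so far
(`emit`); during the first `D` blocks it emits padding. Rows are therefore stored as
`[pad^a, block 0, …, block (W - a)]` with an offset `a` growing by `D` per pass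
(`procRow`), and **one pass maps the stored row of `c` to the stored row of `stepTotal c`**
(`run_procRow`). The transducer state is the list of blocks read so far; its finite summary
(bounded counter, first `3 dM + 1` blocks, last `6 dM + 1` blocks) is a Mealy machine with the
same runs (`Summ`, `summStep`, `run_summ`), which is what the `Λ`-term of
Part `Trees` of this file tabulates.

## References

* [GaboardiMarionRonchidellarocca2008] Thm. 3.9 (proof: `Tr`, `Init`, `Ext`), Thm. 5.14.
* M. Sipser, *Introduction to the Theory of Computation*, 3rd ed., Thm. 7.37, Thm. 9.30 (windows).
-/

namespace Literature.Computability.ImplicitComplexity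

namespace STA

namespace TabCA

open Literature.Computability.Complexity Literature.Computability.Complexity.Tableau Turing

variable (M : TM2ComputableAux Bool Bool)

attribute [local instance] Turing.FinTM2.kFin Turing.FinTM2.ΛFin Turing.FinTM2.σFin Turing.FinTM2.Γk₀Fin

/-- Block values of the machine's tableau. [cite: Sipser2012, Thm. 9.30 (proof)] -/
abbrev V : Type := Val M.tm

/-- The window parameter `dM = depth + 1` of `CookLevinTableau.lean`. [folklore] -/
noncomputable abbrev dd : ℕ := dM M

/-- The delay `D = 3 · dM` of the pass. [folklore] -/
noncomputable def Dly : ℕ := 3 * dd M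

variable {M}

/-! ### The new block from the history of blocks read -/

/-- The new block `J` of the next row, from the list `h` of the old blocks `0 … J + D` (at least):
the top rule for `J ≤ 2 dM`, the interior rule otherwise. [cite: Sipser2012, Thm. 9.30 (proof)] -/
noncomputable def newBlk (h : List (V M)) (J : ℕ) : V M :=
  if hJ : J ≤ 2 * dd M then topF (dd M) (fun s => h.getD s (noneVal M.tm)) ⟨J, by omega⟩
  else intF (dd M) (fun s => h.getD s (noneVal M.tm)) (fun s => h.getD (J - dd M + s) (noneVal M.tm))

/-- **The new block is the block of the next configuration** when `h` lists the blocks `0 … n` of a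
good configuration `c` with `J + dM ≤ n`... precisely: `h.getD s = absVal c s` for all `s ≤ J + 3 dM`.
[cite: Sipser2012, Thm. 9.30 (proof)] -/
theorem newBlk_eq {c : M.tm.Cfg} (hg : TM2Sim.Good M.tm c) {h : List (V M)} {J : ℕ}
    (hh : ∀ s ≤ J + 3 * dd M, h.getD s (noneVal M.tm) = absVal c s) :
    newBlk h J = absVal (TM2Sim.stepTotal M.tm c) J := by
  have hd : TM2Sim.depth M.tm ≤ dd M := (depth_lt_dM M).le
  unfold newBlk
  split
  · next hJ =>
    rw [absVal_stepTotal_top hd c hg ⟨J, by omega⟩]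
    congr 1
    funext s
    exact hh s (by have := s.2; omega)
  · next hJ =>
    rw [absVal_stepTotal_int hd c hg J (by omega)]
    congr 1
    · funext s; exact hh s (by have := s.2; omega)
    · funext s; exact hh _ (by have := s.2; omega)

/-! ### The pass as a transducer on the history -/

/-- What the pass emits after reading the real blocks `h` (the last one just read): padding during
the first `D` blocks, then the new block `|h| - 1 - D`. [folklore] -/
noncomputable def emit (h : List (V M)) : Option (V M) :=
  if h.length ≤ Dly M then none else some (newBlk h (h.length - 1 - Dly M))

/-- One transition on the history: padding is echoed, a real block is recorded and answered by
`emit`. [folklore] -/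
noncomputable def histStep (h : List (V M)) : Option (V M) → List (V M) × Option (V M)
  | none => (h, none)
  | some v => (h ++ [v], emit (h ++ [v]))

/-- Running a transducer left to right: final state and outputs in reading order (the reading-order
counterpart of `mealy` = `List.mapAccumr`, see `mealy_reverse`; Mathlib has no left-to-right
`mapAccum`). [folklore] -/
def runL {σ α β : Type} (δ : σ → α → σ × β) : σ → List α → σ × List β
  | q, [] => (q, [])
  | q, a :: as => ((runL δ (δ q a).1 as).1, (δ q a).2 :: (runL δ (δ q a).1 as).2)

/-- `runL` over an appended list. [folklore] -/
theorem runL_append {σ α β : Type} (δ : σ → α → σ × β) (q : σ) (as bs : List α) :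
    runL δ q (as ++ bs) = ((runL δ (runL δ q as).1 bs).1, (runL δ q as).2 ++ (runL δ (runL δ q as).1 bs).2) := by
  induction as generalizing q with
  | nil => simp [runL]
  | cons a as ih => simp [runL, ih]

/-- **`mealy` is `runL` on the reversed list** (the fold of a Church list reads its innermost
element first). [folklore] -/
theorem mealy_reverse {σ α β : Type} (δ : σ → α → σ × β) (q : σ) (as : List α) :
    mealy δ q as.reverse = ((runL δ q as).1, (runL δ q as).2.reverse) := by
  induction as using List.reverseRecOn with
  | nil => rfl
  | append_singleton as a ih =>
    rw [List.reverse_append, List.reverse_singleton, List.singleton_append, mealy_cons, ih, runL_append]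
    simp [runL]

/-- Padding is echoed and leaves the history unchanged. [folklore] -/
theorem runL_histStep_pads (h : List (V M)) (a : ℕ) :
    runL histStep h (List.replicate a none) = (h, List.replicate a none) := by
  induction a generalizing h with
  | zero => rfl
  | succ a ih => simp [List.replicate_succ, runL, histStep, ih]

/-- Reading real blocks appends them to the history and emits on each prefix. [folklore] -/
theorem runL_histStep_blocks (h : List (V M)) (bs : List (V M)) :
    runL histStep h (bs.map some) = (h ++ bs, (List.range bs.length).map fun i => emit (h ++ bs.take (i + 1))) := by
  induction bs generalizing h with
  | nil => simp [runL]
  | cons b bs ih =>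
    rw [List.map_cons, runL]
    simp only [histStep, ih (h ++ [b]), List.append_assoc, List.singleton_append, List.length_cons]
    refine Prod.ext rfl ?_
    simp only
    rw [List.range_succ_eq_map, List.map_cons, List.map_map]
    rfl

/-! ### Stored rows and the effect of one pass -/

/-- The stored row of a configuration: `a` paddings, then its blocks `0 … m - 1`, in reading order.
[folklore] -/
noncomputable def procRow (a : ℕ) (c : M.tm.Cfg) (m : ℕ) : List (Option (V M)) :=
  List.replicate a none ++ (List.range m).map fun J => some (absVal c J)

/-- Length of a stored row. [folklore] -/
@[simp] theorem length_procRow (a : ℕ) (c : M.tm.Cfg) (m : ℕ) : (procRow a c m).length = a + m := by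
  simp [procRow]

/-- The emissions while reading the blocks of a good configuration: padding for the first `D`
blocks, then the blocks of the next configuration in order. [cite: Sipser2012, Thm. 9.30 (proof)] -/
theorem emit_blocks {c : M.tm.Cfg} (hg : TM2Sim.Good M.tm c) {m i : ℕ} (hi : i < m) :
    emit (((List.range m).map (absVal c)).take (i + 1)) =
      if i < Dly M then none else some (absVal (TM2Sim.stepTotal M.tm c) (i - Dly M)) := by
  unfold emit
  have hlen : (((List.range m).map (absVal c)).take (i + 1)).length = i + 1 := by
    simp; omega
  rw [hlen]
  by_cases h : i < Dly M
  · rw [if_pos (by omega), if_pos h]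
  · rw [if_neg (by omega), if_neg h]
    congr 1
    rw [show i + 1 - 1 - Dly M = i - Dly M by omega]
    refine newBlk_eq hg fun s hs => ?_
    have hs' : s < i + 1 := by unfold Dly at h hs; omega
    rw [List.getD_eq_getElem?_getD, List.getElem?_take, if_pos hs', List.getElem?_map,
      List.getElem?_range (by omega)]
    rfl

/-- **One pass on a stored row**: the stored row of `c` with offset `a` and `m ≥ D` blocks is mapped
to the stored row of `stepTotal c` with offset `a + D` and `m - D` blocks. [cite: GaboardiMarionRonchidellarocca2008, Thm. 3.9 (proof: `Tr`)] -/
theorem run_procRow {c : M.tm.Cfg} (hg : TM2Sim.Good M.tm c) (h : List (V M)) (a m : ℕ) (hm : Dly M ≤ m) :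
    (runL histStep h (procRow a c m)).2 = procRow (a + Dly M) (TM2Sim.stepTotal M.tm c) (m - Dly M) ∨ h ≠ [] := by
  by_cases hh : h = []
  · left
    subst hh
    rw [procRow, runL_append, runL_histStep_pads]
    simp only
    rw [show ((List.range m).map fun J => some (absVal c J)) = ((List.range m).map (absVal c)).map some by simp,
      runL_histStep_blocks]
    simp only [List.nil_append, List.length_map, List.length_range]
    have hem : (List.range m).map (fun i => emit (((List.range m).map (absVal c)).take (i + 1))) =
        (List.range m).map (fun i => if i < Dly M then none else some (absVal (TM2Sim.stepTotal M.tm c) (i - Dly M))) :=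
      List.map_congr_left fun i hi => emit_blocks hg (List.mem_range.1 hi)
    rw [hem, procRow, List.replicate_add, List.append_assoc]
    congr 1
    rw [show m = Dly M + (m - Dly M) by omega, List.range_add, List.map_append, Nat.add_sub_cancel_left]
    congr 1
    · refine List.ext_getElem (by simp) fun i h1 h2 => ?_
      simp only [List.length_map, List.length_range] at h1
      rw [List.getElem_map, List.getElem_range, if_pos h1, List.getElem_replicate]
    · rw [List.map_map]
      refine List.ext_getElem (by simp) fun i h1 h2 => ?_
      rw [List.getElem_map, List.getElem_map, List.getElem_range, Function.comp_apply, if_neg (by omega),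
        Nat.add_sub_cancel_left]
  · exact Or.inr hh

/-- One pass from the empty history, the form used below. [cite: GaboardiMarionRonchidellarocca2008, Thm. 3.9 (proof: `Tr`)] -/
theorem run_procRow_nil {c : M.tm.Cfg} (hg : TM2Sim.Good M.tm c) (a m : ℕ) (hm : Dly M ≤ m) :
    (runL histStep ([] : List (V M)) (procRow a c m)).2 = procRow (a + Dly M) (TM2Sim.stepTotal M.tm c) (m - Dly M) := by
  rcases run_procRow hg [] a m hm with h | h
  · exact h
  · exact absurd rfl h

/-! ### The finite summary of the history -/

/-- The bound of the saturating block counter. [folklore] -/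
noncomputable def Kc (M : TM2ComputableAux Bool Bool) : ℕ := 5 * dd M + 2

/-- Finite summaries: saturating count of blocks read, the first `3 dM + 1` blocks (padded), the last
`6 dM + 1` blocks (padded in front). [folklore] -/
abbrev Summ (M : TM2ComputableAux Bool Bool) : Type := Fin (Kc M + 1) × List.Vector (V M) (3 * dd M + 1) × List.Vector (V M) (6 * dd M + 1)

/-- The first `k` entries of a list, padded with empty blocks. [folklore] -/
noncomputable def firstPad (k : ℕ) (h : List (V M)) : List (V M) := (h ++ List.replicate k (noneVal M.tm)).take k

/-- The last `k` entries of a list, padded in front with empty blocks. [folklore] -/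
noncomputable def lastPad (k : ℕ) (h : List (V M)) : List (V M) := (List.replicate k (noneVal M.tm) ++ h).drop h.length

/-- Length of `firstPad`. [folklore] -/
@[simp] theorem length_firstPad (k : ℕ) (h : List (V M)) : (firstPad k h).length = k := by
  simp [firstPad]

/-- Length of `lastPad`. [folklore] -/
@[simp] theorem length_lastPad (k : ℕ) (h : List (V M)) : (lastPad k h).length = k := by
  simp [lastPad]

/-- Entries of `firstPad`. [folklore] -/
theorem getD_firstPad (k : ℕ) (h : List (V M)) (s : ℕ) (hs : s < k) :
    (firstPad k h).getD s (noneVal M.tm) = h.getD s (noneVal M.tm) := by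
  simp only [firstPad, List.getD_eq_getElem?_getD, List.getElem?_take, if_pos hs]
  by_cases hsl : s < h.length
  · rw [List.getElem?_append_left hsl]
  · rw [List.getElem?_append_right (by omega), List.getElem?_replicate, if_pos (by omega),
      (List.getElem?_eq_none (by omega) : h[s]? = none)]
    rfl

/-- Entries of `lastPad`: position `p` holds entry `p + |h| - k` of `h` (empty in front). [folklore] -/
theorem getD_lastPad (k : ℕ) (h : List (V M)) (p : ℕ) (_hp : p < k) :
    (lastPad k h).getD p (noneVal M.tm) = if k ≤ p + h.length then h.getD (p + h.length - k) (noneVal M.tm) else noneVal M.tm := by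
  rw [lastPad, List.getD_eq_getElem?_getD, List.getElem?_drop]
  by_cases hk : k ≤ p + h.length
  · rw [if_pos hk, List.getElem?_append_right (by simp; omega), List.length_replicate, List.getD_eq_getElem?_getD]
    congr 2; omega
  · rw [if_neg hk, List.getElem?_append_left (by simp; omega), List.getElem?_replicate, if_pos (by omega)]
    rfl

/-- The summary of a history. [folklore] -/
noncomputable def summ (h : List (V M)) : Summ M :=
  (⟨min h.length (Kc M), by omega⟩, ⟨firstPad _ h, length_firstPad _ _⟩, ⟨lastPad _ h, length_lastPad _ _⟩)

/-- The new block computed from a summary (of the history INCLUDING the block just read) at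
counter value `n = |h|`. [folklore] -/
noncomputable def newBlkS (fst : List (V M)) (lst : List (V M)) (n : ℕ) : V M :=
  if hJ : n - 1 - Dly M ≤ 2 * dd M then topF (dd M) (fun s => fst.getD s (noneVal M.tm)) ⟨n - 1 - Dly M, by omega⟩
  else intF (dd M) (fun s => fst.getD s (noneVal M.tm)) (fun s => lst.getD (2 * dd M + s) (noneVal M.tm))

/-- **The Mealy transition on summaries.** [folklore] -/
noncomputable def summStep (q : Summ M) : Option (V M) → Summ M × Option (V M)
  | none => (q, none)
  | some v =>
    let n := q.1.val + 1
    let fst' : List (V M) := if q.1.val < 3 * dd M + 1 then q.2.1.1.set q.1.val v else q.2.1.1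
    let lst' : List (V M) := (q.2.2.1 ++ [v]).drop 1
    ((⟨min n (Kc M), by omega⟩,
      ⟨fst', by simp [fst']; split <;> simp⟩,
      ⟨lst', by simp [lst']⟩),
     if n ≤ Dly M then none else some (newBlkS fst' lst' n))

/-- The initial summary (empty history). [folklore] -/
noncomputable def summ0 (M : TM2ComputableAux Bool Bool) : Summ M := summ []

/-- Lists of equal length with equal default-lookups are equal. [folklore] -/
theorem ext_getD {α : Type} {l₁ l₂ : List α} (dflt : α) (hlen : l₁.length = l₂.length)
    (h : ∀ s < l₁.length, l₁.getD s dflt = l₂.getD s dflt) : l₁ = l₂ := by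
  refine List.ext_getElem hlen fun s h1 h2 => ?_
  have := h s h1
  rw [List.getD_eq_getElem?_getD, List.getD_eq_getElem?_getD, List.getElem?_eq_getElem h1,
    List.getElem?_eq_getElem h2] at this
  simpa using this

/-- Appending a block to the history updates `firstPad` by writing position `|h|` (if in range).
[folklore] -/
theorem firstPad_append (k : ℕ) (h : List (V M)) (v : V M) :
    firstPad k (h ++ [v]) = if h.length < k then (firstPad k h).set h.length v else firstPad k h := by
  refine ext_getD (noneVal M.tm) (by simp; split <;> simp) fun s hs => ?_
  rw [length_firstPad] at hs
  rw [getD_firstPad k _ s hs]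
  split
  · next hlt =>
    rw [List.getD_eq_getElem?_getD (l := (firstPad k h).set _ _)]
    by_cases hse : s = h.length
    · subst hse
      rw [List.getElem?_set_self (by simp; omega)]
      simp [List.getD_eq_getElem?_getD]
    · rw [List.getElem?_set_ne (Ne.symm hse), ← List.getD_eq_getElem?_getD, getD_firstPad k h s hs,
        List.getD_eq_getElem?_getD, List.getD_eq_getElem?_getD]
      by_cases hsl : s < h.length
      · rw [List.getElem?_append_left hsl]
      · rw [List.getElem?_append_right (by omega), (List.getElem?_eq_none (by omega) : h[s]? = none),
          (List.getElem?_eq_none (by simp; omega) : [v][s - h.length]? = none)]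
  · next hge =>
    rw [getD_firstPad k h s hs, List.getD_eq_getElem?_getD, List.getD_eq_getElem?_getD,
      List.getElem?_append_left (by omega)]

/-- Appending a block shifts `lastPad`. [folklore] -/
theorem lastPad_append (k : ℕ) (h : List (V M)) (v : V M) : lastPad k (h ++ [v]) = (lastPad k h ++ [v]).drop 1 := by
  refine ext_getD (noneVal M.tm) (by simp) fun p hp => ?_
  rw [length_lastPad] at hp
  rw [getD_lastPad k _ p hp, List.getD_eq_getElem?_getD (l := List.drop 1 _), List.getElem?_drop]
  simp only [List.length_append, List.length_singleton]
  by_cases hpk : 1 + p < k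
  · rw [List.getElem?_append_left (by simpa using hpk), ← List.getD_eq_getElem?_getD, getD_lastPad k h _ hpk]
    by_cases hk : k ≤ p + (h.length + 1)
    · rw [if_pos hk, if_pos (by omega), List.getD_eq_getElem?_getD, List.getD_eq_getElem?_getD,
        List.getElem?_append_left (by omega)]
      congr 2; omega
    · rw [if_neg hk, if_neg (by omega)]
  · rw [if_pos (by omega), List.getElem?_append_right (by simp; omega), length_lastPad, List.getD_eq_getElem?_getD,
      List.getElem?_append_right (by omega)]
    congr 2
    omega

/-- The new block read off the summary agrees with the one read off the history. [folklore] -/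
theorem newBlkS_eq (h' : List (V M)) (hlen : Dly M + 1 ≤ h'.length) :
    newBlkS (firstPad (3 * dd M + 1) h') (lastPad (6 * dd M + 1) h') (min (h'.length - 1) (Kc M) + 1) =
      newBlk h' (h'.length - 1 - Dly M) := by
  have hDK : Dly M = 3 * dd M ∧ Kc M = 5 * dd M + 2 := ⟨rfl, rfl⟩
  unfold newBlkS newBlk
  by_cases hJ : h'.length - 1 - Dly M ≤ 2 * dd M
  · have hmin : min (h'.length - 1) (Kc M) = h'.length - 1 := Nat.min_eq_left (by omega)
    have hJ' : min (h'.length - 1) (Kc M) + 1 - 1 - Dly M ≤ 2 * dd M := by rw [hmin]; omega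
    rw [dif_pos hJ', dif_pos hJ]
    have eJ : (⟨min (h'.length - 1) (Kc M) + 1 - 1 - Dly M, by omega⟩ : Fin (2 * dd M + 1)) =
        ⟨h'.length - 1 - Dly M, by omega⟩ := Fin.ext (by simp [hmin])
    rw [eJ]
    congr 1
    funext s
    exact getD_firstPad _ h' s (by have := s.2; omega)
  · have hJ' : ¬ (min (h'.length - 1) (Kc M) + 1 - 1 - Dly M ≤ 2 * dd M) := by
      rcases Nat.le_total (h'.length - 1) (Kc M) with hle | hle
      · rw [Nat.min_eq_left hle]; omega
      · rw [Nat.min_eq_right hle]; omega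
    rw [dif_neg hJ', dif_neg hJ]
    congr 1
    · funext s
      exact getD_firstPad _ h' s (by have := s.2; omega)
    · funext s
      rw [getD_lastPad _ h' _ (by have := s.2; omega), if_pos (by have := s.2; omega)]
      congr 1
      have := s.2
      omega

/-- **The summary simulates the history**: one real block. [folklore] -/
theorem summStep_summ (h : List (V M)) (v : V M) : summStep (summ h) (some v) = (summ (h ++ [v]), emit (h ++ [v])) := by
  have hDK : Dly M = 3 * dd M ∧ Kc M = 5 * dd M + 2 := ⟨rfl, rfl⟩
  have hminK : min (min h.length (Kc M) + 1) (Kc M) = min (h.length + 1) (Kc M) := by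
    rcases Nat.le_total h.length (Kc M) with hle | hle
    · rw [Nat.min_eq_left hle]
    · rw [Nat.min_eq_right hle, Nat.min_eq_right (by omega), Nat.min_eq_right (by omega)]
  simp only [summStep, summ]
  refine Prod.ext (Prod.ext (Fin.ext ?_) (Prod.ext (Subtype.ext ?_) (Subtype.ext ?_))) ?_
  · simpa using hminK
  · show (if min h.length (Kc M) < 3 * dd M + 1 then (firstPad (3 * dd M + 1) h).set (min h.length (Kc M)) v
      else firstPad (3 * dd M + 1) h) = firstPad (3 * dd M + 1) (h ++ [v])
    rw [firstPad_append]
    by_cases hlt : h.length < 3 * dd M + 1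
    · rw [Nat.min_eq_left (by omega), if_pos hlt]
    · rw [if_neg hlt, if_neg]
      rcases Nat.le_total h.length (Kc M) with hle | hle
      · rw [Nat.min_eq_left hle]; exact hlt
      · rw [Nat.min_eq_right hle]; omega
  · show ((lastPad (6 * dd M + 1) h) ++ [v]).drop 1 = lastPad (6 * dd M + 1) (h ++ [v])
    rw [lastPad_append]
  · show (if min h.length (Kc M) + 1 ≤ Dly M then none
      else some (newBlkS (if min h.length (Kc M) < 3 * dd M + 1 then (firstPad (3 * dd M + 1) h).set (min h.length (Kc M)) v
        else firstPad (3 * dd M + 1) h) (((lastPad (6 * dd M + 1) h) ++ [v]).drop 1) (min h.length (Kc M) + 1))) =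
      emit (h ++ [v])
    unfold emit
    simp only [List.length_append, List.length_singleton]
    by_cases hD : h.length + 1 ≤ Dly M
    · rw [if_pos hD, if_pos]
      rw [Nat.min_eq_left (by omega)]; exact hD
    · rw [if_neg hD, if_neg]
      · congr 1
        have e1 : (if min h.length (Kc M) < 3 * dd M + 1 then (firstPad (3 * dd M + 1) h).set (min h.length (Kc M)) v
            else firstPad (3 * dd M + 1) h) = firstPad (3 * dd M + 1) (h ++ [v]) := by
          rw [firstPad_append]
          by_cases hlt : h.length < 3 * dd M + 1
          · rw [Nat.min_eq_left (by omega), if_pos hlt]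
          · rw [if_neg hlt, if_neg]
            rcases Nat.le_total h.length (Kc M) with hle | hle
            · rw [Nat.min_eq_left hle]; exact hlt
            · rw [Nat.min_eq_right hle]; omega
        rw [e1, ← lastPad_append]
        have := newBlkS_eq (h ++ [v]) (by simp; omega)
        simp only [List.length_append, List.length_singleton, Nat.add_sub_cancel] at this
        rw [this, Nat.add_sub_cancel]
      · rcases Nat.le_total h.length (Kc M) with hle | hle
        · rw [Nat.min_eq_left hle]; exact hD
        · rw [Nat.min_eq_right hle]; omega

/-- Padding is echoed by the summary machine. [folklore] -/
theorem summStep_none (q : Summ M) : summStep q none = (q, none) := rfl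

/-- **The summary machine has the runs of the history transducer.** [folklore] -/
theorem runL_summ (h : List (V M)) (l : List (Option (V M))) :
    runL summStep (summ h) l = (summ (runL histStep h l).1, (runL histStep h l).2) := by
  induction l generalizing h with
  | nil => rfl
  | cons u l ih =>
    cases u with
    | none => simp only [runL, summStep_none, histStep]; rw [ih]
    | some v => simp only [runL, summStep_summ, histStep]; rw [ih]

/-! ### Encoding into finite index types -/

/-- Block values form a finite type. [folklore] -/
@[reducible] noncomputable def fintypeV (M : TM2ComputableAux Bool Bool) : Fintype (V M) := Fintype.ofFinite _

attribute [local instance] fintypeV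

/-- The row alphabet (padding or a block) and its size. [folklore] -/
noncomputable def nU (M : TM2ComputableAux Bool Bool) : ℕ := Fintype.card (Option (V M))

/-- The number of control states. [folklore] -/
noncomputable def nQ (M : TM2ComputableAux Bool Bool) : ℕ := Fintype.card (Summ M)

/-- Index of a row symbol. [folklore] -/
noncomputable def eU (M : TM2ComputableAux Bool Bool) : Option (V M) ≃ Fin (nU M) := Fintype.equivFin _

/-- Index of a control state. [folklore] -/
noncomputable def eQ (M : TM2ComputableAux Bool Bool) : Summ M ≃ Fin (nQ M) := Fintype.equivFin _

/-- **The transducer on indices** (the Mealy machine tabulated by `treeOf`). [folklore] -/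
noncomputable def δFin (M : TM2ComputableAux Bool Bool) (q : Fin (nQ M)) (u : Fin (nU M)) : Fin (nQ M) × Fin (nU M) :=
  (eQ M (summStep ((eQ M).symm q) ((eU M).symm u)).1, eU M (summStep ((eQ M).symm q) ((eU M).symm u)).2)

/-- The initial control on indices. [folklore] -/
noncomputable def q₀Fin (M : TM2ComputableAux Bool Bool) : Fin (nQ M) := eQ M (summ0 M)

/-- Runs on indices are encoded runs. [folklore] -/
theorem runL_δFin (q : Summ M) (l : List (Option (V M))) :
    runL (δFin M) (eQ M q) (l.map (eU M)) = (eQ M (runL summStep q l).1, (runL summStep q l).2.map (eU M)) := by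
  induction l generalizing q with
  | nil => rfl
  | cons u l ih => simp [runL, δFin, ih]

/-! ### Rows as `Λ`-terms and the pass program -/

/-- The Church-list elements (outermost first) of a stored row (which is in reading order,
innermost element of the Church list first). [folklore] -/
noncomputable def encRow (l : List (Option (V M))) : List Term := l.reverse.map fun u => oneHot (nU M) (eU M u)

/-- `R` represents the stored row `l`. [folklore] -/
def RowRep (R : Term) (l : List (Option (V M))) : Prop := RowLike R (encRow l)

/-- **The machine-step program** `CASTEP`: the pass of the summary transducer. [cite: GaboardiMarionRonchidellarocca2008, Thm. 3.9 (proof: `Tr`), Thm. 5.14] -/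
noncomputable def castep (M : TM2ComputableAux Bool Bool) : PassC := mealyPass (δFin M) (q₀Fin M)

/-- **One `CASTEP` pass computes one machine step on stored rows.** [cite: GaboardiMarionRonchidellarocca2008, Thm. 3.9 (proof: `Tr`), Thm. 5.14] -/
theorem rowRep_castep {c : M.tm.Cfg} (hg : TM2Sim.Good M.tm c) {a m : ℕ} (hm : Dly M ≤ m) {R : Term}
    (hR : RowRep R (procRow a c m)) :
    RowRep ((castep M).term.app R) (procRow (a + Dly M) (TM2Sim.stepTotal M.tm c) (m - Dly M)) := by
  unfold RowRep encRow at hR ⊢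
  have key : (mealy (δFin M) (q₀Fin M) (((procRow a c m).map (eU M)).reverse)).2 =
      ((procRow (a + Dly M) (TM2Sim.stepTotal M.tm c) (m - Dly M)).map (eU M)).reverse := by
    rw [mealy_reverse]; dsimp only
    rw [q₀Fin, runL_δFin]; dsimp only
    rw [summ0, runL_summ]; dsimp only
    rw [run_procRow_nil hg a m hm]
  have h1 := rowLike_mealyPass (δFin M) (q₀Fin M) (R := R) (us := ((procRow a c m).map (eU M)).reverse)
    (by rw [List.map_reverse, List.map_map]; rw [List.map_reverse] at hR; exact hR)
  rw [key, List.map_reverse, List.map_map] at h1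
  rw [List.map_reverse]
  exact h1

/-- **Iterated passes compute the run**: `k` passes from the stored row of configuration `t`
give the stored row of configuration `t + k`. [cite: GaboardiMarionRonchidellarocca2008, Thm. 3.9 (proof: `P(len s) Tr`), Thm. 5.14] -/
theorem rowRep_castep_iter (x u : List Bool) :
    ∀ (k : ℕ) {t a m : ℕ}, Dly M * k ≤ m → ∀ {R : Term}, RowRep R (procRow a (cfgAt M x u t) m) →
      RowRep (nestApp (List.replicate k (castep M).term) R)
        (procRow (a + Dly M * k) (cfgAt M x u (t + k)) (m - Dly M * k))
  | 0, t, a, m, _, R, hR => by simpa [nestApp] using hR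
  | k + 1, t, a, m, hk, R, hR => by
    rw [List.replicate_succ, nestApp]
    have ih := rowRep_castep_iter x u k (t := t) (a := a) (m := m) (by rw [Nat.mul_succ] at hk; omega) hR
    have h := rowRep_castep (good_cfgAt x u (t + k)) (by rw [Nat.mul_succ] at hk; omega) ih
    rw [← cfgAt_succ] at h
    have e1 : a + Dly M * k + Dly M = a + Dly M * (k + 1) := by rw [Nat.mul_succ]; omega
    have e2 : m - Dly M * k - Dly M = m - Dly M * (k + 1) := by rw [Nat.mul_succ]; omega
    have e3 : t + k + 1 = t + (k + 1) := by omega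
    rwa [e1, e2, e3] at h

/-- **Typing of `CASTEP`**: `⊢ CASTEP : Rty j U ⊸ Rty j U` with `U = tyE nU`, degree `j`.
[cite: GaboardiMarionRonchidellarocca2008, Thm. 5.14, Table 2] -/
theorem typingLe_castep (j : ℕ) :
    TypingLe j Ctx.empty (castep M).term ⟨0, .limp 0 (Rty j (tyE (nU M))) (Rty j (tyE (nU M)))⟩ :=
  typingLe_mealyPass _ _ j

end TabCA

end STA

end Literature.Computability.ImplicitComplexity

-- ============================== Part: TableauIO ==============================

/-!
## Part `TableauIO`: Start rows, certificate-writing passes and the acceptance fold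

Companion of Part `TableauCA` of this file for the two ends of the computation (GMR08 =
Gaboardi–Marion–Ronchi Della Rocca 2008, Thm. 3.9: the terms `Init` and `Ext`; Thm. 5.14: the
nondeterministic transition as a SUM of deterministic ones — here the sum `W₀ + W₁ + W_□` of the
passes writing the next certificate bit, or nothing, into the start row):

* `startBlocks x u N` — blocks `0 … N` of the start configuration on `⟨x, u⟩ = boolPair x u`
  (`procRow_start`);
* the writing pass `wpass σ` (finite control `Fin 2`: replace the first empty block by the input
  symbol of bit `σ`) and the skip pass; on the start row of certificate `u` they produce the start
  row of `u ++ [σ]` / of `u` (`rowRep_wpassO`), so that the resolved sequence of `P` summands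
  writes exactly the certificates of length `≤ P` (`rowRep_writes`, `certOf`);
* the acceptance fold (`accProg`): on the stored row of configuration `T` the answer is `0` iff
  block `1` is the accepting block, iff the machine's output is `true` (`accProg_spec`,
  `absVal_one_eq_accVal_iff`).

## References

* [GaboardiMarionRonchidellarocca2008] Thm. 3.9 (proof: `Init`, `Ext`), Thm. 5.14 (proof), Def. 5.13.
* M. Sipser, *Introduction to the Theory of Computation*, 3rd ed., Thm. 7.37 (start and accept).
-/

namespace Literature.Computability.ImplicitComplexity

namespace STA

namespace TabCA

open Literature.Computability.Complexity Literature.Computability.Complexity.Tableau Turing Term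

variable (M : TM2ComputableAux Bool Bool)

attribute [local instance] Turing.FinTM2.kFin Turing.FinTM2.ΛFin Turing.FinTM2.σFin Turing.FinTM2.Γk₀Fin
attribute [local instance] fintypeV

/-! ### The start row -/

/-- The block of input position `i` of the word `w`: its input symbol, empty beyond the word.
[cite: Sipser2012, Thm. 7.37 (proof: start row)] -/
noncomputable def cellOf (w : List Bool) (i : ℕ) : V M :=
  match w[i]? with
  | some b => symVal M b
  | none => noneVal M.tm

/-- Blocks `0 … N` of the start configuration on `boolPair x u`: the initial control, then the
input cells. [cite: Sipser2012, Thm. 7.37 (proof: start row)] -/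
noncomputable def startBlocks (x u : List Bool) (N : ℕ) : List (V M) :=
  ctrlVal M :: (List.range N).map (cellOf M (boolPair x u))

/-- Length of the start blocks. [folklore] -/
@[simp] theorem length_startBlocks (x u : List Bool) (N : ℕ) : (startBlocks M x u N).length = N + 1 := by
  simp [startBlocks]

variable {M}

/-- **The start blocks are the blocks of the start configuration.** [cite: Sipser2012, Thm. 7.37 (proof)] -/
theorem procRow_start (x u : List Bool) (N : ℕ) :
    procRow 0 (cfgAt M x u 0) (N + 1) = (startBlocks M x u N).map some := by
  rw [procRow, List.replicate_zero, List.nil_append, List.range_succ_eq_map, List.map_cons, List.map_map,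
    startBlocks, List.map_cons, List.map_map]
  refine congrArg₂ List.cons (congrArg some (absVal_cfgAt_zero_zero x u)) ?_
  refine List.map_congr_left fun i _ => ?_
  simp only [Function.comp_apply, absVal_cfgAt_zero_succ, cellOf]
  cases (boolPair x u)[i]? with
  | none => rw [noneVal_eq]; rfl
  | some b => rfl

/-- The initial control block is not the empty block. [folklore] -/
theorem ctrlVal_ne_noneVal : ctrlVal M ≠ noneVal M.tm := by
  intro h
  have := congrArg (fun v : V M => v.1.1) h
  simp [ctrlVal, noneVal] at this

/-- Input cells inside the word are not empty; beyond it they are. [folklore] -/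
theorem cellOf_eq_noneVal_iff (w : List Bool) (i : ℕ) : cellOf M w i = noneVal M.tm ↔ w.length ≤ i := by
  unfold cellOf
  cases h : w[i]? with
  | none => simpa using h
  | some b =>
    simp only
    constructor
    · intro e; exact absurd e (symVal_ne_noneVal b)
    · intro hle; rw [List.getElem?_eq_none hle] at h; cases h

/-! ### The writing passes -/

open Classical in
/-- The writing transducer of bit `σ`: control `false` = still searching; the first empty block
becomes the input cell of `σ`. [cite: GaboardiMarionRonchidellarocca2008, Thm. 5.14 (proof: `Trᵢ`)] -/
noncomputable def wStep (σ : Bool) : Bool → Option (V M) → Bool × Option (V M)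
  | b, none => (b, none)
  | true, some v => (true, some v)
  | false, some v => if v = noneVal M.tm then (true, some (symVal M σ)) else (false, some v)

/-- Writing into the start row of certificate `u` gives the start row of `u ++ [σ]`, if there is
room. [cite: GaboardiMarionRonchidellarocca2008, Thm. 5.14 (proof)] -/
theorem runL_wStep_start (σ : Bool) (x u : List Bool) {N : ℕ} (hN : (boolPair x u).length < N) :
    (runL (wStep (M := M) σ) false ((startBlocks M x u N).map some)).2 = (startBlocks M x (u ++ [σ]) N).map some := by
  -- generalise over a searching scan of the cells from position `i₀`
  have key : ∀ (k i₀ : ℕ), (boolPair x u).length < i₀ + k → i₀ ≤ (boolPair x u).length →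
      (runL (wStep (M := M) σ) false (((List.range' i₀ k).map (cellOf M (boolPair x u))).map some)).2 =
        ((List.range' i₀ k).map (cellOf M (boolPair x (u ++ [σ])))).map some := by
    intro k
    induction k with
    | zero => intro i₀ h1 h2; omega
    | succ k ih =>
      intro i₀ h1 h2
      rw [List.range'_succ, List.map_cons, List.map_cons, List.map_cons, List.map_cons, runL]
      have hbp : boolPair x (u ++ [σ]) = boolPair x u ++ [σ] := by simp [boolPair]
      by_cases hi : i₀ = (boolPair x u).length
      · -- the first empty cell: write
        have hempty : cellOf M (boolPair x u) i₀ = noneVal M.tm := (cellOf_eq_noneVal_iff _ _).2 (by omega)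
        simp only [wStep, hempty, ite_true]
        refine congrArg₂ List.cons ?_ ?_
        · unfold cellOf; rw [hbp, List.getElem?_append_right (by omega), hi, Nat.sub_self]; rfl
        · -- after writing, the pass copies; and the two words agree beyond `i₀`
          have hcopy : ∀ (l : List (V M)), (runL (wStep (M := M) σ) true (l.map some)).2 = l.map some := by
            intro l; induction l with
            | nil => rfl
            | cons v l ihl => simp [runL, wStep, ihl]
          rw [hcopy]
          congr 1
          refine List.map_congr_left fun i hi' => ?_
          rw [List.mem_range'_1] at hi'
          unfold cellOf
          rw [hbp, List.getElem?_append_right (by omega), List.getElem?_eq_none (by omega),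
            (List.getElem?_eq_none (by rw [List.length_singleton]; omega) : [σ][i - (boolPair x u).length]? = none)]
      · -- a filled cell: keep searching
        have hfull : cellOf M (boolPair x u) i₀ ≠ noneVal M.tm := fun e => by
          have := (cellOf_eq_noneVal_iff _ _).1 e; omega
        simp only [wStep, hfull, ite_false]
        refine congrArg₂ List.cons ?_ (ih (i₀ + 1) (by omega) (by omega))
        unfold cellOf; rw [hbp, List.getElem?_append_left (by omega)]
  have hctrl : wStep (M := M) σ false (some (ctrlVal M)) = (false, some (ctrlVal M)) := by
    simp [wStep, ctrlVal_ne_noneVal]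
  simp only [startBlocks, List.map_cons, runL, hctrl]
  rw [List.range_eq_range']
  exact congrArg (List.cons (some (ctrlVal M))) (key N 0 (by omega) (Nat.zero_le _))

/-- The writing pass as a Mealy machine on indices, and its initial control. [folklore] -/
noncomputable def δW (σ : Bool) (q : Fin 2) (u : Fin (nU M)) : Fin 2 × Fin (nU M) :=
  let r := wStep (M := M) σ (q.val = 1) ((eU M).symm u)
  (if r.1 then 1 else 0, eU M r.2)

/-- The skip pass as a Mealy machine on indices (identity). [folklore] -/
def δI (n : ℕ) (q : Fin 1) (u : Fin n) : Fin 1 × Fin n := (q, u)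

/-- Runs of the writing machine on indices are encoded runs. [folklore] -/
theorem runL_δW (σ : Bool) (b : Bool) (l : List (Option (V M))) :
    runL (δW (M := M) σ) (if b then 1 else 0) (l.map (eU M)) =
      (if (runL (wStep (M := M) σ) b l).1 then 1 else 0, (runL (wStep (M := M) σ) b l).2.map (eU M)) := by
  induction l generalizing b with
  | nil => rfl
  | cons u l ih =>
    rw [List.map_cons, runL, runL]
    have e : δW (M := M) σ (if b then 1 else 0) (eU M u) =
        (if (wStep (M := M) σ b u).1 then 1 else 0, eU M (wStep (M := M) σ b u).2) := by
      cases b <;> simp [δW]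
    rw [e]
    simp only [ih, List.map_cons]

/-- Runs of the skip machine are the identity. [folklore] -/
theorem runL_δI {n : ℕ} (l : List (Fin n)) : runL (δI n) 0 l = (0, l) := by
  induction l with
  | nil => rfl
  | cons u l ih => simp [runL, δI, ih]

/-- The pass of an optional bit: write `σ` for `some σ`, skip for `none` (the three summands
`W₀ + W₁ + W_□`). [cite: GaboardiMarionRonchidellarocca2008, Thm. 5.14 (proof: `Tr₁ + ⋯ + Trₙ`)] -/
noncomputable def wpassO (M : TM2ComputableAux Bool Bool) : Option Bool → PassC
  | some σ => mealyPass (δW (M := M) σ) 0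
  | none => mealyPass (δI (nU M)) 0

/-- **Semantics of the writing/skip passes on start rows.** [cite: GaboardiMarionRonchidellarocca2008, Thm. 5.14 (proof)] -/
theorem rowRep_wpassO (o : Option Bool) (x u : List Bool) {N : ℕ} (hN : (boolPair x u).length < N) {R : Term}
    (hR : RowRep R ((startBlocks M x u N).map some)) :
    RowRep ((wpassO M o).term.app R) ((startBlocks M x (u ++ o.toList) N).map some) := by
  unfold RowRep encRow at hR ⊢
  cases o with
  | none =>
    have key : (mealy (δI (nU M)) 0 ((((startBlocks M x u N).map some).map (eU M)).reverse)).2 =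
        (((startBlocks M x u N).map some).map (eU M)).reverse := by
      rw [mealy_reverse, runL_δI]
    have h1 := rowLike_mealyPass (δI (nU M)) 0 (R := R) (us := (((startBlocks M x u N).map some).map (eU M)).reverse)
      (by rw [List.map_reverse, List.map_map]; rw [List.map_reverse] at hR; exact hR)
    rw [key, List.map_reverse, List.map_map] at h1
    rw [List.map_reverse]
    simpa [wpassO, Function.comp_def] using h1
  | some σ =>
    have key : (mealy (δW (M := M) σ) 0 ((((startBlocks M x u N).map some).map (eU M)).reverse)).2 =
        (((startBlocks M x (u ++ [σ]) N).map some).map (eU M)).reverse := by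
      rw [mealy_reverse]; dsimp only
      have := runL_δW (M := M) σ false ((startBlocks M x u N).map some)
      simp only [Bool.false_eq_true, ite_false] at this
      rw [this]; dsimp only
      rw [runL_wStep_start σ x u hN]
    have h1 := rowLike_mealyPass (δW (M := M) σ) 0 (R := R) (us := (((startBlocks M x u N).map some).map (eU M)).reverse)
      (by rw [List.map_reverse, List.map_map]; rw [List.map_reverse] at hR; exact hR)
    rw [key, List.map_reverse, List.map_map] at h1
    rw [List.map_reverse]
    simpa [wpassO, Function.comp_def] using h1

/-- The certificate written by a resolved sequence of summands, listed OUTERMOST PASS FIRST (the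
innermost pass, applied first, writes the first bit). [folklore] -/
def certOf (os : List (Option Bool)) : List Bool := os.reverse.filterMap id

/-- The certificate of one more outer pass. [folklore] -/
theorem certOf_cons (o : Option Bool) (os : List (Option Bool)) : certOf (o :: os) = certOf os ++ o.toList := by
  cases o <;> simp [certOf]

/-- The written certificate is no longer than the number of passes. [folklore] -/
theorem length_certOf_le (os : List (Option Bool)) : (certOf os).length ≤ os.length := by
  rw [certOf, ← List.length_reverse (as := os)]
  exact List.length_filterMap_le _ _

/-- Every certificate of length `≤ P` is written by some sequence of `P` summands. [folklore] -/
theorem exists_certOf_eq (u : List Bool) {P : ℕ} (hu : u.length ≤ P) :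
    ∃ os : List (Option Bool), os.length = P ∧ certOf os = u := by
  refine ⟨(List.replicate (P - u.length) none ++ u.map some).reverse, by simp; omega, ?_⟩
  rw [certOf, List.reverse_reverse, List.filterMap_append]
  simp

/-- **The resolved writing passes produce the start row of the written certificate.**
[cite: GaboardiMarionRonchidellarocca2008, Thm. 5.14 (proof)] -/
theorem rowRep_writes (x : List Bool) {N : ℕ} :
    ∀ (os : List (Option Bool)), 2 * x.length + 2 + os.length ≤ N → ∀ {R : Term},
      RowRep R ((startBlocks M x [] N).map some) →
      RowRep (nestApp (os.map fun o => (wpassO M o).term) R) ((startBlocks M x (certOf os) N).map some)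
  | [], _, R, hR => by simpa [nestApp, certOf] using hR
  | o :: os, hlen, R, hR => by
    rw [List.map_cons, nestApp, certOf_cons]
    have ih := rowRep_writes x os (by simp at hlen; omega) hR
    refine rowRep_wpassO o x (certOf os) ?_ ih
    have := length_certOf_le os
    simp only [length_boolPair, List.length_cons] at hlen ⊢
    omega

/-- **Typing of the writing/skip passes**: `Rty j U ⊸ Rty j U`, degree `j`. [cite: GaboardiMarionRonchidellarocca2008, Thm. 5.14, Table 2] -/
theorem typingLe_wpassO (o : Option Bool) (j : ℕ) :
    TypingLe j Ctx.empty (wpassO M o).term ⟨0, .limp 0 (Rty j (tyE (nU M))) (Rty j (tyE (nU M)))⟩ := by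
  cases o with
  | none => exact typingLe_mealyPass _ _ j
  | some σ => exact typingLe_mealyPass _ _ j

/-! ### The acceptance fold -/

/-- Control of the acceptance fold: before block `0`, after block `0`, verdict. [folklore] -/
inductive AccSt : Type
  | start | saw0 | acc | rej
  deriving DecidableEq, Fintype

open Classical in
/-- The acceptance transition: skip the padding, skip block `0`, compare block `1` with the
accepting block. [cite: GaboardiMarionRonchidellarocca2008, Thm. 3.9 (proof: `Ext`)] -/
noncomputable def accStep : AccSt → Option (V M) → AccSt
  | q, none => q
  | .start, some _ => .saw0
  | .saw0, some v => if v = accVal M then .acc else .rej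
  | .acc, some _ => .acc
  | .rej, some _ => .rej

open Classical in
/-- The acceptance fold over a stored row with at least two blocks ends in `acc` iff block `1` is
the accepting block. [cite: GaboardiMarionRonchidellarocca2008, Thm. 3.9 (proof: `Ext`)] -/
theorem foldl_accStep_procRow (a : ℕ) (c : M.tm.Cfg) {m : ℕ} (hm : 2 ≤ m) :
    (procRow a c m).foldl (accStep (M := M)) .start = (if absVal c 1 = accVal M then AccSt.acc else AccSt.rej) := by
  rw [procRow, List.foldl_append]
  have h1 : (List.replicate a (none : Option (V M))).foldl (accStep (M := M)) .start = .start := by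
    induction a with
    | zero => rfl
    | succ a ih => rw [List.replicate_succ, List.foldl_cons]; exact ih
  rw [h1]
  obtain ⟨m', rfl⟩ : ∃ m', m = m' + 2 := ⟨m - 2, by omega⟩
  rw [show m' + 2 = 1 + 1 + m' by omega, List.range_add, List.range_add, List.map_append, List.map_append,
    List.foldl_append, List.foldl_append]
  simp only [List.range_one, List.map_cons, List.map_nil, List.foldl_cons, List.foldl_nil, accStep, Nat.add_zero]
  have habs : ∀ (l : List ℕ) (q : AccSt), (q = .acc ∨ q = .rej) →
      (l.map fun J => some (absVal c J)).foldl (accStep (M := M)) q = q := by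
    intro l; induction l with
    | nil => intro q _; rfl
    | cons J l ih =>
      intro q hq
      rw [List.map_cons, List.foldl_cons]
      rcases hq with rfl | rfl
      · exact ih _ (Or.inl rfl)
      · exact ih _ (Or.inr rfl)
  split
  · exact habs _ _ (Or.inl rfl)
  · exact habs _ _ (Or.inr rfl)

/-- Index encoding of the acceptance control. [folklore] -/
noncomputable def eA : AccSt ≃ Fin (Fintype.card AccSt) := Fintype.equivFin _

/-- The acceptance transition on indices. [folklore] -/
noncomputable def δA (q : Fin (Fintype.card AccSt)) (u : Fin (nU M)) : Fin (Fintype.card AccSt) :=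
  eA (accStep (M := M) (eA.symm q) ((eU M).symm u))

/-- **The acceptance program** `OUT`. [cite: GaboardiMarionRonchidellarocca2008, Thm. 3.9 (proof: `Ext`), Def. 5.13] -/
noncomputable def accProg (M : TM2ComputableAux Bool Bool) : Term :=
  outProg (δA (M := M)) (eA .start) fun q => decide (eA.symm q = .acc)

/-- The arguments of the acceptance spine (the shape used by the round analysis). [folklore] -/
noncomputable def accArgs (M : TM2ComputableAux Bool Bool) : List Term :=
  soC (treeOf' (δA (M := M))) :: oneHot (Fintype.card AccSt) (eA AccSt.start) ::
    (List.finRange (Fintype.card AccSt)).map fun q => encBit (!decide (eA.symm q = .acc))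

/-- The acceptance arguments are closed, and there are at least two of them. [folklore] -/
theorem goodArgs_accArgs : GoodArgs (accArgs M) := by
  obtain ⟨h1, h2, h3⟩ := outProg_closed_parts (δA (M := M)) (eA AccSt.start) fun q => decide (eA.symm q = .acc)
  refine ⟨by simp [accArgs], ?_⟩
  intro a ha
  simp only [accArgs, List.mem_cons] at ha
  rcases ha with rfl | rfl | ha
  · exact h1
  · exact h2
  · exact h3 a ha

/-- `accProg R` head-reduces to the acceptance spine. [folklore] -/
theorem accProg_hbStar {R : Term} (hR : R.Closed) : HBStar ((accProg M).app R) (R.apps (accArgs M)) := by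
  obtain ⟨h1, h2, h3⟩ := outProg_closed_parts (δA (M := M)) (eA AccSt.start) fun q => decide (eA.symm q = .acc)
  exact OUTc_hbStar h1 h2 h3 hR

open Classical in
/-- **Semantics of the acceptance spine on a stored row**: `0` iff block `1` is accepting.
[cite: GaboardiMarionRonchidellarocca2008, Thm. 3.9 (proof: `Ext`), Def. 5.13] -/
theorem accArgs_spec {R : Term} {a m : ℕ} {c : M.tm.Cfg} (hm : 2 ≤ m) (hR : RowRep R (procRow a c m)) :
    BetaReduces (R.apps (accArgs M)) (encBit (!decide (absVal c 1 = accVal M))) := by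
  unfold RowRep encRow at hR
  have h := outProg_spec (δA (M := M)) (eA AccSt.start) (fun q => decide (eA.symm q = .acc)) (R := R)
    (us := ((procRow a c m).map (eU M)).reverse) (by rw [List.map_reverse, List.map_map]; rw [List.map_reverse] at hR; exact hR)
  have hfold : ((procRow a c m).map (eU M)).reverse.foldr (fun (u : Fin (nU M)) (q : Fin (Fintype.card AccSt)) => δA (M := M) q u)
      (eA AccSt.start) = eA ((procRow a c m).foldl (accStep (M := M)) .start) := by
    rw [List.foldr_reverse, List.foldl_map]
    suffices ∀ (l : List (Option (V M))) (q : AccSt),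
        l.foldl (fun (acc' : Fin (Fintype.card AccSt)) (u : Option (V M)) => δA (M := M) acc' (eU M u)) (eA q) =
          eA (l.foldl (accStep (M := M)) q) from this _ _
    intro l; induction l with
    | nil => intro q; rfl
    | cons u l ih => intro q; rw [List.foldl_cons, List.foldl_cons, ← ih]; simp [δA]
  rw [hfold, foldl_accStep_procRow a c hm, Equiv.symm_apply_apply] at h
  have h' : BetaReduces (R.apps (accArgs M)) (encBit (!decide ((if absVal c 1 = accVal M then AccSt.acc else AccSt.rej) = AccSt.acc))) := h
  by_cases hp : absVal c 1 = accVal M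
  · simpa [hp] using h'
  · simpa [hp] using h'

/-- **Typing of the acceptance program**: `⊢ accProg : Rty j U ⊸ B`, degree `j`. [cite: GaboardiMarionRonchidellarocca2008, Thm. 3.9 (proof: `Ext`)] -/
theorem typingLe_accProg (j : ℕ) : TypingLe j Ctx.empty (accProg M) ⟨0, .limp 0 (Rty j (tyE (nU M))) tyB⟩ :=
  typingLe_outProg _ _ _ j

/-! ### Reading the machine's answer off block `1` -/

/-- **Block `1` of configuration `T` is the accepting block iff the output is `true`**, when the
machine halts within `T` steps with output `[f w]` (deterministic and total).
[cite: Sipser2012, Thm. 7.37 (proof: accept)] -/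
theorem absVal_one_eq_accVal_iff {x u : List Bool} {T : ℕ} {b : Bool} (hrun : M.OutputsWithin (boolPair x u) [b] T) :
    absVal (cfgAt M x u T) 1 = accVal M ↔ b = true := by
  have hgood : TM2Sim.Good M.tm (cfgAt M x u T) := good_cfgAt x u T
  rw [cfgAt_eq_haltList hrun] at hgood ⊢
  rw [absVal_haltList_one]
  constructor
  · intro hacc
    rw [TM2Comp.haltList_eq] at hgood
    have hsym : TM2Sim.IsSym M.tm M.tm.k₁ (M.outputAlphabet.symm b) := hgood M.tm.k₁ _ (by simp)
    simp only [accVal, List.getElem?_cons_zero, Prod.mk.injEq, true_and] at hacc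
    exact M.outputAlphabet.symm.injective (outCell_some_inj hsym hacc)
  · rintro rfl; rfl

end TabCA

end STA

end Literature.Computability.ImplicitComplexity

-- ============================== Part: Horner ==============================

/-!
## Part `Horner`: Polynomials of the input length as `STA` numerals (GMR08 Lemma 3.6)

GMR08 (= Gaboardi–Marion–Ronchi Della Rocca 2008) Lemma 3.6: "Let `P` be a polynomial and
`deg(P)` its degree. Then there is a term `P̲` defining `P` typable as `⊢ P̲ : !^{deg P} N ⊸ N_{2deg(P)+1}`."
Here the polynomial is evaluated at the LENGTH of the input word and each occurrence of the
length is a separate copy `len sᵢ` of the input (the copies are merged by rule `(m)` in the final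
program), in Horner form:

* `hornerS s [c₀,…,c_k] = add c̲₀ (mult (len s) (add c̲₁ (⋯)))`, and with distinct variables for
  the copies `hornerV v [c₀,…]` (slots `v, v+1, …`);
* **semantics** `numLike_hornerS`: `hornerS s̲ cs` iterates `hornerEval |s| cs` times;
  every `p : Polynomial ℕ` has such a coefficient list (`exists_hornerEval_eq_eval`);
* **typing** `typingLe_hornerV`: in the graded context `sᵥ₊ₜ : !ᵗ S` the term has type
  `N_{2k+1}` with degree `2k` (`k` = number of coefficients), by `add : Nᵢ ⊸ Nᵢ ⊸ Nᵢ₊₁`,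
  `mult : N₁ ⊸ !N_j ⊸ N_{j+1}`, `len : S ⊸ N₁`.

## References

* [GaboardiMarionRonchidellarocca2008] Lemma 3.6, §3.2.
-/

namespace Literature.Computability.ImplicitComplexity

namespace STA

open Term

/-! ### Horner terms -/

/-- Horner evaluation of a coefficient list (constant term first). [folklore] -/
def hornerEval (n : ℕ) : List ℕ → ℕ
  | [] => 0
  | c :: cs => c + n * hornerEval n cs

/-- The Horner term with the same term `s` for every copy of the input. [cite: GaboardiMarionRonchidellarocca2008, Lemma 3.6] -/
def hornerS (s : Term) : List ℕ → Term
  | [] => church 0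
  | c :: cs => add.apps [church c, mult.apps [lenC.app s, hornerS s cs]]

/-- The Horner term with the copies of the input in the distinct slots `v, v + 1, …`.
[cite: GaboardiMarionRonchidellarocca2008, Lemma 3.6] -/
def hornerV : ℕ → List ℕ → Term
  | _, [] => church 0
  | v, c :: cs => add.apps [church c, mult.apps [lenC.app (.var v), hornerV (v + 1) cs]]

/-- Substitution moves into the copies. [folklore] -/
theorem hornerS_substp (s : Term) (cs : List ℕ) (τ : ℕ → Term) : (hornerS s cs).substp τ = hornerS (s.substp τ) cs := by
  induction cs with
  | nil => exact (closed_church 0).substp_eq τ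
  | cons c cs ih =>
    simp [hornerS, Term.substp, closed_add.substp_eq, (closed_church c).substp_eq, closed_mult.substp_eq,
      closed_lenC.substp_eq, ih]

/-- Renaming moves into the copies. [folklore] -/
theorem hornerS_rename (s : Term) (cs : List ℕ) (ρ : ℕ → ℕ) : (hornerS s cs).rename ρ = hornerS (s.rename ρ) cs := by
  rw [rename_eq_substp, hornerS_substp, ← rename_eq_substp]

/-- Merging all copy slots onto one variable gives the one-copy Horner term. [folklore] -/
theorem hornerV_rename (ρ : ℕ → ℕ) (j : ℕ) : ∀ (v : ℕ) (cs : List ℕ), (∀ t < cs.length, ρ (v + t) = j) →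
    (hornerV v cs).rename ρ = hornerS (.var j) cs
  | v, [], _ => (closed_church 0).rename_eq ρ
  | v, c :: cs, hρ => by
    have h0 : ρ v = j := by simpa using hρ 0 (by simp)
    have ih := hornerV_rename ρ j (v + 1) cs fun t ht => by rw [Nat.add_assoc, Nat.add_comm 1]; exact hρ (t + 1) (by simpa using ht)
    simp [hornerV, hornerS, Term.rename, closed_add.rename_eq, (closed_church c).rename_eq, closed_mult.rename_eq,
      closed_lenC.rename_eq, h0, ih]

/-- The Horner term of a closed copy is closed. [folklore] -/
theorem closed_hornerS {s : Term} (hs : s.Closed) (cs : List ℕ) : (hornerS s cs).Closed := by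
  induction cs with
  | nil => exact closed_church 0
  | cons c cs ih => simp [hornerS, closed_add, closed_church, closed_mult, closed_lenC, hs, ih]

/-- **Semantics**: the Horner term on a word iterates `hornerEval |w| cs` times. [cite: GaboardiMarionRonchidellarocca2008, Lemma 3.6] -/
theorem numLike_hornerS (w : List Bool) : ∀ cs : List ℕ, NumLike (hornerS (encWord w) cs) (hornerEval w.length cs)
  | [] => numLike_church 0
  | c :: cs => by
    rw [hornerS, hornerEval]
    exact numLike_add (numLike_church c) (numLike_mult (numLike_lenC_encWord w) (numLike_hornerS w cs))

/-! ### Every polynomial has a Horner list -/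

/-- Horner evaluation is the sum `∑ cᵢ nⁱ`. [folklore] -/
theorem hornerEval_eq_sum (n : ℕ) (cs : List ℕ) :
    hornerEval n cs = ∑ i ∈ Finset.range cs.length, cs.getD i 0 * n ^ i := by
  induction cs with
  | nil => simp [hornerEval]
  | cons c cs ih =>
    rw [hornerEval, ih, List.length_cons, Finset.sum_range_succ', Finset.mul_sum]
    simp only [List.getD_cons_succ, List.getD_cons_zero, pow_zero, mul_one, pow_succ]
    rw [Nat.add_comm]
    congr 1
    exact Finset.sum_congr rfl fun i _ => by ring

/-- **Every polynomial over `ℕ` is a Horner list** (its coefficients). [cite: GaboardiMarionRonchidellarocca2008, Lemma 3.6] -/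
theorem exists_hornerEval_eq_eval (p : Polynomial ℕ) : ∃ cs : List ℕ, ∀ n : ℕ, hornerEval n cs = p.eval n := by
  refine ⟨(List.range (p.natDegree + 1)).map p.coeff, fun n => ?_⟩
  rw [hornerEval_eq_sum, Polynomial.eval_eq_sum_range, List.length_map, List.length_range]
  refine Finset.sum_congr rfl fun i hi => ?_
  rw [Finset.mem_range] at hi
  rw [List.getD_eq_getElem?_getD, List.getElem?_map, List.getElem?_range hi, Option.map_some, Option.getD_some]

/-! ### Typing in the graded context of copies -/

/-- The graded context of the copies: slot `v + t` holds the input at modality `t`, for `t < L`.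
[folklore] -/
def hctx (v L : ℕ) : Ctx := fun x => if v ≤ x ∧ x < v + L then some ⟨x - v, tyS 1⟩ else none

/-- The singleton context of one linear copy. [folklore] -/
theorem hctx_one (v : ℕ) : hctx v 1 = fun x => if x = v then some ⟨0, tyS 1⟩ else none := by
  funext x
  by_cases hx : x = v
  · subst hx; simp [hctx]
  · simp only [hctx, if_neg hx]; rw [if_neg (by omega)]

/-- No copy: the empty context. [folklore] -/
theorem hctx_zero (v : ℕ) : hctx v 0 = Ctx.empty := by
  funext x; simp [hctx, Ctx.empty]

/-- The graded context splits into the first copy and the promoted rest. [folklore] -/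
theorem hctx_split (v L : ℕ) : (hctx v (L + 1)).Split (hctx v 1) (hctx (v + 1) L).bang := by
  intro x
  simp only [hctx, Ctx.bang]
  by_cases hx : x = v
  · subst hx
    left
    rw [if_pos (by omega), if_pos (by omega), if_neg (by omega)]
    exact ⟨by simp, rfl⟩
  · right
    rw [if_neg (by omega)]
    refine ⟨rfl, ?_⟩
    by_cases h2 : v + 1 ≤ x ∧ x < v + 1 + L
    · rw [if_pos h2, if_pos (by omega)]
      simp only [Option.map_some, SoftTy.bang, Option.some.injEq, SoftTy.mk.injEq, and_true]
      omega
    · rw [if_neg h2, if_neg (by omega)]; rfl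

/-- `len` of the linear copy in slot `v`. [cite: GaboardiMarionRonchidellarocca2008, §3.2 (`len`)] -/
theorem typingLe_lenC_var (v : ℕ) : TypingLe 1 (hctx v 1) (lenC.app (.var v)) ⟨0, Nty 1⟩ := by
  rw [hctx_one]
  exact TypingLe.app (Ctx.Split.all_right _) (typingLe_lenC 1) ⟨0, by omega, typing_var_single v 0 (tyS 1)⟩

/-- **Typing of the Horner term**: `N_{2k+1}` with degree `2k` in the graded context of its `k`
copies. [cite: GaboardiMarionRonchidellarocca2008, Lemma 3.6] -/
theorem typingLe_hornerV : ∀ (v : ℕ) (cs : List ℕ),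
    TypingLe (2 * cs.length) (hctx v cs.length) (hornerV v cs) ⟨0, Nty (2 * cs.length + 1)⟩
  | v, [] => by
    rw [List.length_nil, hctx_zero]
    exact typingLe_church 0 (by omega)
  | v, c :: cs => by
    rw [List.length_cons, hornerV]
    set L := cs.length with hL
    have ih := typingLe_hornerV (v + 1) cs
    -- `mult (len s_v) !(rest)`
    have hmult : TypingLe (2 * L + 2) (hctx v (L + 1)) (mult.apps [lenC.app (.var v), hornerV (v + 1) cs]) ⟨0, Nty (2 * L + 2)⟩ := by
      simp only [apps_cons, apps_nil]
      refine TypingLe.app (hctx_split v L) (k := 1) (B := Nty (2 * L + 1)) ?_ ?_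
      · refine TypingLe.app (Ctx.Split.all_right _) ?_ ((typingLe_lenC_var v).mono (by omega))
        have := typingLe_mult 1 (2 * L + 1)
        rw [show 1 + (2 * L + 1) = 2 * L + 2 by omega] at this
        exact this.mono (by omega)
      · exact ih.sp.mono (by omega)
    simp only [apps_cons, apps_nil]
    refine TypingLe.app (Ctx.Split.all_right _) ?_ (hmult.mono (by omega))
    refine TypingLe.app_empty ((typingLe_add (2 * L + 2)).mono (by omega) |>.of_eq_ty ?_) ((typingLe_church c (i := 2 * L + 2) (by omega)).mono (by omega))
    rfl

end STA

end Literature.Computability.ImplicitComplexity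

-- ============================== Part: Row0 ==============================

/-!
## Part `Row0`: The start-row program `Init` of the NP-completeness of `STA₊`

GMR08 (= Gaboardi–Marion–Ronchi Della Rocca 2008) Thm. 3.9: "for every polynomial `R` we have a
term `Init_R : !S ⊸ TM` that given an input string `s`, returns a configuration in the initial
state with the tape of length `R(|s|)` filled by `s`". In the tree's tableau form the initial
configuration on `⟨x, u⟩ = boolPair x u` is the row
`[ctrl, x₀, x₀, x₁, x₁, …, 0, 1, (certificate, written later), empty, …]`; as a Church list read
from block `0` (innermost) it is built by

  `ROW0 = λp s c z. p (λa. c ∅ a) (c 1̂ (c 0̂ (s (λb. b BR₀ BR₁ c) I (c ĉtrl z))))`,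

the padding iterated by the numeral `p`, the doubled bits produced by folding the input word `s`
with a case on each bit whose branches `BR_b = λc' k a. k (c' b̂ (c' b̂ a))` receive the
constructor AFTER the selection (linearity). This file gives the term over an abstract alphabet
(`Row0Consts`), its `β`-semantics (`row0_spec`: it folds like the explicit list `row0List`) and
its typing `⊢ ROW0 : N_i ⊸ S ⊸ Rty (max i 2 + 1) U` (`typingLe_ROW0`), the five occurrences of
`c` (at modalities `i, 0, 0, 2, 0`) being raised and merged by rule `(m)` (`merge_slots`).

## References

* [GaboardiMarionRonchidellarocca2008] Thm. 3.9 (proof: `Init`), Thm. 5.14, §3.2, Table 2.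
-/

namespace Literature.Computability.ImplicitComplexity

namespace STA

open Term

/-! ### Raising and merging a family of copy slots -/

/-- **Merging graded copies**: if the slots `x ∈ S` hold copies `!^{lev x} A` with `lev x ≤ Λ`,
slot `j ∉ S` is empty, and `N` bounds the support of the context and the free indices of `M`,
then the copies can be raised to `!^Λ A` and merged onto `j : !^{Λ+1} A`. [cite: GaboardiMarionRonchidellarocca2008, Table 2 (m)] -/
theorem merge_slots {d : ℕ} {Γ : Ctx} {M : Term} {μ : SoftTy} (h : Typing d Γ M μ) (S : Finset ℕ) (j : ℕ)
    (lev : ℕ → ℕ) (Λ : ℕ) (A : LinTy) (hS : ∀ x ∈ S, Γ x = some ⟨lev x, A⟩ ∧ lev x ≤ Λ) (hj : Γ j = none) (hjS : j ∉ S)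
    (N : ℕ) (hN : Γ N = none) (hNS : N ∉ S) (hNM : N ∉ M.fv) :
    Typing d (fun x => if x = j then some ⟨Λ + 1, A⟩ else if x ∈ S then none else Γ x) (M.rename (mpxRen S j)) μ := by
  classical
  -- raise every slot of `S` to modality `Λ`
  have hraise : ∀ (S' : Finset ℕ), S' ⊆ S →
      Typing d (fun x => if x ∈ S' then some ⟨Λ, A⟩ else Γ x) M μ := by
    intro S'
    induction S' using Finset.induction with
    | empty => intro _; simpa using h
    | @insert x₀ S' hx₀ ih =>
      intro hsub
      have hx₀S : x₀ ∈ S := hsub (Finset.mem_insert_self _ _)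
      have ih' := ih (fun y hy => hsub (Finset.mem_insert_of_mem hy))
      obtain ⟨hΓx₀, hlev⟩ := hS x₀ hx₀S
      have hcur : (fun x => if x ∈ S' then some ⟨Λ, A⟩ else Γ x) x₀ = some ⟨lev x₀, A⟩ := by
        simp [hx₀, hΓx₀]
      have hNx₀ : N ≠ x₀ := fun e => hNS (e ▸ hx₀S)
      have hcurN : (fun x => if x ∈ S' then some ⟨Λ, A⟩ else Γ x) N = none := by
        have : N ∉ S' := fun hm => hNS (hsub (Finset.mem_insert_of_mem hm))
        simp [this, hN]
      have := ih'.raiseN (i := x₀) hcur (J := N) hcurN hNM (Λ - lev x₀)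
      rw [show lev x₀ + (Λ - lev x₀) = Λ by omega] at this
      have e : Function.update (fun x => if x ∈ S' then some ⟨Λ, A⟩ else Γ x) x₀ (some ⟨Λ, A⟩) =
          (fun x => if x ∈ insert x₀ S' then some ⟨Λ, A⟩ else Γ x) := by
        funext x
        by_cases hx : x = x₀
        · subst hx; simp
        · rw [Function.update_of_ne hx]; simp [Finset.mem_insert, hx]
      rw [e] at this
      exact this
  have h1 := hraise S (subset_refl S)
  refine Typing.mpx S j (σ := ⟨Λ, A⟩) h1 (fun x hx => by simp [hx]) (by simp [hjS, hj]) ?_ rfl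
  funext x
  simp only [Ctx.mpx, SoftTy.bang]
  by_cases hxS : x ∈ S
  · simp [hxS, show x ≠ j from fun e => hjS (e ▸ hxS)]
  · by_cases hxj : x = j
    · simp [hxj, hjS]
    · simp [hxS, hxj]

/-- The same in the degree-bounded form. [folklore] -/
theorem TypingLe.merge_slots {D : ℕ} {Γ : Ctx} {M : Term} {μ : SoftTy} (h : TypingLe D Γ M μ) (S : Finset ℕ) (j : ℕ)
    (lev : ℕ → ℕ) (Λ : ℕ) (A : LinTy) (hS : ∀ x ∈ S, Γ x = some ⟨lev x, A⟩ ∧ lev x ≤ Λ) (hj : Γ j = none) (hjS : j ∉ S)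
    (N : ℕ) (hN : Γ N = none) (hNS : N ∉ S) (hNM : N ∉ M.fv) :
    TypingLe D (fun x => if x = j then some ⟨Λ + 1, A⟩ else if x ∈ S then none else Γ x) (M.rename (mpxRen S j)) μ := by
  obtain ⟨d, hd, h⟩ := h
  exact ⟨d, hd, STA.merge_slots h S j lev Λ A hS hj hjS N hN hNS hNM⟩

/-! ### The constants of the row alphabet -/

/-- The closed data of the start row: empty block, the two separator blocks, the control block, the
two bit blocks, all of one closed type `U`. [folklore] -/
structure Row0Consts where
  /-- the alphabet type -/
  U : LinTy
  /-- the empty block -/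
  NV : Term
  /-- the separator block `1` (second) -/
  ST : Term
  /-- the separator block `0` (first) -/
  SF : Term
  /-- the initial control block -/
  CT : Term
  /-- the block of a bit -/
  Vb : Bool → Term
  hU : U.ClosedT
  hNV : NV.Closed
  hST : ST.Closed
  hSF : SF.Closed
  hCT : CT.Closed
  hVb : ∀ b, (Vb b).Closed
  tNV : TypingLe 0 Ctx.empty NV ⟨0, U⟩
  tST : TypingLe 0 Ctx.empty ST ⟨0, U⟩
  tSF : TypingLe 0 Ctx.empty SF ⟨0, U⟩
  tCT : TypingLe 0 Ctx.empty CT ⟨0, U⟩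
  tVb : ∀ b, TypingLe 0 Ctx.empty (Vb b) ⟨0, U⟩

variable (κ : Row0Consts)

/-! ### The term -/

/-- The branch `BR_b = λc' k a. k (c' b̂ (c' b̂ a))` writing the doubled bit `b`. [cite: GaboardiMarionRonchidellarocca2008, Thm. 3.9 (proof: `Init`)] -/
def BR (b : Bool) : Term := lams 3 ((Term.var 1).app ((Term.var 2).apps [κ.Vb b, (Term.var 2).apps [κ.Vb b, .var 0]]))

/-- The identity `I = λa.a`. [folklore] -/
def ID : Term := .lam (.var 0)

/-- The body of `ROW0` under its four binders `p s c z`. [cite: GaboardiMarionRonchidellarocca2008, Thm. 3.9 (proof: `Init`)] -/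
def row0Body : Term :=
  (Term.var 3).apps [.lam ((Term.var 2).apps [κ.NV, .var 0]),
    (Term.var 1).apps [κ.ST, (Term.var 1).apps [κ.SF,
      ((Term.var 2).apps [.lam ((Term.var 0).apps [BR κ false, BR κ true, .var 2]), ID]).app ((Term.var 1).apps [κ.CT, .var 0])]]]

/-- **`ROW0 = λp s c z. p (λa. c ∅ a) (c 1̂ (c 0̂ (s (λb. b BR₀ BR₁ c) I (c ĉtrl z))))`.**
[cite: GaboardiMarionRonchidellarocca2008, Thm. 3.9 (proof: `Init`)] -/
def ROW0 : Term := lams 4 (row0Body κ)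

/-- The branches are closed. [folklore] -/
theorem closed_BR (b : Bool) : (BR κ b).Closed := by
  simp only [BR, Closed, bnd_lams, Nat.zero_add, bnd_app, bnd_var, Bool.and_eq_true, decide_eq_true_eq]
  exact ⟨by omega, bnd_apps (by decide) (by simp [(κ.hVb b).bnd 3])⟩

/-- `I` is closed. [folklore] -/
theorem closed_ID : ID.Closed := by decide

/-- `ROW0` is closed. [folklore] -/
theorem closed_ROW0 : (ROW0 κ).Closed := by
  simp only [ROW0, row0Body, Closed, bnd_lams, Nat.zero_add]
  refine bnd_apps (by decide) ?_
  intro N hN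
  simp only [List.mem_cons, List.not_mem_nil, or_false] at hN
  rcases hN with rfl | rfl
  · rw [bnd_lam]; exact bnd_apps (by decide) (by simp [κ.hNV.bnd 5])
  · refine bnd_apps (by decide) ?_
    intro N hN
    simp only [List.mem_cons, List.not_mem_nil, or_false] at hN
    rcases hN with rfl | rfl
    · exact κ.hST.bnd 4
    · refine bnd_apps (by decide) ?_
      intro N hN
      simp only [List.mem_cons, List.not_mem_nil, or_false] at hN
      rcases hN with rfl | rfl
      · exact κ.hSF.bnd 4
      · simp only [bnd_app, Bool.and_eq_true]
        refine ⟨bnd_apps (by decide) ?_, bnd_apps (by decide) (by simp [κ.hCT.bnd 4])⟩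
        intro N hN
        simp only [List.mem_cons, List.not_mem_nil, or_false] at hN
        rcases hN with rfl | rfl
        · rw [bnd_lam]
          exact bnd_apps (by decide) (by simp [(closed_BR κ false).bnd 5, (closed_BR κ true).bnd 5])
        · exact closed_ID.bnd 4

/-! ### Semantics -/

/-- The reversed doubled bits `[b̂ₙ₋₁, b̂ₙ₋₁, …, b̂₀, b̂₀]`. [folklore] -/
def revDoubled (x : List Bool) : List Term := x.reverse.flatMap fun b => [κ.Vb b, κ.Vb b]

/-- The elements of the start row built by `ROW0`, outermost first. [cite: GaboardiMarionRonchidellarocca2008, Thm. 3.9 (proof: `Init`)] -/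
def row0List (pad : ℕ) (x : List Bool) : List Term := List.replicate pad κ.NV ++ [κ.ST, κ.SF] ++ revDoubled κ x ++ [κ.CT]

/-- Chains over an appended list nest. [folklore] -/
theorem chain_append (K Z : Term) (l₁ l₂ : List Term) : chain K Z (l₁ ++ l₂) = chain K (chain K Z l₂) l₁ := by
  induction l₁ with
  | nil => rfl
  | cons v l₁ ih => rw [List.cons_append, chain_cons, chain_cons, ih]

/-- The branch writes its bit twice in front of the accumulator and continues. [folklore] -/
theorem BR_spec (b : Bool) {K C A : Term} (hK : K.Closed) (hC : C.Closed) (hA : A.Closed) :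
    BetaReduces ((BR κ b).apps [K, C, A]) (C.app (K.apps [κ.Vb b, K.apps [κ.Vb b, A]])) := by
  have h := apps_lams_betaReduces ((Term.var 1).app ((Term.var 2).apps [κ.Vb b, (Term.var 2).apps [κ.Vb b, .var 0]])) 3
    [K, C, A] rfl (by simp [hK, hC, hA])
  have e : ((Term.var 1).app ((Term.var 2).apps [κ.Vb b, (Term.var 2).apps [κ.Vb b, .var 0]])).substp (instN 3 [K, C, A]) =
      C.app (K.apps [κ.Vb b, K.apps [κ.Vb b, A]]) := by
    simp [Term.substp, instN, List.getD, (κ.hVb b).substp_eq]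
  rwa [e] at h

/-- The fold of the input word with the bit-case step, applied to an accumulator, writes the
reversed doubled bits in front of it. [cite: GaboardiMarionRonchidellarocca2008, Thm. 3.9 (proof: `Init`)] -/
theorem xpart_spec {K : Term} (hK : K.Closed) : ∀ (x : List Bool) {A : Term}, A.Closed →
    BetaReduces ((chain (.lam ((Term.var 0).apps [BR κ false, BR κ true, K])) ID (x.map encBit)).app A)
      (chain K A (revDoubled κ x))
  | [], A, _ => by
    simp only [List.map_nil, chain_nil, revDoubled, List.reverse_nil, List.flatMap_nil]
    exact BetaReduces.single (by have := RedB.beta (.var 0) A; exact this)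
  | b :: x, A, hA => by
    rw [List.map_cons, chain_cons]
    set BOX : Term := .lam ((Term.var 0).apps [BR κ false, BR κ true, K]) with hBOX
    set C := chain BOX ID (x.map encBit) with hC
    have hBRs : (BR κ false).Closed ∧ (BR κ true).Closed := ⟨closed_BR κ false, closed_BR κ true⟩
    have hBOXc : BOX.Closed := by
      rw [hBOX, closed_lam]; exact bnd_apps (by decide) (by simp [hBRs.1.bnd 1, hBRs.2.bnd 1, hK.bnd 1])
    have hCc : C.Closed := closed_chain hBOXc closed_ID fun v hv => by
      obtain ⟨b', -, rfl⟩ := List.mem_map.1 hv; exact closed_encBit b'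
    -- (BOX b̂ C) A →β (b̂ BR₀ BR₁ K) C A
    show BetaReduces ((BOX.apps [encBit b, C]).app A) _
    rw [show (BOX.apps [encBit b, C]).app A = BOX.apps [encBit b, C, A] from rfl]
    have h1 := apps_lams_betaReduces_append ((Term.var 0).apps [BR κ false, BR κ true, K]) (q := 1) (ts := [encBit b])
      rfl (by simp [closed_encBit b]) [C, A]
    have e1 : ((Term.var 0).apps [BR κ false, BR κ true, K]).substp (instN 1 [encBit b]) = (encBit b).apps [BR κ false, BR κ true, K] := by
      simp [Term.substp, instN, List.getD, hBRs.1.substp_eq, hBRs.2.substp_eq, hK.substp_eq]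
    rw [show BOX = lams 1 ((Term.var 0).apps [BR κ false, BR κ true, K]) from rfl]
    rw [e1] at h1
    refine h1.trans' ?_
    -- select the branch
    rw [← apps_append]
    have h2 := apps_oneHot_betaReduces_append (q := 2) (i := if b then 1 else 0) (by cases b <;> simp)
      (ts := [BR κ false, BR κ true]) rfl (by simp [hBRs.1, hBRs.2]) [K, C, A]
    have eb : encBit b = oneHot 2 (if b then 1 else 0) := by cases b <;> rfl
    rw [← eb] at h2
    refine (show BetaReduces ((encBit b).apps ([BR κ false, BR κ true] ++ [K, C, A])) _ from h2).trans' ?_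
    have e2 : [BR κ false, BR κ true].getD (if b then 1 else 0) (.var 0) = BR κ b := by cases b <;> rfl
    rw [e2]
    refine (BR_spec κ b hK hCc hA).trans' ?_
    -- continue with the inner fold
    have hA' : (K.apps [κ.Vb b, K.apps [κ.Vb b, A]]).Closed := by simp [hK, κ.hVb b, hA]
    refine (xpart_spec hK x hA').trans' ?_
    simp only [revDoubled, List.reverse_cons, List.flatMap_append, List.flatMap_cons, List.flatMap_nil, List.append_nil,
      chain_append, chain_cons, chain_nil]
    exact BetaReduces.rfl' _

/-- Iterating the padding box prepends empty blocks. [folklore] -/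
theorem pad_spec {K : Term} (hK : K.Closed) (pad : ℕ) {R : Term} (hR : R.Closed) :
    BetaReduces (iterT (.lam (K.apps [κ.NV, .var 0])) pad R) (chain K R (List.replicate pad κ.NV)) := by
  induction pad with
  | zero => exact BetaReduces.rfl' _
  | succ pad ih =>
    rw [iterT_succ, List.replicate_succ, chain_cons]
    have hc : (chain K R (List.replicate pad κ.NV)).Closed :=
      closed_chain hK hR fun v hv => by rw [List.eq_of_mem_replicate hv]; exact κ.hNV
    refine (BetaReduces.appR _ ih).trans' ?_
    have := apps_lams_betaReduces (K.apps [κ.NV, .var 0]) 1 [chain K R (List.replicate pad κ.NV)] rfl (by simp [hc])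
    have e : (K.apps [κ.NV, .var 0]).substp (instN 1 [chain K R (List.replicate pad κ.NV)]) =
        K.apps [κ.NV, chain K R (List.replicate pad κ.NV)] := by
      simp [Term.substp, instN, List.getD, hK.substp_eq, κ.hNV.substp_eq]
    rw [e] at this
    exact this

/-- **Semantics of `ROW0`**: on a numeral iterating `pad` times and the word `x`, `ROW0` folds like
the start row `row0List pad x`. [cite: GaboardiMarionRonchidellarocca2008, Thm. 3.9 (proof: `Init`)] -/
theorem row0_spec {P : Term} {pad : ℕ} (hP : NumLike P pad) (x : List Bool) :
    RowLike ((ROW0 κ).apps [P, encWord x]) (row0List κ pad x) := by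
  refine ⟨by simp [closed_ROW0, hP.1, closed_encWord], fun K Z hK hZ => ?_⟩
  rw [← apps_append]
  have h1 := apps_lams_betaReduces (row0Body κ) 4 [P, encWord x, K, Z] rfl (by simp [hP.1, closed_encWord x, hK, hZ])
  have hBRs : (BR κ false).Closed ∧ (BR κ true).Closed := ⟨closed_BR κ false, closed_BR κ true⟩
  have e1 : (row0Body κ).substp (instN 4 [P, encWord x, K, Z]) =
      P.apps [.lam (K.apps [κ.NV, .var 0]),
        K.apps [κ.ST, K.apps [κ.SF,
          (((encWord x).apps [.lam ((Term.var 0).apps [BR κ false, BR κ true, K]), ID]).app (K.apps [κ.CT, Z]))]]] := by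
    simp [row0Body, ID, Term.substp, Term.up, instN, List.getD, κ.hNV.substp_eq, κ.hST.substp_eq, κ.hSF.substp_eq,
      κ.hCT.substp_eq, hBRs.1.substp_eq, hBRs.2.substp_eq, hK.rename_eq]
  rw [e1] at h1
  refine h1.trans' ?_
  -- the x-part
  have hKCZ : (K.apps [κ.CT, Z]).Closed := by simp [hK, κ.hCT, hZ]
  have hBOXc : (Term.lam ((Term.var 0).apps [BR κ false, BR κ true, K])).Closed := by
    rw [closed_lam]; exact bnd_apps (by decide) (by simp [hBRs.1.bnd 1, hBRs.2.bnd 1, hK.bnd 1])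
  have hbits : ∀ v ∈ x.map encBit, v.Closed := fun v hv => by obtain ⟨b, -, rfl⟩ := List.mem_map.1 hv; exact closed_encBit b
  have hx : BetaReduces (((encWord x).apps [.lam ((Term.var 0).apps [BR κ false, BR κ true, K]), ID]).app (K.apps [κ.CT, Z]))
      (chain K (K.apps [κ.CT, Z]) (revDoubled κ x)) := by
    rw [encWord_eq_encList]
    refine (BetaReduces.appL (apps_encList_betaReduces hbits hBOXc closed_ID []) _).trans' ?_
    exact xpart_spec κ hK x hKCZ
  have hREST : BetaReduces (K.apps [κ.ST, K.apps [κ.SF,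
      (((encWord x).apps [.lam ((Term.var 0).apps [BR κ false, BR κ true, K]), ID]).app (K.apps [κ.CT, Z]))]])
      (chain K Z (κ.ST :: κ.SF :: (revDoubled κ x ++ [κ.CT]))) := by
    simp only [chain_cons, chain_append, chain_nil]
    exact BetaReduces.apps_args K (List.Forall₂.cons (BetaReduces.rfl' _) (List.Forall₂.cons
      (BetaReduces.apps_args K (List.Forall₂.cons (BetaReduces.rfl' _) (List.Forall₂.cons hx List.Forall₂.nil)))
      List.Forall₂.nil))
  have hRESTc : (chain K Z (κ.ST :: κ.SF :: (revDoubled κ x ++ [κ.CT]))).Closed := by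
    refine closed_chain hK hZ fun v hv => ?_
    simp only [List.mem_cons, List.mem_append, revDoubled, List.mem_flatMap, List.not_mem_nil, or_false] at hv
    rcases hv with rfl | rfl | ⟨b, -, hb⟩ | rfl
    · exact κ.hST
    · exact κ.hSF
    · rcases hb with rfl | rfl <;> exact κ.hVb b
    · exact κ.hCT
  -- the padding iteration
  refine (BetaReduces.apps_args P (List.Forall₂.cons (BetaReduces.rfl' _) (List.Forall₂.cons hREST List.Forall₂.nil))).trans' ?_
  have hboxP : (Term.lam (K.apps [κ.NV, .var 0])).Closed := by
    rw [closed_lam]; exact bnd_apps (hK.bnd 1) (by simp [κ.hNV.bnd 1])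
  refine (hP.2 _ _ hboxP hRESTc).trans' ?_
  have eL : row0List κ pad x = List.replicate pad κ.NV ++ (κ.ST :: κ.SF :: (revDoubled κ x ++ [κ.CT])) := by
    simp [row0List]
  rw [eL, chain_append]
  exact pad_spec κ hK pad hRESTc

/-! ### Typing -/

/-- `F = U ⊸ α ⊸ α`, the type of the row constructor. [folklore] -/
abbrev F : LinTy := Fty κ.U

/-- **`⊢ BR_b : !F ⊸ (α ⊸ α) ⊸ α ⊸ α`** (the constructor used twice, multiplexed). [cite: GaboardiMarionRonchidellarocca2008, Table 2 (m)] -/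
theorem typingLe_BR (b : Bool) :
    TypingLe 0 Ctx.empty (BR κ b) ⟨0, .limp 1 (F κ) (.limp 0 (.limp 0 (.tvar 0) (.tvar 0)) (.limp 0 (.tvar 0) (.tvar 0)))⟩ := by
  -- body with the two copies of `c'` in slots 3, 4
  have h1 : TypingLe 0 (Ctx.ofList [some ⟨0, .tvar 0⟩, some ⟨0, .limp 0 (.tvar 0) (.tvar 0)⟩, none, some ⟨0, F κ⟩, some ⟨0, F κ⟩])
      ((Term.var 1).app ((Term.var 3).apps [κ.Vb b, (Term.var 4).apps [κ.Vb b, .var 0]])) ⟨0, .tvar 0⟩ := by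
    simp only [apps_cons, apps_nil]
    refine TypingLe.appL (l₁ := [none, some ⟨0, .limp 0 (.tvar 0) (.tvar 0)⟩, none, none, none])
      (l₂ := [some ⟨0, .tvar 0⟩, none, none, some ⟨0, F κ⟩, some ⟨0, F κ⟩]) (by simp [SplitL]) (typingLe_var rfl le_rfl) ?_
    refine TypingLe.appL (l₁ := [none, none, none, some ⟨0, F κ⟩, none]) (l₂ := [some ⟨0, .tvar 0⟩, none, none, none, some ⟨0, F κ⟩])
      (k := 0) (B := .tvar 0) (by simp [SplitL]) ?_ ?_
    · exact TypingLe.appL (l₁ := [none, none, none, some ⟨0, F κ⟩, none]) (l₂ := [none, none, none, none, none]) (by simp [SplitL])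
        (typingLe_var rfl le_rfl) ((κ.tVb b).inNones _ (by simp))
    · refine TypingLe.appL (l₁ := [none, none, none, none, some ⟨0, F κ⟩]) (l₂ := [some ⟨0, .tvar 0⟩, none, none, none, none])
        (by simp [SplitL]) ?_ (typingLe_var rfl le_rfl)
      exact TypingLe.appL (l₁ := [none, none, none, none, some ⟨0, F κ⟩]) (l₂ := [none, none, none, none, none]) (by simp [SplitL])
        (typingLe_var rfl le_rfl) ((κ.tVb b).inNones _ (by simp))
  have h2 := h1.merge_slots {3, 4} 2 (fun _ => 0) 0 (F κ) (fun x hx => by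
      simp only [Finset.mem_insert, Finset.mem_singleton] at hx; rcases hx with rfl | rfl <;> exact ⟨rfl, le_rfl⟩)
    rfl (by decide) 5 rfl (by decide) (by simp [Term.fv, (κ.hVb b).fv_eq])
  have ectx : (fun x => if x = 2 then some ⟨0 + 1, F κ⟩ else if x ∈ ({3, 4} : Finset ℕ) then none
      else Ctx.ofList [some ⟨0, .tvar 0⟩, some ⟨0, .limp 0 (.tvar 0) (.tvar 0)⟩, none, some ⟨0, F κ⟩, some ⟨0, F κ⟩] x) =
      Ctx.ofList [some ⟨0, .tvar 0⟩, some ⟨0, .limp 0 (.tvar 0) (.tvar 0)⟩, some ⟨1, F κ⟩] := by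
    funext x
    rcases x with _ | _ | _ | _ | _ | x <;> simp
  have etm : ((Term.var 1).app ((Term.var 3).apps [κ.Vb b, (Term.var 4).apps [κ.Vb b, .var 0]])).rename (mpxRen {3, 4} 2) =
      (Term.var 1).app ((Term.var 2).apps [κ.Vb b, (Term.var 2).apps [κ.Vb b, .var 0]]) := by
    simp [Term.rename, mpxRen, (κ.hVb b).rename_eq]
  rw [ectx, etm] at h2
  rw [← Ctx.ofList_nil, BR]
  exact TypingLe.lamL (TypingLe.lamL (TypingLe.lamL h2))

/-- **`⊢ I : α ⊸ α`.** [folklore] -/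
theorem typingLe_ID (A : LinTy) : TypingLe 0 Ctx.empty ID ⟨0, .limp 0 A A⟩ := by
  rw [← Ctx.ofList_nil, ID]
  exact TypingLe.lamL (typingLe_var (l := [some ⟨0, A⟩]) (i := 0) rfl le_rfl)

/-- The body of `ROW0` with the five occurrences of `c` in the distinct slots `4 … 8` (modalities
`i, 0, 0, 2, 0`). [folklore] -/
def row0Body' : Term :=
  (Term.var 3).apps [.lam ((Term.var 5).apps [κ.NV, .var 0]),
    (Term.var 5).apps [κ.ST, (Term.var 6).apps [κ.SF,
      ((Term.var 2).apps [.lam ((Term.var 0).apps [BR κ false, BR κ true, .var 8]), ID]).app ((Term.var 8).apps [κ.CT, .var 0])]]]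

/-- The context of `row0Body'`. [folklore] -/
def row0Ctx' (i : ℕ) : List (Option SoftTy) :=
  [some ⟨0, .tvar 0⟩, none, some ⟨0, tyS 1⟩, some ⟨0, Nty i⟩, some ⟨i, F κ⟩, some ⟨0, F κ⟩, some ⟨0, F κ⟩, some ⟨2, F κ⟩, some ⟨0, F κ⟩]

/-- Typing the body with distinct copies. [cite: GaboardiMarionRonchidellarocca2008, Thm. 3.9 (proof: `Init`), Table 2] -/
theorem typingLe_row0Body' (i : ℕ) : TypingLe (max i 2) (Ctx.ofList (row0Ctx' κ i)) (row0Body' κ) ⟨0, .tvar 0⟩ := by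
  have hF : F κ = .limp 0 κ.U (.limp 0 (.tvar 0) (.tvar 0)) := rfl
  rw [row0Body', row0Ctx']
  simp only [apps_cons, apps_nil]
  -- p BOXP REST
  refine TypingLe.appL
    (l₁ := [none, none, none, some ⟨0, Nty i⟩, some ⟨i, F κ⟩, none, none, none, none])
    (l₂ := [some ⟨0, .tvar 0⟩, none, some ⟨0, tyS 1⟩, none, none, some ⟨0, F κ⟩, some ⟨0, F κ⟩, some ⟨2, F κ⟩, some ⟨0, F κ⟩])
    (k := 0) (B := .tvar 0) (by simp [SplitL]) ?_ ?_
  · refine TypingLe.appL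
      (l₁ := [none, none, none, some ⟨0, Nty i⟩, none, none, none, none, none])
      (l₂ := [none, none, none, none, some ⟨i, F κ⟩, none, none, none, none])
      (k := i) (B := .limp 0 (.tvar 0) (.tvar 0)) (by simp [SplitL]) ?_ ?_
    · have := (typingLe_var (l := [none, none, none, some ⟨0, Nty i⟩, none, none, none, none, none]) (i := 3) rfl
        (Nat.zero_le (max i 2))).allE (.tvar 0)
      rwa [inst_Nty_body] at this
    · -- the padding box, promoted `i` times
      have h0 : TypingLe 0 (Ctx.ofList [none, none, none, none, some ⟨0, F κ⟩, none, none, none, none])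
          (.lam ((Term.var 5).apps [κ.NV, .var 0])) ⟨0, .limp 0 (.tvar 0) (.tvar 0)⟩ := by
        refine TypingLe.lamL ?_
        simp only [apps_cons, apps_nil]
        refine TypingLe.appL (l₁ := [none, none, none, none, none, some ⟨0, F κ⟩, none, none, none, none])
          (l₂ := [some ⟨0, .tvar 0⟩, none, none, none, none, none, none, none, none, none]) (by simp [SplitL]) ?_
          (typingLe_var rfl le_rfl)
        exact TypingLe.appL (l₁ := [none, none, none, none, none, some ⟨0, F κ⟩, none, none, none, none])
          (l₂ := [none, none, none, none, none, none, none, none, none, none]) (by simp [SplitL, hF]) (typingLe_var rfl le_rfl)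
          (κ.tNV.inNones _ (by simp))
      have := TypingLe.spNL i h0
      simp only [List.map_cons, List.map_nil, Option.map_none, Option.map_some, Nat.zero_add] at this
      exact this.mono (by omega)
  · -- c ST (c SF XP)
    refine TypingLe.appL
      (l₁ := [none, none, none, none, none, some ⟨0, F κ⟩, none, none, none])
      (l₂ := [some ⟨0, .tvar 0⟩, none, some ⟨0, tyS 1⟩, none, none, none, some ⟨0, F κ⟩, some ⟨2, F κ⟩, some ⟨0, F κ⟩])
      (k := 0) (B := .tvar 0) (by simp [SplitL]) ?_ ?_
    · exact TypingLe.appL (l₁ := [none, none, none, none, none, some ⟨0, F κ⟩, none, none, none])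
        (l₂ := [none, none, none, none, none, none, none, none, none]) (by simp [SplitL, hF])
        (typingLe_var rfl (Nat.zero_le _)) ((κ.tST.mono (Nat.zero_le _)).inNones _ (by simp))
    · refine TypingLe.appL
        (l₁ := [none, none, none, none, none, none, some ⟨0, F κ⟩, none, none])
        (l₂ := [some ⟨0, .tvar 0⟩, none, some ⟨0, tyS 1⟩, none, none, none, none, some ⟨2, F κ⟩, some ⟨0, F κ⟩])
        (k := 0) (B := .tvar 0) (by simp [SplitL]) ?_ ?_
      · exact TypingLe.appL (l₁ := [none, none, none, none, none, none, some ⟨0, F κ⟩, none, none])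
          (l₂ := [none, none, none, none, none, none, none, none, none]) (by simp [SplitL, hF])
          (typingLe_var rfl (Nat.zero_le _)) ((κ.tSF.mono (Nat.zero_le _)).inNones _ (by simp))
      · -- XP = (s BOXX I) (c CT z)
        refine TypingLe.appL
          (l₁ := [none, none, some ⟨0, tyS 1⟩, none, none, none, none, some ⟨2, F κ⟩, none])
          (l₂ := [some ⟨0, .tvar 0⟩, none, none, none, none, none, none, none, some ⟨0, F κ⟩])
          (k := 0) (B := .tvar 0) (by simp [SplitL]) ?_ ?_
        · refine TypingLe.appL
            (l₁ := [none, none, some ⟨0, tyS 1⟩, none, none, none, none, some ⟨2, F κ⟩, none])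
            (l₂ := [none, none, none, none, none, none, none, none, none])
            (k := 0) (B := .limp 0 (.tvar 0) (.tvar 0)) (by simp [SplitL]) ?_ (((typingLe_ID (.tvar 0)).mono (Nat.zero_le _)).inNones _ (by simp))
          refine TypingLe.appL
            (l₁ := [none, none, some ⟨0, tyS 1⟩, none, none, none, none, none, none])
            (l₂ := [none, none, none, none, none, none, none, some ⟨2, F κ⟩, none])
            (k := 1) (B := .limp 0 tyB (.limp 0 (.limp 0 (.tvar 0) (.tvar 0)) (.limp 0 (.tvar 0) (.tvar 0)))) (by simp [SplitL]) ?_ ?_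
          · have := (typingLe_var (l := [none, none, some ⟨0, tyS 1⟩, none, none, none, none, none, none]) (i := 2) rfl
              (Nat.zero_le (max i 2))).allE (.limp 0 (.tvar 0) (.tvar 0))
            rwa [inst_tyS_body] at this
          · -- the bit-case box, with `c` at modality 1 inside, promoted once
            have h0 : TypingLe 1 (Ctx.ofList [none, none, none, none, none, none, none, some ⟨1, F κ⟩, none])
                (.lam ((Term.var 0).apps [BR κ false, BR κ true, .var 8]))
                ⟨0, .limp 0 tyB (.limp 0 (.limp 0 (.tvar 0) (.tvar 0)) (.limp 0 (.tvar 0) (.tvar 0)))⟩ := by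
              refine TypingLe.lamL ?_
              simp only [apps_cons, apps_nil]
              refine TypingLe.appL (l₁ := [some ⟨0, tyB⟩, none, none, none, none, none, none, none, none, none])
                (l₂ := [none, none, none, none, none, none, none, none, some ⟨1, F κ⟩, none]) (by simp [SplitL]) ?_
                (typingLe_var rfl le_rfl)
              set τ : LinTy := .limp 1 (F κ) (.limp 0 (.limp 0 (.tvar 0) (.tvar 0)) (.limp 0 (.tvar 0) (.tvar 0))) with hτ
              refine typingLe_apps_closed (q := 2) (X := τ) (args := [BR κ false, BR κ true]) ?_ rfl fun a ha => ?_
              · exact (typingLe_var (l := [some ⟨0, tyB⟩, none, none, none, none, none, none, none, none, none]) (i := 0) rfl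
                  (Nat.zero_le 1)).allE τ
              · simp only [List.mem_cons, List.not_mem_nil, or_false] at ha
                rcases ha with rfl | rfl <;> exact (typingLe_BR κ _).mono (Nat.zero_le 1)
            have := TypingLe.spNL 1 h0
            simp only [List.map_cons, List.map_nil, Option.map_none, Option.map_some] at this
            exact this.mono (by omega)
        · refine TypingLe.appL
            (l₁ := [none, none, none, none, none, none, none, none, some ⟨0, F κ⟩])
            (l₂ := [some ⟨0, .tvar 0⟩, none, none, none, none, none, none, none, none])
            (by simp [SplitL]) ?_ (typingLe_var rfl (Nat.zero_le _))
          exact TypingLe.appL (l₁ := [none, none, none, none, none, none, none, none, some ⟨0, F κ⟩])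
            (l₂ := [none, none, none, none, none, none, none, none, none]) (by simp [SplitL, hF])
            (typingLe_var rfl (Nat.zero_le _)) ((κ.tCT.mono (Nat.zero_le _)).inNones _ (by simp))

/-- The row index of `ROW0`: one more than the highest modality of an occurrence of `c`. [folklore] -/
def jRow (i : ℕ) : ℕ := max i 2 + 1

/-- **Typing of `ROW0`**: `⊢ ROW0 : Nᵢ ⊸ S₁ ⊸ Rty (jRow i) U`, degree `max i 2`.
[cite: GaboardiMarionRonchidellarocca2008, Thm. 3.9 (proof: `Init`), Table 2 (m), (sp), (∀I)] -/
theorem typingLe_ROW0 (i : ℕ) :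
    TypingLe (max i 2) Ctx.empty (ROW0 κ) ⟨0, .limp 0 (Nty i) (.limp 0 (tyS 1) (Rty (jRow i) κ.U))⟩ := by
  have h1 := typingLe_row0Body' κ i
  have h2 := h1.merge_slots {4, 5, 6, 7, 8} 1 (fun x => if x = 4 then i else if x = 7 then 2 else 0) (max i 2) (F κ)
    (fun x hx => by
      simp only [Finset.mem_insert, Finset.mem_singleton] at hx
      rcases hx with rfl | rfl | rfl | rfl | rfl <;> simp [row0Ctx'])
    rfl (by decide) 9 rfl (by decide) ?_
  · have ectx : (fun x => if x = 1 then some ⟨max i 2 + 1, F κ⟩ else if x ∈ ({4, 5, 6, 7, 8} : Finset ℕ) then none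
        else Ctx.ofList (row0Ctx' κ i) x) =
        Ctx.ofList [some ⟨0, .tvar 0⟩, some ⟨max i 2 + 1, F κ⟩, some ⟨0, tyS 1⟩, some ⟨0, Nty i⟩] := by
      funext x
      rcases x with _ | _ | _ | _ | _ | _ | _ | _ | _ | x <;> simp [row0Ctx']
    have etm : (row0Body' κ).rename (mpxRen {4, 5, 6, 7, 8} 1) = row0Body κ := by
      simp [row0Body', row0Body, Term.rename, mpxRen, liftRen, κ.hNV.rename_eq, κ.hST.rename_eq, κ.hSF.rename_eq, κ.hCT.rename_eq,
        (closed_BR κ false).rename_eq, (closed_BR κ true).rename_eq, ID]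
    rw [ectx, etm] at h2
    rw [← Ctx.ofList_nil, ROW0]
    refine TypingLe.lamL (TypingLe.lamL ?_)
    refine TypingLe.allIL ?_
    rw [shiftL_closed (by
      intro a ha σ e
      simp only [List.mem_cons, List.not_mem_nil, or_false] at ha
      rcases ha with rfl | rfl <;> cases e
      · rw [tyS_eq_Rty, tyB_eq_tyE]; exact closedT_Rty 1 (closedT_tyE 2)
      · exact closedT_Nty i)]
    exact TypingLe.lamL (TypingLe.lamL h2)
  · -- slot 9 is not free in the body
    intro hmem
    have hb : (row0Body' κ).bnd 9 = true := by
      rw [row0Body']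
      refine bnd_apps (by decide) ?_
      intro N hN
      simp only [List.mem_cons, List.not_mem_nil, or_false] at hN
      rcases hN with rfl | rfl
      · rw [bnd_lam]; exact bnd_apps (by decide) (by simp [κ.hNV.bnd 10])
      · refine bnd_apps (by decide) ?_
        intro N hN
        simp only [List.mem_cons, List.not_mem_nil, or_false] at hN
        rcases hN with rfl | rfl
        · exact κ.hST.bnd 9
        · refine bnd_apps (by decide) ?_
          intro N hN
          simp only [List.mem_cons, List.not_mem_nil, or_false] at hN
          rcases hN with rfl | rfl
          · exact κ.hSF.bnd 9
          · simp only [bnd_app, Bool.and_eq_true]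
            refine ⟨bnd_apps (by decide) ?_, bnd_apps (by decide) (by simp [κ.hCT.bnd 9])⟩
            intro N hN
            simp only [List.mem_cons, List.not_mem_nil, or_false] at hN
            rcases hN with rfl | rfl
            · rw [bnd_lam]; exact bnd_apps (by decide) (by simp [(closed_BR κ false).bnd 10, (closed_BR κ true).bnd 10])
            · exact closed_ID.bnd 9
    exact absurd (lt_of_bnd hb 9 hmem) (lt_irrefl 9)

end STA

end Literature.Computability.ImplicitComplexity

-- ============================== Part: NPProgram ==============================

/-!
## Part `NPProgram`: NP-completeness of `STA₊`: every language of NP is soft-sum-representable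

The second half of `STAPlusCapturesNP` (GMR08 = Gaboardi–Marion–Ronchi Della Rocca 2008,
**Thm. 5.14**: "a decision problem decidable by a nondeterministic Turing machine in polynomial
time is definable by a term `NDTM_P` of `STA₊`", whose transition RELATION is programmed as the
SUM of deterministic transition terms). For the tree's verifier class `NP = polyExists P` over
`FinTM2` deciders, the program of `L` (verifier `M` for `L'`, certificate bound `p`) is

  `M_L = λs. OUT (T̲(s) CASTEP (P̲(s) (W_□ + W₀ + W₁) (ROW0 PAD̲(s) s)))`

(`SoftTypeAssignmentTableauCA/IO/Row0/Horner.lean`): build the start row of `⟨x, ·⟩`, let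
`P(|x|) = p(|x|)` nondeterministic passes write a certificate `u` of length `≤ p(|x|)`, run
`T(|x|)` machine steps, read the answer. This file assembles it and proves

* `decides_prog`: `x ∈ L ⟺ M_L x̲ →βγ* 0` — `⟸` by advancing the `β`-steps that unfold the numerals
  (`Reduces.of_betaReduces`), the forced leftmost rounds (`det_rounds`, `choice_rounds_zero`)
  which yield a resolved sequence of summands, and the `β`-semantics of the resolved program
  (`resolved_spec`); `⟹` by performing the rounds of the witnessing certificate and `β`-confluence;
* `typing_prog`: `⊢ M_L : !ⁿ S ⊸ B` for some `n` and degree, the copies of the input being merged by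
  rule `(m)` (`merge_slots`);
* `exists_softSum_of_mem_NP : L ∈ NP → ∃ t, SoftSumRepresentsAtLevel t L`.

## References

* [GaboardiMarionRonchidellarocca2008] Thm. 5.14, Def. 5.13, Thm. 3.9, Lemma 3.6.
* [AroraBarak2009] Def. 2.1 (NP by verifiers).
-/

namespace Literature.Computability.ImplicitComplexity

namespace STA

namespace TabCA

open Literature.Computability.Complexity Literature.Computability.Complexity.Tableau Turing Term

variable (M : TM2ComputableAux Bool Bool)

attribute [local instance] Turing.FinTM2.kFin Turing.FinTM2.ΛFin Turing.FinTM2.σFin Turing.FinTM2.Γk₀Fin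
attribute [local instance] fintypeV

/-! ### The row constants of the machine -/

/-- The `Λ`-term of a row symbol. [folklore] -/
noncomputable def encUt (u : Option (V M)) : Term := oneHot (nU M) (eU M u)

/-- The row constants of the machine: empty block, separators, control, bits. [folklore] -/
noncomputable def κM : Row0Consts where
  U := tyE (nU M)
  NV := encUt M (some (noneVal M.tm))
  ST := encUt M (some (symVal M true))
  SF := encUt M (some (symVal M false))
  CT := encUt M (some (ctrlVal M))
  Vb := fun b => encUt M (some (symVal M b))
  hU := closedT_tyE _
  hNV := closed_oneHot (eU M _).2
  hST := closed_oneHot (eU M _).2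
  hSF := closed_oneHot (eU M _).2
  hCT := closed_oneHot (eU M _).2
  hVb := fun _ => closed_oneHot (eU M _).2
  tNV := typingLe_oneHot (eU M _).2
  tST := typingLe_oneHot (eU M _).2
  tSF := typingLe_oneHot (eU M _).2
  tCT := typingLe_oneHot (eU M _).2
  tVb := fun _ => typingLe_oneHot (eU M _).2

variable {M}

/-- The input cells of a word, within a long enough range: the symbols then empties. [folklore] -/
theorem map_cellOf_range (w : List Bool) {N : ℕ} (hN : w.length ≤ N) :
    (List.range N).map (cellOf M w) = w.map (symVal M) ++ List.replicate (N - w.length) (noneVal M.tm) := by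
  refine List.ext_getElem (by simp; omega) fun i h1 h2 => ?_
  rw [List.getElem_map, List.getElem_range]
  simp only [List.length_map, List.length_range] at h1
  by_cases hi : i < w.length
  · rw [List.getElem_append_left (by simpa using hi), List.getElem_map, cellOf, List.getElem?_eq_getElem hi]
  · rw [List.getElem_append_right (by simpa using hi), List.getElem_replicate, cellOf, List.getElem?_eq_none (by omega)]

/-- The start row in reading order, as `Λ`-terms. [folklore] -/
theorem map_enc_startBlocks (x : List Bool) (pad : ℕ) :
    ((startBlocks M x [] (2 * x.length + 2 + pad)).map some).map (encUt M) =
      (κM M).CT :: ((x.flatMap fun b => [(κM M).Vb b, (κM M).Vb b]) ++ [(κM M).SF, (κM M).ST] ++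
        List.replicate pad (κM M).NV) := by
  have hw : (boolPair x []).length = 2 * x.length + 2 := by simp
  have hbp : boolPair x [] = (x.flatMap fun b => [b, b]) ++ [false, true] := by simp [boolPair]
  unfold startBlocks
  rw [map_cellOf_range (M := M) (boolPair x []) (by omega), hw, show 2 * x.length + 2 + pad - (2 * x.length + 2) = pad by omega,
    hbp]
  simp only [List.map_cons, List.map_append, List.map_replicate, List.map_flatMap, List.map_nil,
    List.append_assoc, List.cons_append, List.nil_append]
  rfl

/-- Reversing the reading order gives the fold order. [folklore] -/
theorem reverse_readRow (x : List Bool) (pad : ℕ) :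
    ((κM M).CT :: ((x.flatMap fun b => [(κM M).Vb b, (κM M).Vb b]) ++ [(κM M).SF, (κM M).ST] ++
        List.replicate pad (κM M).NV)).reverse = row0List (κM M) pad x := by
  rw [row0List, List.reverse_cons, List.reverse_append, List.reverse_append, List.reverse_replicate, revDoubled,
    List.reverse_flatMap]
  simp [List.append_assoc, Function.comp_def]

/-- **The start row built by `ROW0` is the stored start row of the empty certificate.**
[cite: GaboardiMarionRonchidellarocca2008, Thm. 3.9 (proof: `Init`)] -/
theorem encRow_start (x : List Bool) (pad : ℕ) :
    encRow ((startBlocks M x [] (2 * x.length + 2 + pad)).map some) = row0List (κM M) pad x := by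
  rw [encRow, List.map_reverse, show (fun u => oneHot (nU M) (eU M u)) = encUt M from rfl, map_enc_startBlocks, reverse_readRow]

/-- The term `R0x = ROW0 PAD̲ x̲` represents the stored start row of the empty certificate.
[cite: GaboardiMarionRonchidellarocca2008, Thm. 3.9 (proof: `Init`)] -/
theorem rowRep_row0 {Pd : Term} {pad : ℕ} (hPd : NumLike Pd pad) (x : List Bool) :
    RowRep ((ROW0 (κM M)).apps [Pd, encWord x]) ((startBlocks M x [] (2 * x.length + 2 + pad)).map some) := by
  unfold RowRep
  rw [encRow_start]
  exact row0_spec (κM M) hPd x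

/-! ### The three summands and the resolved program -/

/-- The summands `W_□, W₀, W₁`. [cite: GaboardiMarionRonchidellarocca2008, Thm. 5.14 (proof: `Tr₁ + ⋯ + Trₙ`)] -/
noncomputable def ws (M : TM2ComputableAux Bool Bool) : List PassC := [wpassO M none, wpassO M (some false), wpassO M (some true)]

/-- The index of a summand. [folklore] -/
def ιw : Option Bool → Fin 3
  | none => 0
  | some false => 1
  | some true => 2

/-- The optional bit of an index. [folklore] -/
def oOf (σ : Fin 3) : Option Bool := if σ = 0 then none else if σ = 1 then some false else some true

/-- Indices name the summands. [folklore] -/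
theorem ws_get (σ : Fin (ws M).length) : (ws M).get σ = wpassO M (oOf ⟨σ.val, σ.isLt⟩) := by
  obtain ⟨σ, hσ⟩ := σ
  have hσ' : σ < 3 := hσ
  match σ, hσ' with
  | 0, _ => rfl
  | 1, _ => rfl
  | 2, _ => rfl

/-- `oOf ∘ ιw = id`. [folklore] -/
theorem oOf_ιw (o : Option Bool) : oOf (ιw o) = o := by
  rcases o with _ | _ | _ <;> rfl

/-- The sum `W_□ + W₀ + W₁`. [cite: GaboardiMarionRonchidellarocca2008, Thm. 5.14 (proof)] -/
noncomputable def SUMW (M : TM2ComputableAux Bool Bool) : Term := sums ((ws M).map PassC.term)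

/-- `SUMW` is closed. [folklore] -/
theorem closed_SUMW : (SUMW M).Closed :=
  closed_sums fun C hC => by obtain ⟨c, -, rfl⟩ := List.mem_map.1 hC; exact c.closed_term

/-- `nestApp` over an appended list. [folklore] -/
theorem nestApp_append (l₁ l₂ : List Term) (X : Term) : nestApp (l₁ ++ l₂) X = nestApp l₁ (nestApp l₂ X) := by
  induction l₁ with
  | nil => rfl
  | cons C l₁ ih => rw [List.cons_append, nestApp, nestApp, ih]

/-- `rounds` over an appended list. [folklore] -/
theorem rounds_append (cs₁ cs₂ : List PassC) (args : List Term) : rounds (cs₁ ++ cs₂) args = rounds cs₂ (rounds cs₁ args) := by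
  induction cs₁ generalizing args with
  | nil => rfl
  | cons c cs₁ ih => rw [List.cons_append, rounds, rounds, ih]

open Classical in
/-- **Semantics of the resolved program**: `T` machine passes over the start row written by the
summands `os`, read by the acceptance spine, `β`-reduce to the answer bit of the run on the
certificate `certOf os`. [cite: GaboardiMarionRonchidellarocca2008, Thm. 5.14 (proof), Thm. 3.9] -/
theorem resolved_spec {Pd : Term} {pad : ℕ} (hPd : NumLike Pd pad) (x : List Bool) (os : List (Option Bool)) (T : ℕ)
    (hos : os.length ≤ pad) (hT : Dly M * T + 2 ≤ 2 * x.length + 3 + pad) :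
    BetaReduces ((nestApp (List.replicate T (castep M).term) (nestApp (os.map fun o => (wpassO M o).term)
        ((ROW0 (κM M)).apps [Pd, encWord x]))).apps (accArgs M))
      (encBit (!decide (absVal (cfgAt M x (certOf os) T) 1 = accVal M))) := by
  have h0 := rowRep_row0 (M := M) hPd x
  have h1 := rowRep_writes x (N := 2 * x.length + 2 + pad) os (by omega) h0
  rw [← procRow_start] at h1
  have h2 := rowRep_castep_iter x (certOf os) T (t := 0) (a := 0) (m := 2 * x.length + 2 + pad + 1) (by omega) h1
  simp only [Nat.zero_add] at h2
  exact accArgs_spec (by omega) h2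

/-! ### The program -/

section Prog

variable (csT csP csPad : List ℕ)

/-- The program body with the term `s` in every copy slot of the input. [cite: GaboardiMarionRonchidellarocca2008, Thm. 5.14 (`NDTM_P`)] -/
noncomputable def progS (s : Term) : Term :=
  (accProg M).app ((hornerS s csT).apps [(castep M).term, (hornerS s csP).apps [SUMW M, (ROW0 (κM M)).apps [hornerS s csPad, s]]])

/-- **The program `M_L = λs. OUT (T̲ CASTEP (P̲ SUMW (ROW0 PAD̲ s)))`.** [cite: GaboardiMarionRonchidellarocca2008, Thm. 5.14 (`NDTM_P`)] -/
noncomputable def prog : Term := .lam (progS (M := M) csT csP csPad (.var 0))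

/-- Substituting the input word into the body. [folklore] -/
theorem progS_subst0 (x : List Bool) :
    (progS (M := M) csT csP csPad (.var 0)).subst0 (encWord x) = progS (M := M) csT csP csPad (encWord x) := by
  obtain ⟨hso, hs0, hbs⟩ := outProg_closed_parts (δA (M := M)) (eA AccSt.start) fun q => decide (eA.symm q = .acc)
  have haP : (accProg M).Closed := by
    rw [accProg, outProg, OUTc, closed_lam]
    exact bnd_apps (by decide) (by
      intro N hN
      simp only [List.mem_cons] at hN
      rcases hN with rfl | rfl | hN
      · exact hso.bnd 1
      · exact hs0.bnd 1
      · exact (hbs N hN).bnd 1)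
  simp [progS, subst0_eq_substp, Term.substp, hornerS_substp, haP.substp_eq, (castep M).closed_term.substp_eq,
    closed_SUMW.substp_eq, (closed_ROW0 (κM M)).substp_eq]

/-- The unfolded program `Q`: numerals unfolded, acceptance spine opened. [folklore] -/
noncomputable def progQ (x : List Bool) : Term :=
  (nestApp (List.replicate (hornerEval x.length csT) (castep M).term)
    (nestApp (List.replicate (hornerEval x.length csP) (SUMW M))
      ((ROW0 (κM M)).apps [hornerS (encWord x) csPad, encWord x]))).apps (accArgs M)

/-- `R0x` is closed. [folklore] -/
theorem closed_R0x (x : List Bool) : ((ROW0 (κM M)).apps [hornerS (encWord x) csPad, encWord x]).Closed := by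
  simp [closed_ROW0, closed_hornerS (closed_encWord x), closed_encWord]

/-- **Advancing the `β`-steps**: `M_L x̲ →β* Q`. [cite: GaboardiMarionRonchidellarocca2008, Thm. 5.14 (proof)] -/
theorem prog_betaReduces (x : List Bool) :
    BetaReduces ((prog (M := M) csT csP csPad).app (encWord x)) (progQ (M := M) csT csP csPad x) := by
  refine (BetaReduces.single (RedB.beta _ _)).trans' ?_
  rw [progS_subst0, progS]
  have hR0 := closed_R0x (M := M) csPad x
  -- unfold the two numerals
  have hP := (numLike_hornerS x csP).2 (SUMW M) _ closed_SUMW hR0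
  have hIn : (iterT (SUMW M) (hornerEval x.length csP) ((ROW0 (κM M)).apps [hornerS (encWord x) csPad, encWord x])).Closed :=
    closed_iterT closed_SUMW hR0 _
  have hTc : ((hornerS (encWord x) csP).apps [SUMW M, (ROW0 (κM M)).apps [hornerS (encWord x) csPad, encWord x]]).Closed := by
    simp [closed_hornerS (closed_encWord x), closed_SUMW, closed_ROW0, closed_encWord]
  have hT := (numLike_hornerS x csT).2 (castep M).term _ (castep M).closed_term hTc
  have hT' := hT.trans' (BetaReduces.iterT_base _ _ hP)
  -- open the acceptance spine
  have hZc : ((hornerS (encWord x) csT).apps [(castep M).term,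
      (hornerS (encWord x) csP).apps [SUMW M, (ROW0 (κM M)).apps [hornerS (encWord x) csPad, encWord x]]]).Closed := by
    simp [closed_hornerS (closed_encWord x), (castep M).closed_term, closed_SUMW, closed_ROW0, closed_encWord]
  refine (accProg_hbStar (M := M) hZc).betaReduces.trans' ?_
  exact hT'.apps_head _

/-- **Deciding by `0`, analysis**: if `M_L x̲` reaches `0`, some certificate `u`, `|u| ≤ P(|x|)`, makes
block `1` of configuration `T(|x|)` accepting. [cite: GaboardiMarionRonchidellarocca2008, Thm. 5.14 (proof), Def. 5.13] -/
theorem exists_cert_of_reduces_zero (x : List Bool)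
    (hpad : hornerEval x.length csP ≤ hornerEval x.length csPad)
    (hT : Dly M * hornerEval x.length csT + 2 ≤ 2 * x.length + 3 + hornerEval x.length csPad)
    (h : Reduces ((prog (M := M) csT csP csPad).app (encWord x)) zero) :
    ∃ u : List Bool, u.length ≤ hornerEval x.length csP ∧ absVal (cfgAt M x u (hornerEval x.length csT)) 1 = accVal M := by
  classical
  have hR0 : ((ROW0 (κM M)).apps [hornerS (encWord x) csPad, encWord x]).Closed := closed_R0x (M := M) csPad x
  -- advance, then leftmost
  have hQ : LmoStar (progQ (M := M) csT csP csPad x) zero :=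
    (reduces_zero_iff_lmoStar _).1 (h.of_betaReduces normal_zero (prog_betaReduces (M := M) csT csP csPad x))
  -- the deterministic rounds of the machine passes
  have hargs : GoodArgs (accArgs M) := goodArgs_accArgs
  have hX : (nestApp (List.replicate (hornerEval x.length csP) (SUMW M))
      ((ROW0 (κM M)).apps [hornerS (encWord x) csPad, encWord x])).Closed :=
    closed_nestApp (fun C hC => by rw [List.eq_of_mem_replicate hC]; exact closed_SUMW) hR0
  have e1 : List.replicate (hornerEval x.length csT) (castep M).term =
      (List.replicate (hornerEval x.length csT) (castep M)).map PassC.term := by simp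
  rw [progQ, e1] at hQ
  have h1 := (det_rounds_zero_iff (List.replicate (hornerEval x.length csT) (castep M)) hX hargs).1 hQ
  -- the choice rounds of the writing passes
  have e2 : SUMW M = sums ((ws M).map PassC.term) := rfl
  rw [e2] at h1
  obtain ⟨σs, hσlen, h2⟩ := choice_rounds_zero (ws M) (by simp [ws]) hR0 (hornerEval x.length csP) (hargs.rounds _) h1
  -- the resolved deterministic program reaches the same spine
  have hmap : σs.map (ws M).get = (σs.map fun σ : Fin (ws M).length => oOf ⟨σ.val, σ.isLt⟩).map (wpassO M) := by
    rw [List.map_map]; exact List.map_congr_left fun σ _ => ws_get σ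
  have h3 := det_rounds (List.replicate (hornerEval x.length csT) (castep M) ++ σs.map (ws M).get) hR0 hargs
  rw [List.map_append, nestApp_append, rounds_append] at h3
  have hZ := h3.lmoStar.trans h2
  -- … and computes the answer bit, which must therefore be `0`
  rw [hmap, List.map_map, ← e1] at hZ
  have hlen : (σs.map fun σ : Fin (ws M).length => oOf ⟨σ.val, σ.isLt⟩).length ≤ hornerEval x.length csPad := by
    rw [List.length_map, hσlen]; exact hpad
  have hspec := resolved_spec (M := M) (numLike_hornerS x csPad) x _ (hornerEval x.length csT) hlen hT
  have hE := (LmoStar.reduces hZ).of_betaReduces normal_zero (by exact hspec)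
  have hnorm : ∀ b : Bool, Normal (encBit b) := fun b => by cases b; exacts [normal_zero, normal_one]
  have hEq := Reduces.eq_of_isNormal hE (hnorm _)
  refine ⟨certOf (σs.map fun σ : Fin (ws M).length => oOf ⟨σ.val, σ.isLt⟩), ?_, ?_⟩
  · exact (length_certOf_le _).trans (by rw [List.length_map, hσlen])
  · by_contra hne
    rw [decide_eq_false hne] at hEq
    simp [encBit, one, zero] at hEq

/-- **Deciding by `0`, synthesis**: a certificate `u`, `|u| ≤ P(|x|)`, with block `1` of configuration
`T(|x|)` accepting, gives a reduction of `M_L x̲` to `0`. [cite: GaboardiMarionRonchidellarocca2008, Thm. 5.14 (proof), Def. 5.13] -/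
theorem reduces_zero_of_cert (x : List Bool)
    (hpad : hornerEval x.length csP ≤ hornerEval x.length csPad)
    (hT : Dly M * hornerEval x.length csT + 2 ≤ 2 * x.length + 3 + hornerEval x.length csPad)
    {u : List Bool} (hu : u.length ≤ hornerEval x.length csP)
    (hacc : absVal (cfgAt M x u (hornerEval x.length csT)) 1 = accVal M) :
    Reduces ((prog (M := M) csT csP csPad).app (encWord x)) zero := by
  classical
  have hR0 : ((ROW0 (κM M)).apps [hornerS (encWord x) csPad, encWord x]).Closed := closed_R0x (M := M) csPad x
  have hargs : GoodArgs (accArgs M) := goodArgs_accArgs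
  obtain ⟨os, hoslen, hcert⟩ := exists_certOf_eq u (P := hornerEval x.length csP) hu
  -- to `Q`, then the deterministic rounds, then the chosen summands
  refine (prog_betaReduces (M := M) csT csP csPad x).reduces.trans ?_
  have hX : (nestApp (List.replicate (hornerEval x.length csP) (SUMW M))
      ((ROW0 (κM M)).apps [hornerS (encWord x) csPad, encWord x])).Closed :=
    closed_nestApp (fun C hC => by rw [List.eq_of_mem_replicate hC]; exact closed_SUMW) hR0
  have e1 : List.replicate (hornerEval x.length csT) (castep M).term =
      (List.replicate (hornerEval x.length csT) (castep M)).map PassC.term := by simp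
  rw [progQ, e1]
  refine (det_rounds (List.replicate (hornerEval x.length csT) (castep M)) hX hargs).reduces.trans ?_
  have hσlen : (os.map fun o => (⟨(ιw o).val, (ιw o).isLt⟩ : Fin (ws M).length)).length = hornerEval x.length csP := by
    rw [List.length_map, hoslen]
  have hmap : (os.map fun o => (⟨(ιw o).val, (ιw o).isLt⟩ : Fin (ws M).length)).map (ws M).get = os.map (wpassO M) := by
    rw [List.map_map]
    refine List.map_congr_left fun o _ => ?_
    rw [Function.comp_apply, ws_get]
    exact congrArg _ (oOf_ιw o)
  have e2 : SUMW M = sums ((ws M).map PassC.term) := rfl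
  have h2 := lmoStar_choice_rounds (ws M) hR0 (os.map fun o => (⟨(ιw o).val, (ιw o).isLt⟩ : Fin (ws M).length))
    (hargs.rounds (List.replicate (hornerEval x.length csT) (castep M)))
  rw [hσlen, ← e2, hmap] at h2
  refine h2.reduces.trans ?_
  -- the resolved program: same spine by head steps, and the answer `0` by `β`; conclude by confluence
  have h3 := det_rounds (List.replicate (hornerEval x.length csT) (castep M) ++
    (os.map fun o => (⟨(ιw o).val, (ιw o).isLt⟩ : Fin (ws M).length)).map (ws M).get) hR0 hargs
  rw [List.map_append, nestApp_append, rounds_append, hmap, List.map_map, ← e1] at h3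
  have hspec := resolved_spec (M := M) (numLike_hornerS x csPad) x os (hornerEval x.length csT) (by rw [hoslen]; exact hpad) hT
  rw [hcert, hacc] at hspec
  simp only [decide_true, Bool.not_true] at hspec
  obtain ⟨Zc, hZ1, hZ2⟩ := BetaReduces.cr h3.betaReduces (by exact hspec)
  rw [normal_zero.eq_of_betaReduces hZ2] at hZ1
  exact hZ1.reduces

end Prog

/-! ### Typing the program -/

/-- Application of an iterator in a context: `P F X` with `⊢ F : A ⊸ A` closed and promoted. [cite: GaboardiMarionRonchidellarocca2008, §3.2, Table 2] -/
theorem typingLe_iterApp_ctx {D : ℕ} {Γ ΓP ΓX : Ctx} {P F X : Term} {i : ℕ} {A : LinTy} (hs : Γ.Split ΓP ΓX)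
    (hP : TypingLe D ΓP P ⟨0, Nty i⟩) (hFi : ∃ D₀, D₀ + i ≤ D ∧ TypingLe D₀ Ctx.empty F ⟨0, .limp 0 A A⟩)
    (hX : TypingLe D ΓX X ⟨0, A⟩) : TypingLe D Γ (P.apps [F, X]) ⟨0, A⟩ := by
  simp only [apps_cons, apps_nil]
  refine TypingLe.app hs (TypingLe.app (Ctx.Split.all_left _) (k := i) (B := .limp 0 A A) ?_ ?_) hX
  · have := hP.allE A; rwa [inst_Nty_body] at this
  · obtain ⟨D₀, hD₀, hF₀⟩ := hFi
    have := hF₀.spN_empty i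
    rw [Nat.zero_add] at this
    exact this.mono hD₀

/-- Union of two contexts (meaningful on disjoint supports). [folklore] -/
def orC (Γ Δ : Ctx) : Ctx := fun x => (Γ x).or (Δ x)

/-- Disjoint contexts split their union. [folklore] -/
theorem split_orC {Γ Δ : Ctx} (h : ∀ x, Γ x = none ∨ Δ x = none) : (orC Γ Δ).Split Γ Δ := by
  intro x
  rcases h x with hx | hx
  · right; simp [orC, hx]
  · left; simp [orC, hx]

/-- Free indices of the Horner term with copies from slot `v`. [folklore] -/
theorem bnd_hornerV : ∀ (v : ℕ) (cs : List ℕ), (hornerV v cs).bnd (v + cs.length) = true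
  | v, [] => (closed_church 0).bnd _
  | v, c :: cs => by
    rw [hornerV, List.length_cons]
    refine bnd_apps (closed_add.bnd _) ?_
    intro N hN
    simp only [List.mem_cons, List.not_mem_nil, or_false] at hN
    rcases hN with rfl | rfl
    · exact (closed_church c).bnd _
    · refine bnd_apps (closed_mult.bnd _) ?_
      intro N hN
      simp only [List.mem_cons, List.not_mem_nil, or_false] at hN
      rcases hN with rfl | rfl
      · simp only [bnd_app, closed_lenC.bnd, bnd_var, Bool.true_and, decide_eq_true_eq]; omega
      · have := bnd_hornerV (v + 1) cs
        rw [show v + 1 + cs.length = v + (cs.length + 1) by omega] at this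
        exact this

section Typing

variable (csT csP csPad : List ℕ)

/-- The program body with the copies of the input in distinct slots: the input of `ROW0` in slot
`1`, the copies of `T̲` from slot `2`, of `P̲` after them, of `PAD̲` after those. [folklore] -/
noncomputable def progV : Term :=
  (accProg M).app ((hornerV 2 csT).apps [(castep M).term,
    (hornerV (2 + csT.length) csP).apps [SUMW M, (ROW0 (κM M)).apps [hornerV (2 + csT.length + csP.length) csPad, .var 1]]])

/-- Merging all copy slots onto slot `0` gives the program body. [folklore] -/
theorem progV_rename (S : Finset ℕ) (hS : ∀ x, x ∈ S ↔ 1 ≤ x ∧ x < 2 + csT.length + csP.length + csPad.length) :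
    (progV (M := M) csT csP csPad).rename (mpxRen S 0) = progS (M := M) csT csP csPad (.var 0) := by
  obtain ⟨hso, hs0, hbs⟩ := outProg_closed_parts (δA (M := M)) (eA AccSt.start) fun q => decide (eA.symm q = .acc)
  have haP : (accProg M).Closed := by
    rw [accProg, outProg, OUTc, closed_lam]
    exact bnd_apps (by decide) (by
      intro N hN
      simp only [List.mem_cons] at hN
      rcases hN with rfl | rfl | hN
      · exact hso.bnd 1
      · exact hs0.bnd 1
      · exact (hbs N hN).bnd 1)
  have hρ : ∀ y, 1 ≤ y → y < 2 + csT.length + csP.length + csPad.length → mpxRen S 0 y = 0 := fun y h1 h2 => by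
    simp [mpxRen, (hS y).2 ⟨h1, h2⟩]
  simp only [progV, progS, Term.rename, rename_apps, List.map_cons, List.map_nil, haP.rename_eq, (castep M).closed_term.rename_eq,
    closed_SUMW.rename_eq, (closed_ROW0 (κM M)).rename_eq]
  rw [hornerV_rename _ 0 2 csT (fun t ht => hρ _ (by omega) (by omega)),
    hornerV_rename _ 0 (2 + csT.length) csP (fun t ht => hρ _ (by omega) (by omega)),
    hornerV_rename _ 0 (2 + csT.length + csP.length) csPad (fun t ht => hρ _ (by omega) (by omega)),
    hρ 1 le_rfl (by omega)]

/-- The row index used by the program. [folklore] -/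
def jR : ℕ := jRow (2 * csPad.length + 1)

/-- A generous degree bound. [folklore] -/
def Dtot : ℕ := 2 * (csT.length + csP.length + csPad.length) + 8

/-- The level of the program: one more than the maximal modality of a copy. [folklore] -/
def lev : ℕ := max csT.length (max csP.length csPad.length) + 1

/-- **Typing of the body with distinct copies.** [cite: GaboardiMarionRonchidellarocca2008, Thm. 5.14 (proof), Table 2] -/
theorem typingLe_progV :
    TypingLe (Dtot csT csP csPad)
      (orC (hctx 2 csT.length) (orC (hctx (2 + csT.length) csP.length)
        (orC (hctx (2 + csT.length + csP.length) csPad.length) (fun x => if x = 1 then some ⟨0, tyS 1⟩ else none))))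
      (progV (M := M) csT csP csPad) ⟨0, tyB⟩ := by
  set LT := csT.length
  set LP := csP.length
  set LPad := csPad.length
  set U : LinTy := tyE (nU M)
  have hj : jR csPad = max (2 * LPad + 1) 2 + 1 := rfl
  have hDt : Dtot csT csP csPad = 2 * (LT + LP + LPad) + 8 := rfl
  -- ROW0 PAD s
  have hR0 : TypingLe (Dtot csT csP csPad)
      (orC (hctx (2 + LT + LP) LPad) (fun x => if x = 1 then some ⟨0, tyS 1⟩ else none))
      ((ROW0 (κM M)).apps [hornerV (2 + LT + LP) csPad, .var 1]) ⟨0, Rty (jR csPad) U⟩ := by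
    simp only [apps_cons, apps_nil]
    refine TypingLe.app (k := 0) (B := tyS 1) (split_orC fun x => ?_)
      (TypingLe.app (k := 0) (B := Nty (2 * LPad + 1)) (Ctx.Split.all_right _) ?_ ?_) ?_
    · by_cases hx : x = 1
      · left; subst hx; simp only [hctx]; rw [if_neg (by omega)]
      · right; simp [hx]
    · exact (typingLe_ROW0 (κM M) (2 * LPad + 1)).mono (by rw [hDt]; omega)
    · exact (typingLe_hornerV (2 + LT + LP) csPad).mono (by rw [hDt]; omega)
    · exact ⟨0, Nat.zero_le _, typing_var_single 1 0 (tyS 1)⟩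
  -- P̲ SUMW (ROW0 …)
  have hSUM : TypingLe (jR csPad) Ctx.empty (SUMW M) ⟨0, .limp 0 (Rty (jR csPad) U) (Rty (jR csPad) U)⟩ :=
    typingLe_sums (by simp [ws]) fun C hC => by
      obtain ⟨c, hc, rfl⟩ := List.mem_map.1 hC
      simp only [ws, List.mem_cons, List.not_mem_nil, or_false] at hc
      rcases hc with rfl | rfl | rfl <;> exact typingLe_wpassO _ _
  have hPit : TypingLe (Dtot csT csP csPad)
      (orC (hctx (2 + LT) LP) (orC (hctx (2 + LT + LP) LPad) (fun x => if x = 1 then some ⟨0, tyS 1⟩ else none)))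
      ((hornerV (2 + LT) csP).apps [SUMW M, (ROW0 (κM M)).apps [hornerV (2 + LT + LP) csPad, .var 1]]) ⟨0, Rty (jR csPad) U⟩ := by
    refine typingLe_iterApp_ctx (i := 2 * LP + 1) (split_orC fun x => ?_) ((typingLe_hornerV (2 + LT) csP).mono (by rw [hDt]; omega))
      ⟨jR csPad, by rw [hj, hDt]; omega, hSUM⟩ hR0
    simp only [hctx, orC]
    by_cases h1 : 2 + LT ≤ x ∧ x < 2 + LT + LP
    · right
      rw [if_neg (by omega)]
      simp [show x ≠ 1 by omega]
    · left; rw [if_neg h1]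
  -- T̲ CASTEP (…)
  have hTit : TypingLe (Dtot csT csP csPad)
      (orC (hctx 2 LT) (orC (hctx (2 + LT) LP) (orC (hctx (2 + LT + LP) LPad) (fun x => if x = 1 then some ⟨0, tyS 1⟩ else none))))
      ((hornerV 2 csT).apps [(castep M).term,
        (hornerV (2 + LT) csP).apps [SUMW M, (ROW0 (κM M)).apps [hornerV (2 + LT + LP) csPad, .var 1]]]) ⟨0, Rty (jR csPad) U⟩ := by
    refine typingLe_iterApp_ctx (i := 2 * LT + 1) (split_orC fun x => ?_) ((typingLe_hornerV 2 csT).mono (by rw [hDt]; omega))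
      ⟨jR csPad, by rw [hj, hDt]; omega, typingLe_castep (M := M) (jR csPad)⟩ hPit
    simp only [hctx, orC]
    by_cases h1 : 2 ≤ x ∧ x < 2 + LT
    · right
      rw [if_neg (by omega), if_neg (by omega)]
      simp [show x ≠ 1 by omega]
    · left; rw [if_neg h1]
  -- OUT (…)
  rw [progV]
  exact TypingLe.app (Ctx.Split.all_right _) ((typingLe_accProg (M := M) (jR csPad)).mono (by rw [hj, hDt]; omega)) hTit

/-- The joint context of all copies, in closed form. [folklore] -/
def progCtx : Ctx := fun x =>
  if x = 1 then some ⟨0, tyS 1⟩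
  else if 2 ≤ x ∧ x < 2 + csT.length then some ⟨x - 2, tyS 1⟩
  else if 2 + csT.length ≤ x ∧ x < 2 + csT.length + csP.length then some ⟨x - (2 + csT.length), tyS 1⟩
  else if 2 + csT.length + csP.length ≤ x ∧ x < 2 + csT.length + csP.length + csPad.length then
    some ⟨x - (2 + csT.length + csP.length), tyS 1⟩ else none

/-- The joint context is the union of the graded contexts. [folklore] -/
theorem progCtx_eq : orC (hctx 2 csT.length) (orC (hctx (2 + csT.length) csP.length)
      (orC (hctx (2 + csT.length + csP.length) csPad.length) (fun x => if x = 1 then some ⟨0, tyS 1⟩ else none))) =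
    progCtx csT csP csPad := by
  funext x
  simp only [orC, hctx, progCtx]
  by_cases h1 : x = 1
  · subst h1
    have c3 : ¬ (2 + csT.length ≤ 1 ∧ 1 < 2 + csT.length + csP.length) := by omega
    have c4 : ¬ (2 + csT.length + csP.length ≤ 1 ∧ 1 < 2 + csT.length + csP.length + csPad.length) := by omega
    simp [c3, c4]
  · by_cases h2 : 2 ≤ x ∧ x < 2 + csT.length
    · simp [h1, h2]
    · by_cases h3 : 2 + csT.length ≤ x ∧ x < 2 + csT.length + csP.length
      · simp [h1, h2, h3]
      · by_cases h4 : 2 + csT.length + csP.length ≤ x ∧ x < 2 + csT.length + csP.length + csPad.length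
        · simp [h1, h2, h3, h4]
        · simp [h1, h2, h3, h4]

/-- **Typing of the program**: `⊢ M_L : !ⁿ S₁ ⊸ B` with `n = lev`. [cite: GaboardiMarionRonchidellarocca2008, Thm. 5.14, Table 2 (m)] -/
theorem typing_prog : ∃ d ≤ Dtot csT csP csPad,
    Typing d Ctx.empty (prog (M := M) csT csP csPad) (progTy (lev csT csP csPad) 1) := by
  classical
  have h1 := typingLe_progV (M := M) csT csP csPad
  rw [progCtx_eq] at h1
  set S : Finset ℕ := (Finset.range (2 + csT.length + csP.length + csPad.length)).filter (fun x => 1 ≤ x) with hSdef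
  have hS : ∀ x, x ∈ S ↔ 1 ≤ x ∧ x < 2 + csT.length + csP.length + csPad.length := fun x => by
    simp [hSdef, Finset.mem_filter, and_comm]
  have h2 := h1.merge_slots S 0
    (fun x => if 2 ≤ x ∧ x < 2 + csT.length then x - 2
      else if 2 + csT.length ≤ x ∧ x < 2 + csT.length + csP.length then x - (2 + csT.length)
      else if 2 + csT.length + csP.length ≤ x ∧ x < 2 + csT.length + csP.length + csPad.length then x - (2 + csT.length + csP.length)
      else 0)
    (max csT.length (max csP.length csPad.length)) (tyS 1) (fun x hx => by
      obtain ⟨hx1, hx2⟩ := (hS x).1 hx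
      by_cases e1 : x = 1
      · subst e1
        have c3 : ¬ (2 + csT.length ≤ 1 ∧ 1 < 2 + csT.length + csP.length) := by omega
        have c4 : ¬ (2 + csT.length + csP.length ≤ 1 ∧ 1 < 2 + csT.length + csP.length + csPad.length) := by omega
        simp [progCtx, c3, c4]
      · by_cases e2 : 2 ≤ x ∧ x < 2 + csT.length
        · simp [progCtx, e1, e2]; omega
        · by_cases e3 : 2 + csT.length ≤ x ∧ x < 2 + csT.length + csP.length
          · simp [progCtx, e1, e2, e3]; omega
          · have e4 : 2 + csT.length + csP.length ≤ x ∧ x < 2 + csT.length + csP.length + csPad.length := by omega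
            simp [progCtx, e1, e2, e3, e4]; omega)
    (by simp only [progCtx]; rw [if_neg (by omega), if_neg (by omega), if_neg (by omega), if_neg (by omega)])
    (by simp [hS]) (2 + csT.length + csP.length + csPad.length)
    (by simp only [progCtx]; rw [if_neg (by omega), if_neg (by omega), if_neg (by omega), if_neg (by omega)])
    (by simp [hS]) ?_
  · rw [progV_rename (M := M) csT csP csPad S hS] at h2
    have ectx : (fun x => if x = 0 then some ⟨max csT.length (max csP.length csPad.length) + 1, tyS 1⟩
        else if x ∈ S then none else progCtx csT csP csPad x) = Ctx.cons (some ⟨lev csT csP csPad, tyS 1⟩) Ctx.empty := by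
      funext x
      cases x with
      | zero => rfl
      | succ x =>
        simp only [Nat.succ_ne_zero, if_false, Ctx.cons, Ctx.empty]
        by_cases hx : x + 1 ∈ S
        · rw [if_pos hx]
        · rw [if_neg hx]
          have : ¬ (1 ≤ x + 1 ∧ x + 1 < 2 + csT.length + csP.length + csPad.length) := fun h' => hx ((hS _).2 h')
          simp only [progCtx]
          rw [if_neg (by omega), if_neg (by omega), if_neg (by omega), if_neg (by omega)]
    rw [ectx] at h2
    obtain ⟨d, hd, h2⟩ := h2
    exact ⟨d, hd, Typing.lam h2⟩
  · -- the bound slot is not free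
    intro hmem
    have hb : (progV (M := M) csT csP csPad).bnd (2 + csT.length + csP.length + csPad.length) = true := by
      obtain ⟨hso, hs0, hbs⟩ := outProg_closed_parts (δA (M := M)) (eA AccSt.start) fun q => decide (eA.symm q = .acc)
      have haP : (accProg M).Closed := by
        rw [accProg, outProg, OUTc, closed_lam]
        exact bnd_apps (by decide) (by
          intro N hN
          simp only [List.mem_cons] at hN
          rcases hN with rfl | rfl | hN
          · exact hso.bnd 1
          · exact hs0.bnd 1
          · exact (hbs N hN).bnd 1)
      rw [progV, bnd_app]
      simp only [Bool.and_eq_true]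
      refine ⟨haP.bnd _, bnd_apps (bnd_mono (bnd_hornerV 2 csT) (by omega)) ?_⟩
      intro N hN
      simp only [List.mem_cons, List.not_mem_nil, or_false] at hN
      rcases hN with rfl | rfl
      · exact (castep M).closed_term.bnd _
      · refine bnd_apps (bnd_mono (bnd_hornerV (2 + csT.length) csP) (by omega)) ?_
        intro N hN
        simp only [List.mem_cons, List.not_mem_nil, or_false] at hN
        rcases hN with rfl | rfl
        · exact closed_SUMW.bnd _
        · refine bnd_apps ((closed_ROW0 (κM M)).bnd _) ?_
          intro N hN
          simp only [List.mem_cons, List.not_mem_nil, or_false] at hN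
          rcases hN with rfl | rfl
          · exact bnd_mono (bnd_hornerV (2 + csT.length + csP.length) csPad) (by omega)
          · simp only [bnd_var, decide_eq_true_eq]; omega
    exact absurd (lt_of_bnd hb _ hmem) (lt_irrefl _)

end Typing

/-! ### The theorem -/

/-- The polynomials of the construction: certificate length `p`, time `c (2n + 2 + p(n))^k + c`,
padding `p + D · T + 2`. [folklore] -/
theorem exists_lists (p : Polynomial ℕ) (c k : ℕ) (D : ℕ) :
    ∃ csP csT csPad : List ℕ, ∀ n : ℕ,
      hornerEval n csP = p.eval n ∧
      hornerEval n csT = c * (2 * n + 2 + p.eval n) ^ k + c ∧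
      hornerEval n csPad = p.eval n + D * (c * (2 * n + 2 + p.eval n) ^ k + c) + 2 := by
  obtain ⟨csP, hP⟩ := exists_hornerEval_eq_eval p
  set pT : Polynomial ℕ := Polynomial.C c * (Polynomial.C 2 * Polynomial.X + Polynomial.C 2 + p) ^ k + Polynomial.C c with hpT
  have hTe : ∀ n, pT.eval n = c * (2 * n + 2 + p.eval n) ^ k + c := fun n => by simp [hpT]
  obtain ⟨csT, hT⟩ := exists_hornerEval_eq_eval pT
  set pPad : Polynomial ℕ := p + Polynomial.C D * pT + Polynomial.C 2 with hpPad
  have hPe : ∀ n, pPad.eval n = p.eval n + D * (c * (2 * n + 2 + p.eval n) ^ k + c) + 2 := fun n => by simp [hpPad, hTe]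
  obtain ⟨csPad, hPad⟩ := exists_hornerEval_eq_eval pPad
  exact ⟨csP, csT, csPad, fun n => ⟨hP n, by rw [hT, hTe], by rw [hPad, hPe]⟩⟩

/-- **GMR08 Theorem 5.14 (NP-completeness of `STA₊`) on the tree's classes**: every language of
`NP` is soft-sum-representable at some level. [cite: GaboardiMarionRonchidellarocca2008, Thm. 5.14 (with Def. 5.13)] -/
theorem exists_softSum_of_mem_NP {L : Language Bool} (hL : L ∈ Nondeterministic.NP) : ∃ t : ℕ, SoftSumRepresentsAtLevel t L := by
  classical
  obtain ⟨L', hL'P, p, hLp⟩ := hL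
  -- unpack `L' ∈ P`: a machine deciding `L'` in time `c n^k + c`
  simp only [Classes.P, Set.mem_iUnion, DTIME, Set.mem_setOf_eq, TimeClass, TimeDecidable] at hL'P
  obtain ⟨k, c, Mach, hMach⟩ := hL'P
  have hrun : ∀ w : List Bool, Mach.OutputsWithin w [L'.boolIndicator w] (c * w.length ^ k + c) := fun w => hMach w
  obtain ⟨csP, csT, csPad, hcs⟩ := exists_lists p c k (Dly Mach)
  obtain ⟨d, hd, htyp⟩ := typing_prog (M := Mach) csT csP csPad
  refine ⟨max d (lev csT csP csPad), prog (M := Mach) csT csP csPad, d, lev csT csP csPad, 1, le_max_left _ _, le_max_right _ _,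
    le_rfl, htyp, fun x => ?_⟩
  obtain ⟨hP, hT, hPad⟩ := hcs x.length
  have hpad : hornerEval x.length csP ≤ hornerEval x.length csPad := by rw [hP, hPad]; omega
  have hTb : Dly Mach * hornerEval x.length csT + 2 ≤ 2 * x.length + 3 + hornerEval x.length csPad := by
    rw [hT, hPad]; omega
  -- block `1` accepting ⟺ the verifier accepts, for certificates within the bound
  have hacc : ∀ u : List Bool, u.length ≤ p.eval x.length →
      (absVal (cfgAt Mach x u (hornerEval x.length csT)) 1 = accVal Mach ↔ boolPair x u ∈ L') := by
    intro u hu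
    have hw : Mach.OutputsWithin (boolPair x u) [L'.boolIndicator (boolPair x u)] (hornerEval x.length csT) := by
      refine (hrun (boolPair x u)).mono ?_
      rw [hT, length_boolPair]
      have : (2 * x.length + 2 + u.length) ^ k ≤ (2 * x.length + 2 + p.eval x.length) ^ k :=
        Nat.pow_le_pow_left (by omega) k
      nlinarith
    rw [absVal_one_eq_accVal_iff hw, ← Set.mem_iff_boolIndicator]
    exact Iff.rfl
  rw [hLp x]
  constructor
  · rintro ⟨u, hu, hmem⟩
    exact reduces_zero_of_cert (M := Mach) csT csP csPad x hpad hTb (by rw [hP]; exact hu) ((hacc u hu).2 hmem)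
  · intro hred
    obtain ⟨u, hu, haccu⟩ := exists_cert_of_reduces_zero (M := Mach) csT csP csPad x hpad hTb hred
    rw [hP] at hu
    exact ⟨u, hu, (hacc u hu).1 haccu⟩

end TabCA

end STA

end Literature.Computability.ImplicitComplexity
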